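import Literature.NumberTheory.LFunctions.LargeValuesAffineFourier
import Literature.NumberTheory.Sieve.DivisorBound
import Mathlib.Analysis.SpecialFunctions.ImproperIntegrals
import HarnessLib

/-!
# Sums over affine transformations: Guth–Maynard Lemma 9.2 and Proposition 9.1

Topic `NumberTheory/LFunctions`, family RH. Continuation of `LargeValuesAffineTools.lean` and
`LargeValuesAffineFourier.lean` in the programme around the tree's named fact
`Literature.NumberTheory.LFunctions.zeroDensity_guth_maynard` (L. Guth, J. Maynard, *New large value
estimates for Dirichlet polynomials*, Ann. of Math. 203 (2026)). This file PROVES Lemma 9.2 and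
Proposition 9.1 of the paper (the equidistribution of `∑ f((m₁u+m₃)/m₂)`), in three parts that were
developed as separate units and are kept as Parts A–C below (each with its own overview).

No named fact is introduced; everything in this file is proved. Definitions (with bodies):
`psi1c`, `ktil`, `nearPairs`, `PsiF` (Part A), `rhoT`, `fsm`, `Zsum` (Part B).

## Part A — the kernel, the near pairs `(m₁, ℓ)`, and the `ξ`-integral (eqs. (9.6)–(9.12))

Part A proves (§§1–3: the Fourier-side tools; §§4–6: the integration over `ξ`, eqs. (9.7)–(9.12):
`Ψ(x) = ∑_{m₂} |m₂| f̂(m₂x)` (`PsiF`), `Φ_{m₁}(m₁x) = |Ψ(x)|/|m₁|`, `∫|Ψ|² ≤ 72M₂³‖f‖₂²`, the pointwise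
bounds `Φ ≤ 12M₂²‖f‖₁/M₁`, `Φ ≤ 192T^{10}A|ξ|^{-4}`, the substitution `ξ = m₁x`, and
`∫ g² ≤ C K²T^η M⁶‖f‖₁² + 6 S_II (∫ ktil(x)|Ψ(x)|²dx + ε_t ∫|Ψ|²) + C K² T^{-8}‖f‖₁²`
(`integral_gfun_sq_le`)):

* §1 the combined decay `|ψ̂₁(y)| ≤ K_j(1+|y|)^{-j}` of the fixed bump (`exists_psi1_fourier_decay`);
* §2 the **truncated periodised kernel** `ktil L M₃' x = ∑_{|ℓ|≤3L} ψ₁(ℓ/L) M₃'|ψ̂₁(M₃'(ℓ−x))|` (a finite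
  sum, continuous in `x`) with `perK ≤ ktil + 8K_jM₃'T^{2−j}` on `|x| ≤ T⁶` when `L ≥ T⁶ + T`
  (`perK_le_ktil_add`) and `ktil ≤ 8KM₃'` (`ktil_le`);
* §3 **the region `T^ηM₁/M₃' < |ξ| ≤ T⁶`** (eq. (9.11) and the sentences after it): the count of the
  pairs `(m₁, ℓ)` with `M₃'|ℓ − ξ/m₁| ≤ Y` through `s = m₁ℓ ≠ 0` and the divisor bound
  (`card_nearPairs_le`), and the bound
  `∑_{m₁∈I₁} perK ψ̂₁ M₃' (ξ/m₁) ≤ C T^η (M₁ + M₃')` (`sum_perK_le_regionII`; "the number of terms in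
  the outer double sum is `⪅ 1 + M₁/M₃`").

## Part B — the second Poisson summation and the smoothing `f̃` (eqs. (9.13)–(9.16))

Part A reduced `∫ g²` to the quantity `Q̃ = ∫ ktil L M₃' x · |Ψ(x)|² dx` (`Ψ(x) = ∑_{m₂} |m₂| f̂(m₂x)`).
Part B proves the bound for `Q̃` (eqs. (9.13)–(9.16) of the paper):

* §1 the smoothing kernel `rhoT` (`ρ_T(z) = 2LM₂K'(1+LM₂|z|)^{-j} · 1_{|z| ≤ T^{-2}}`, a non-negative
  bounded compactly supported kernel dominating all the `u'`-kernels `L|ψ̂₁(L(k+m₂u−m₂'u'))|` up to the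
  factor `1/|m₂'|`, `kernel_le_rhoT`) and the smoothed function **`fsm = ρ_T ⋆ f`** (the paper's `f̃`;
  `fsm_apply`, `fsm_nonneg`, `fsm_eq_zero_of_notMem`, `fsm_contDiff`, `integral_fsm`, `integral_rhoT_le`);
* §2 the expansion `|Ψ(z)|² = ∑_{m₂,m₂'} |m₂m₂'| ∫∫ f(u)f(u') e(−z(m₂u−m₂'u')) du du'` (`normSq_PsiF_eq`), the
  second Poisson summation `Z(w) = ∑_ℓ ψ₁(ℓ/L)e(−ℓw) = ∑_k Lψ̂₁(L(k+w))` with `|Z(w)| ≤ perK ψ̂₁ L (−w)`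
  (`norm_Zsum_le`), and the pointwise bound for `B(y) = ∑_ℓ ψ₁(ℓ/L)|Ψ(ℓ − y/M₃')|²` (`Bfun_le`);
* §3 **`Q̃ ≤ 4K (2M₂ ‖f‖₂ J(f̃; I₂, I₂, K₁)^{1/2} + negligible)`** (`Qtil_le`): the `ℓ`-sum out of the
  integral, the substitution `x = ℓ − y/M₃'`, `Bfun_le`, the `u'`-kernel domination, the reduction of the
  `k`-range to `|k| ≤ K₁` (`K₁ ≥ 1026M₂`) on the support of `f`, and Cauchy–Schwarz
  ("Now we apply Cauchy–Schwarz to get (9.16)").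

## Part C — Lemma 9.2 assembled and Proposition 9.1 by iteration

Part C proves:

* §1 the comparison `J(f) ≤ ∫ g²` and the trivial bound `J(f) ≤ 6·10⁶ M⁷ ‖f‖₂²` (Remark after
  Proposition 9.1: "By a simple Cauchy–Schwarz argument …");
* §2 the behaviour of the class of admissible `f` under the smoothing `f ↦ f̃ = ρ_T ⋆ f`:
  `‖f̃‖₁ = ‖ρ_T‖₁‖f‖₁`, `‖f̃‖₂ ≤ ‖ρ_T‖₁‖f‖₂`, `|𝓕f̃| ≤ ‖ρ_T‖₁|𝓕f|` ("`f̃` has Fourier transform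
  `f̂(ξ)ψ̂(ξ/T)`, so also satisfies the rapid decay assumption");
* §3 **Lemma 9.2** in assembled quantitative form (`J_step`):
  `J(f; I₁,I₂,M₃) ≤ 𝔄 T^η M⁶ ‖f‖₁² + 𝔅 T^η M² ‖f‖₂ J(f̃; I₂,I₂,K₁)^{1/2} + ℭ T^{-8}(‖f‖₁² + ‖f‖₂²)`,
  combining `integral_gfun_sq_le` (regions I–III), `sum_perK_le_regionII` and `Qtil_le`;
* §4 **Proposition 9.1** (`affine_equidistribution`): for every `η > 0` there are `C, T₀` such that
  for `T ≥ T₀`, `1 ≤ M ≤ T`, every smooth `f ≥ 0` supported in `[1/16, 9/2]` with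
  `|f̂(ζ)| ≤ T²‖f‖₁(T/|ζ|)⁴` (`ζ ≠ 0`), and every configuration `I₁ ⊂ {M₁ ≤ |m| ≤ 2M₁}`,
  `I₂ ⊂ {M₂ ≤ |m| ≤ 2M₂}`, `M₁, M₂ ≤ M`, `M₃ ≤ 23M`:
  `J(f; I₁, I₂, M₃) ≤ C T^η (M⁶ ‖f‖₁² + M⁴ ‖f‖₂²)` — by `k₀ = ⌈9/η⌉` applications of Lemma 9.2 starting
  from the trivial bound (the paper's "downwards induction on `ε`"; `J_iterate`), with exponents
  `a_d = 2η/3 + 3·2^{-d}` (so `a_{d+1} = η/3 + a_d/2`) and constants `Γ^d · 6·10⁶`.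

## References

* L. Guth, J. Maynard, *New large value estimates for Dirichlet polynomials*, Ann. of Math. (2)
  203 (2026), no. 2; arXiv:2405.20552 (2024): §9 (Lemma 9.2, eqs. (9.1)–(9.15); Proposition 9.1 and
  its proof).
-/

noncomputable section

open Real Set Filter Topology Complex MeasureTheory Finset
open scoped FourierTransform ContDiff Convolution

namespace Literature.NumberTheory.LFunctions

namespace GuthMaynardAffine

open GuthMaynardFourier GuthMaynardS3 GuthMaynardSmoothR

/-! # Part A — the kernel, the near pairs, and the `ξ`-integral -/


/-! ## §1. The Fourier decay of `ψ₁` -/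

/-- The complexified bump `ψ₁`. [folklore] -/
def psi1c : ℝ → ℂ := fun x ↦ ((psi1 x : ℝ) : ℂ)

/-- `ψ₁` (complexified) is smooth. [folklore] -/
theorem psi1c_contDiff : ContDiff ℝ ∞ psi1c := Complex.ofRealCLM.contDiff.comp psi1_contDiff

/-- `ψ₁` (complexified) has compact support. [folklore] -/
theorem psi1c_hasCompactSupport : HasCompactSupport psi1c := psi1_hasCompactSupport.comp_left Complex.ofReal_zero

/-- **Combined decay `|ψ̂₁(y)| ≤ K(1+|y|)^{-j}`** for every `j`. [folklore] -/
theorem exists_psi1_fourier_decay (j : ℕ) : ∃ K, 0 ≤ K ∧ ∀ y : ℝ, ‖𝓕 psi1c y‖ ≤ K / (1 + |y|) ^ j := by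
  obtain ⟨K, hK0, hKb, hKd⟩ := GuthMaynardRFunction.fourier_decay psi1c_contDiff psi1c_hasCompactSupport j
  refine ⟨2 ^ j * (K + K), by positivity, fun y ↦ ?_⟩
  have h1y : 1 ≤ 1 + |y| := by have := abs_nonneg y; linarith
  by_cases hy : |y| ≤ 1
  · have h2 : (1 + |y|) ^ j ≤ 2 ^ j := pow_le_pow_left₀ (by positivity) (by linarith) j
    rw [le_div_iff₀ (by positivity)]
    calc ‖𝓕 psi1c y‖ * (1 + |y|) ^ j ≤ K * 2 ^ j := mul_le_mul (hKb y) h2 (by positivity) hK0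
      _ ≤ 2 ^ j * (K + K) := by nlinarith [pow_nonneg (zero_le_two (α := ℝ)) j]
  · push Not at hy
    have hy0 : y ≠ 0 := by intro h; rw [h, abs_zero] at hy; linarith
    have h2 := hKd y hy0
    refine h2.trans ?_
    rw [div_le_div_iff₀ (by positivity) (by positivity)]
    have h4 : (1 + |y|) ^ j ≤ 2 ^ j * |y| ^ j := by
      rw [← mul_pow]; exact pow_le_pow_left₀ (by positivity) (by linarith) j
    have h5 : 0 ≤ 2 ^ j * K * |y| ^ j := by positivity
    calc K * (1 + |y|) ^ j ≤ K * (2 ^ j * |y| ^ j) := mul_le_mul_of_nonneg_left h4 hK0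
      _ ≤ 2 ^ j * (K + K) * |y| ^ j := by linarith

/-! ## §2. The truncated periodised kernel -/

/-- The truncated periodised kernel with smooth weights
`ktil L M₃' x = ∑_{|ℓ| ≤ 3L} ψ₁(ℓ/L) M₃' |ψ̂₁(M₃'(ℓ − x))|` (a finite sum majorising the `ℓ`-sum of
(9.6) on `|ℓ| ≤ 2L`, and ready for the second Poisson summation of the proof).
[cite: GuthMaynard2026, proof of Lemma 9.2] -/
def ktil (L : ℕ) (M₃' x : ℝ) : ℝ :=
  ∑ ℓ ∈ Finset.Icc (-(3 * L : ℤ)) (3 * L), psi1 ((ℓ : ℝ) / L) * (M₃' * ‖𝓕 psi1c (M₃' * (ℓ - x))‖)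

/-- `ktil ≥ 0`. [folklore] -/
theorem ktil_nonneg (L : ℕ) {M₃' : ℝ} (_hM : 0 ≤ M₃') (x : ℝ) : 0 ≤ ktil L M₃' x :=
  Finset.sum_nonneg fun ℓ _ ↦ mul_nonneg (psi1_nonneg _) (by positivity)

/-- `ktil` is continuous in `x`. [folklore] -/
theorem ktil_continuous (L : ℕ) (M₃' : ℝ) : Continuous (ktil L M₃') := by
  unfold ktil
  refine continuous_finsetSum _ fun ℓ _ ↦ continuous_const.mul (continuous_const.mul ?_)
  have hc : Continuous (𝓕 psi1c) :=
    VectorFourier.fourierIntegral_continuous Real.continuous_fourierChar (by exact continuous_inner)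
      ((psi1c_contDiff.continuous).integrable_of_hasCompactSupport psi1c_hasCompactSupport)
  exact (hc.comp (continuous_const.mul (continuous_const.sub continuous_id))).norm

/-- **`ktil ≤ 8KM₃'`** (`|ψ̂₁(y)| ≤ K(1+|y|)^{-2}`, `M₃' ≥ 1`). [cite: GuthMaynard2026, proof of Lemma 9.2] -/
theorem ktil_le {K : ℝ} (hK : 0 ≤ K) (hΦ : ∀ y, ‖𝓕 psi1c y‖ ≤ K / (1 + |y|) ^ 2) (L : ℕ) {M₃' : ℝ}
    (hM : 1 ≤ M₃') (x : ℝ) : ktil L M₃' x ≤ 8 * K * M₃' := by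
  have hM0 : 0 < M₃' := by linarith
  calc ktil L M₃' x ≤ ∑ ℓ ∈ Finset.Icc (-(3 * L : ℤ)) (3 * L), M₃' * ‖𝓕 psi1c (M₃' * (ℓ - x))‖ := by
        refine Finset.sum_le_sum fun ℓ _ ↦ ?_
        calc psi1 ((ℓ : ℝ) / L) * (M₃' * ‖𝓕 psi1c (M₃' * (ℓ - x))‖) ≤ 1 * (M₃' * ‖𝓕 psi1c (M₃' * (ℓ - x))‖) :=
              mul_le_mul_of_nonneg_right (psi1_le_one _) (by positivity)
          _ = _ := one_mul _
    _ ≤ 8 * K * M₃' := sum_perK_terms_le hK hΦ hM x _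

/-- **`perK ≤ ktil + 8K_jM₃'T^{2−j}` on `|x| ≤ T⁶`** when `L ≥ T⁶ + T`, `T ≥ 1`, `M₃' ≥ 1`, `j ≥ 2` (the terms
with `|ℓ| ≤ 2L` carry the weight `ψ₁(ℓ/L) = 1`, the others are the tail of `sum_tail_le`).
[cite: GuthMaynard2026, proof of Lemma 9.2] -/
theorem perK_le_ktil_add {K : ℝ} (hK : 0 ≤ K) {j : ℕ} (hj : 2 ≤ j)
    (hΦ : ∀ y, ‖𝓕 psi1c y‖ ≤ K / (1 + |y|) ^ j) {T : ℝ} (_hT : 1 ≤ T) {L : ℕ} (_hL : T ^ 6 + T ≤ L)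
    {M₃' : ℝ} (hM : 1 ≤ M₃') {x : ℝ} (hx : |x| ≤ T ^ 6) :
    perK (𝓕 psi1c) M₃' x ≤ ktil L M₃' x + 8 * K * M₃' * T ^ ((2 : ℝ) - j) := by
  have hM0 : 0 < M₃' := by linarith
  have hT0 : 0 < T := by linarith
  refine Real.tsum_le_of_sum_le (fun ℓ ↦ by positivity) fun F ↦ ?_
  classical
  -- split `F` at `|ℓ| ≤ 2L`
  rw [← Finset.sum_filter_add_sum_filter_not F (fun ℓ : ℤ ↦ |ℓ| ≤ 2 * L)]
  refine add_le_add ?_ ?_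
  · -- the part `|ℓ| ≤ 2L` is dominated by `ktil`
    have hsub : F.filter (fun ℓ : ℤ ↦ |ℓ| ≤ 2 * L) ⊆ Finset.Icc (-(3 * L : ℤ)) (3 * L) := by
      intro ℓ hℓ
      rw [Finset.mem_filter] at hℓ
      rw [Finset.mem_Icc]
      have := abs_le.mp hℓ.2
      omega
    calc ∑ ℓ ∈ F.filter (fun ℓ : ℤ ↦ |ℓ| ≤ 2 * L), M₃' * ‖𝓕 psi1c (M₃' * (ℓ - x))‖
        = ∑ ℓ ∈ F.filter (fun ℓ : ℤ ↦ |ℓ| ≤ 2 * L), psi1 ((ℓ : ℝ) / L) * (M₃' * ‖𝓕 psi1c (M₃' * (ℓ - x))‖) := by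
          refine Finset.sum_congr rfl fun ℓ hℓ ↦ ?_
          rw [Finset.mem_filter] at hℓ
          rw [psi1_eq_one, one_mul]
          rcases Nat.eq_zero_or_pos L with hL0 | hLpos
          · rw [hL0]; simp
          · have hLr : (0 : ℝ) < L := by exact_mod_cast hLpos
            rw [abs_div, abs_of_pos hLr, div_le_iff₀ hLr]
            have : |(ℓ : ℝ)| ≤ 2 * L := by
              rw [← Int.cast_abs]; exact_mod_cast hℓ.2
            linarith
      _ ≤ ktil L M₃' x := Finset.sum_le_sum_of_subset_of_nonneg hsub fun ℓ _ _ ↦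
          mul_nonneg (psi1_nonneg _) (by positivity)
  · -- the tail `|ℓ| > 2L`
    have h2L : T ^ 6 + 1 ≤ ((2 * L : ℕ) : ℝ) := by push_cast; nlinarith
    have htail := sum_tail_le hK hj hΦ hM h2L hx (F.filter fun ℓ : ℤ ↦ ¬|ℓ| ≤ 2 * L) fun ℓ hℓ ↦ by
      rw [Finset.mem_filter] at hℓ
      push Not at hℓ
      have : ((2 * L : ℕ) : ℝ) ≤ |(ℓ : ℝ)| := by
        rw [← Int.cast_abs]
        have : (2 * L : ℤ) + 1 ≤ |ℓ| := hℓ.2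
        exact_mod_cast (by omega : (2 * L : ℤ) ≤ |ℓ|)
      exact this
    refine htail.trans ?_
    have h3 : T ≤ ((2 * L : ℕ) : ℝ) - T ^ 6 := by push_cast; linarith
    have h4 : (((2 * L : ℕ) : ℝ) - T ^ 6) ^ ((2 : ℝ) - j) ≤ T ^ ((2 : ℝ) - j) := by
      have hexp : (2 : ℝ) - j ≤ 0 := by
        have : (2 : ℝ) ≤ j := by exact_mod_cast hj
        linarith
      exact Real.rpow_le_rpow_of_nonpos hT0 h3 hexp
    exact mul_le_mul_of_nonneg_left h4 (by positivity)

/-! ## §3. The region `T^ηM₁/M₃' < |ξ| ≤ T⁶`: counting near pairs -/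

/-- The near pairs `(m₁, ℓ) ∈ I₁ × [−L₀, L₀]` with `M₃'|ℓ − ξ/m₁| ≤ Y`.
[cite: GuthMaynard2026, proof of Lemma 9.2, after (9.10)] -/
def nearPairs (I₁ : Finset ℤ) (L₀ : ℕ) (M₃' Y ξ : ℝ) : Finset (ℤ × ℤ) :=
  (I₁ ×ˢ Finset.Icc (-(L₀ : ℤ)) L₀).filter fun p ↦ M₃' * |(p.2 : ℝ) - ξ / p.1| ≤ Y

/-- **The count of near pairs**: if `M₁, M₃', Y ≥ 1`, `I₁ ⊂ {M₁ ≤ |m₁| ≤ 2M₁}`, `2M₁Y/M₃' ≤ |ξ|/2`,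
`|ξ| ≤ T⁶` with `T ≥ 1`, and `d(n) ≤ C_d n^ε` for all `n ≥ 1`, then
`#nearPairs ≤ (4M₁Y/M₃' + 1) · 2C_d(2T⁶)^ε` ("the number of such integers `s` is `⪅ 1 + M₁/M₃` …
each such integer `s` has `⪅ 1` factorizations as `s = m₁ℓ`"). [cite: GuthMaynard2026, proof of Lemma 9.2] -/
theorem card_nearPairs_le (I₁ : Finset ℤ) {M₁ : ℝ} (_hM₁ : 1 ≤ M₁) (hI₁ : ∀ m ∈ I₁, M₁ ≤ |(m : ℝ)| ∧ |(m : ℝ)| ≤ 2 * M₁)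
    (L₀ : ℕ) {M₃' Y ξ : ℝ} (_hM₃' : 1 ≤ M₃') (_hY : 1 ≤ Y) (_hsmall : 2 * M₁ * Y / M₃' ≤ |ξ| / 2)
    {T : ℝ} (_hT : 1 ≤ T) (hξT : |ξ| ≤ T ^ 6) {Cd ε : ℝ} (_hCd : 1 ≤ Cd) (hε : 0 < ε)
    (hdiv : ∀ n : ℕ, n ≠ 0 → (n.divisors.card : ℝ) ≤ Cd * (n : ℝ) ^ ε) :
    ((nearPairs I₁ L₀ M₃' Y ξ).card : ℝ) ≤ (4 * M₁ * Y / M₃' + 1) * (2 * Cd * (2 * T ^ 6) ^ ε) := by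
  classical
  set P := nearPairs I₁ L₀ M₃' Y ξ with hP
  have hM₃'0 : 0 < M₃' := by linarith
  have hξ0 : 0 < |ξ| := by
    have : 0 < 2 * M₁ * Y / M₃' := by positivity
    linarith
  -- properties of a near pair
  have hnear : ∀ p ∈ P, p.1 ∈ I₁ ∧ p.1 ≠ 0 ∧ |((p.1 * p.2 : ℤ) : ℝ) - ξ| ≤ 2 * M₁ * Y / M₃' := by
    intro p hp
    rw [hP, nearPairs, Finset.mem_filter, Finset.mem_product] at hp
    obtain ⟨⟨h1, -⟩, h2⟩ := hp
    obtain ⟨hm1, hm2⟩ := hI₁ p.1 h1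
    have hp1 : p.1 ≠ 0 := by
      intro h; rw [h, Int.cast_zero, abs_zero] at hm1; linarith
    have hp1' : (p.1 : ℝ) ≠ 0 := by exact_mod_cast hp1
    refine ⟨h1, hp1, ?_⟩
    have e : ((p.1 * p.2 : ℤ) : ℝ) - ξ = (p.1 : ℝ) * ((p.2 : ℝ) - ξ / p.1) := by
      push_cast; field_simp
    rw [e, abs_mul]
    have h3 : |(p.2 : ℝ) - ξ / p.1| ≤ Y / M₃' := by
      rw [le_div_iff₀ hM₃'0, mul_comm]; exact h2
    calc |(p.1 : ℝ)| * |(p.2 : ℝ) - ξ / p.1| ≤ 2 * M₁ * (Y / M₃') :=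
          mul_le_mul hm2 h3 (abs_nonneg _) (by positivity)
      _ = 2 * M₁ * Y / M₃' := by ring
  have hsne : ∀ p ∈ P, p.1 * p.2 ≠ 0 := by
    intro p hp h
    have := (hnear p hp).2.2
    rw [h, Int.cast_zero, zero_sub, abs_neg] at this
    linarith
  -- the map to `s = m₁ℓ`
  set σ : ℤ × ℤ → ℤ := fun p ↦ p.1 * p.2 with hσ
  have hfib : ∀ s ∈ P.image σ, ((P.filter fun p ↦ σ p = s).card : ℝ) ≤ 2 * Cd * (2 * T ^ 6) ^ ε := by
    intro s hs
    rw [Finset.mem_image] at hs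
    obtain ⟨p, hp, rfl⟩ := hs
    have hs0 : σ p ≠ 0 := hsne p hp
    have h1 : (P.filter fun q ↦ σ q = σ p).card ≤ ((I₁ ×ˢ Finset.Icc (-(L₀ : ℤ)) L₀).filter
        fun q : ℤ × ℤ ↦ q.1 * q.2 = σ p).card := by
      refine Finset.card_le_card fun q hq ↦ ?_
      rw [Finset.mem_filter] at hq ⊢
      have hqP := hq.1
      rw [hP, nearPairs, Finset.mem_filter] at hqP
      exact ⟨hqP.1, hq.2⟩
    have h2 := card_mul_eq_le I₁ (Finset.Icc (-(L₀ : ℤ)) L₀) hs0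
    have h3 : ((σ p).natAbs.divisors.card : ℝ) ≤ Cd * ((σ p).natAbs : ℝ) ^ ε :=
      hdiv _ (Int.natAbs_ne_zero.mpr hs0)
    have h4 : ((σ p).natAbs : ℝ) ≤ 2 * T ^ 6 := by
      have := (hnear p hp).2.2
      have h5 : |((σ p : ℤ) : ℝ)| ≤ |ξ| + 2 * M₁ * Y / M₃' := by
        have := abs_sub_abs_le_abs_sub ((σ p : ℤ) : ℝ) ξ
        simp only [hσ] at this ⊢
        linarith
      rw [Nat.cast_natAbs, Int.cast_abs]
      linarith
    calc ((P.filter fun q ↦ σ q = σ p).card : ℝ) ≤ (2 * (σ p).natAbs.divisors.card : ℕ) := by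
          exact_mod_cast h1.trans h2
      _ ≤ 2 * (Cd * ((σ p).natAbs : ℝ) ^ ε) := by push_cast; linarith
      _ ≤ 2 * (Cd * (2 * T ^ 6) ^ ε) := by
          gcongr
      _ = _ := by ring
  have hcard1 : (P.card : ℝ) ≤ ((P.image σ).card : ℝ) * (2 * Cd * (2 * T ^ 6) ^ ε) := by
    -- `Finset.card_le_mul_card_image` needs a natural-number fibre bound; use the real version by hand
    have h := Finset.card_eq_sum_card_image σ P
    rw [h]
    push_cast
    calc ∑ s ∈ P.image σ, ((P.filter fun p ↦ σ p = s).card : ℝ)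
        ≤ ∑ s ∈ P.image σ, (2 * Cd * (2 * T ^ 6) ^ ε) := Finset.sum_le_sum hfib
      _ = _ := by rw [Finset.sum_const, nsmul_eq_mul]
  -- the image consists of integers within `2M₁Y/M₃'` of `ξ`
  have hcard2 : ((P.image σ).card : ℝ) ≤ 2 * (2 * M₁ * Y / M₃') + 1 :=
    card_int_near_le ξ (by positivity) _ fun s hs ↦ by
      rw [Finset.mem_image] at hs
      obtain ⟨p, hp, rfl⟩ := hs
      exact (hnear p hp).2.2
  calc (P.card : ℝ) ≤ ((P.image σ).card : ℝ) * (2 * Cd * (2 * T ^ 6) ^ ε) := hcard1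
    _ ≤ (2 * (2 * M₁ * Y / M₃') + 1) * (2 * Cd * (2 * T ^ 6) ^ ε) :=
        mul_le_mul_of_nonneg_right hcard2 (by positivity)
    _ = _ := by ring

/-- **Region II bound for `S(ξ) = ∑_{m₁} perK(ξ/m₁)`** (eq. (9.11) and after): for `0 < η ≤ 1` and `j ≥ 2`
with `η(j−2) ≥ 4` there is `C` such that for `T ≥ T₀ = 4^{2/η}`, `1 ≤ M₁ ≤ T`, `1 ≤ M₃' ≤ T²`,
`I₁ ⊂ {M₁ ≤ |m₁| ≤ 2M₁}`, and `T^ηM₁/M₃' < |ξ| ≤ T⁶`: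
`∑_{m₁∈I₁} perK ψ̂₁ M₃' (ξ/m₁) ≤ C T^η (M₁ + M₃')`.
[cite: GuthMaynard2026, proof of Lemma 9.2, (9.11)] -/
theorem sum_perK_le_regionII {η : ℝ} (hη : 0 < η) (hη1 : η ≤ 1) {j : ℕ} (hj : 2 ≤ j) (hjη : 4 ≤ η * (j - 2)) :
    ∃ C, 0 ≤ C ∧ ∀ (T : ℝ), (4 : ℝ) ^ (2 / η) ≤ T → ∀ (M₁ M₃' : ℝ), 1 ≤ M₁ → M₁ ≤ T → 1 ≤ M₃' → M₃' ≤ T ^ 2 →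
      ∀ (I₁ : Finset ℤ), (∀ m ∈ I₁, M₁ ≤ |(m : ℝ)| ∧ |(m : ℝ)| ≤ 2 * M₁) →
      ∀ ξ : ℝ, T ^ η * M₁ / M₃' < |ξ| → |ξ| ≤ T ^ 6 →
      ∑ m₁ ∈ I₁, perK (𝓕 psi1c) M₃' (ξ / m₁) ≤ C * T ^ η * (M₁ + M₃') := by
  obtain ⟨K, hK0, hK⟩ := exists_psi1_fourier_decay j
  have hε : 0 < η / 14 := by positivity
  obtain ⟨Cd, hCd1, hCd⟩ := Literature.NumberTheory.Sieve.exists_card_divisors_le_mul_rpow hε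
  refine ⟨32 * Cd * K + 8 * K * 6, by positivity, fun T hT M₁ M₃' hM₁ hM₁T hM₃' hM₃'T I₁ hI₁ ξ hξ1 hξ2 ↦ ?_⟩
  classical
  have h4 : (4 : ℝ) ≤ (4 : ℝ) ^ (2 / η) := by
    calc (4 : ℝ) = 4 ^ (1 : ℝ) := (Real.rpow_one 4).symm
      _ ≤ 4 ^ (2 / η) := Real.rpow_le_rpow_of_exponent_le (by norm_num) (by
          rw [le_div_iff₀ hη]; linarith)
  have hT1 : 1 ≤ T := by linarith
  have hT0 : 0 < T := by linarith
  have hM₃'0 : 0 < M₃' := by linarith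
  set Y : ℝ := T ^ (η / 2) with hY
  have hY1 : 1 ≤ Y := Real.one_le_rpow hT1 (by positivity)
  -- `T^{η/2} ≥ 4`
  have hY4 : 4 ≤ Y := by
    have : (4 : ℝ) ^ (2 / η) ≤ T := hT
    calc (4 : ℝ) = ((4 : ℝ) ^ (2 / η)) ^ (η / 2) := by
          rw [← Real.rpow_mul (by norm_num)]; field_simp; simp
      _ ≤ T ^ (η / 2) := Real.rpow_le_rpow (by positivity) this (by positivity)
  -- the bound `2M₁Y/M₃' ≤ |ξ|/2`
  have hsmall : 2 * M₁ * Y / M₃' ≤ |ξ| / 2 := by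
    have e : T ^ η = Y * Y := by rw [hY, ← Real.rpow_add hT0]; ring_nf
    have h1 : T ^ η * M₁ / M₃' = Y * (M₁ * Y / M₃') := by rw [e]; ring
    rw [h1] at hξ1
    have h2 : 4 * (M₁ * Y / M₃') ≤ Y * (M₁ * Y / M₃') := mul_le_mul_of_nonneg_right hY4 (by positivity)
    have h3 : Y * (M₁ * Y / M₃') ≤ |ξ| := hξ1.le
    calc 2 * M₁ * Y / M₃' = (4 * (M₁ * Y / M₃')) / 2 := by ring
      _ ≤ (Y * (M₁ * Y / M₃')) / 2 := by gcongr
      _ ≤ |ξ| / 2 := by gcongr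
  -- near and far split of each `perK(ξ/m₁)`
  set L₀ : ℕ := ⌈T ^ 6 + T⌉₊ with hL₀
  have hnearset : ∀ m₁ ∈ I₁, ∀ ℓ : ℤ, M₃' * |(ℓ : ℝ) - ξ / m₁| ≤ Y → ℓ ∈ Finset.Icc (-(L₀ : ℤ)) L₀ := by
    intro m₁ hm₁ ℓ hℓ
    obtain ⟨hm1, -⟩ := hI₁ m₁ hm₁
    have hm0 : (m₁ : ℝ) ≠ 0 := by intro h; rw [h, abs_zero] at hm1; linarith
    have h1 : |(ℓ : ℝ) - ξ / m₁| ≤ Y := by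
      have : |(ℓ : ℝ) - ξ / m₁| ≤ M₃' * |(ℓ : ℝ) - ξ / m₁| := le_mul_of_one_le_left (abs_nonneg _) hM₃'
      linarith
    have h2 : |ξ / m₁| ≤ T ^ 6 := by
      rw [abs_div]
      exact (div_le_self (abs_nonneg _) (by linarith)).trans hξ2
    have h3 : |(ℓ : ℝ)| ≤ T ^ 6 + T := by
      have := abs_sub_abs_le_abs_sub (ℓ : ℝ) (ξ / m₁)
      have hYT : Y ≤ T := by
        calc Y = T ^ (η / 2) := rfl
          _ ≤ T ^ (1 : ℝ) := Real.rpow_le_rpow_of_exponent_le hT1 (by linarith)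
          _ = T := Real.rpow_one T
      linarith
    have h4' : (T ^ 6 + T : ℝ) ≤ L₀ := Nat.le_ceil _
    rw [Finset.mem_Icc, ← abs_le]
    have : |(ℓ : ℝ)| ≤ (L₀ : ℝ) := h3.trans h4'
    rw [← Int.cast_abs] at this
    exact_mod_cast this
  set P := nearPairs I₁ L₀ M₃' Y ξ with hP
  have hper : ∀ m₁ ∈ I₁, perK (𝓕 psi1c) M₃' (ξ / m₁) ≤
      M₃' * K * ((P.filter fun p ↦ p.1 = m₁).card : ℝ) + 8 * K * M₃' * Y ^ ((2 : ℝ) - j) := by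
    intro m₁ hm₁
    refine Real.tsum_le_of_sum_le (fun ℓ ↦ by positivity) fun F ↦ ?_
    rw [← Finset.sum_filter_add_sum_filter_not F (fun ℓ : ℤ ↦ M₃' * |(ℓ : ℝ) - ξ / m₁| ≤ Y)]
    refine add_le_add ?_ ?_
    · -- near terms: each `≤ M₃'K`, and they inject into the fibre of `P` over `m₁`
      have hinj : (F.filter fun ℓ : ℤ ↦ M₃' * |(ℓ : ℝ) - ξ / m₁| ≤ Y).card ≤ (P.filter fun p ↦ p.1 = m₁).card := by
        refine Finset.card_le_card_of_injOn (fun ℓ ↦ (m₁, ℓ)) (fun ℓ hℓ ↦ ?_) (fun a _ b _ h ↦ by simpa using h)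
        rw [Finset.mem_coe, Finset.mem_filter] at hℓ
        rw [Finset.mem_coe, Finset.mem_filter, hP, nearPairs, Finset.mem_filter, Finset.mem_product]
        exact ⟨⟨⟨hm₁, hnearset m₁ hm₁ ℓ hℓ.2⟩, hℓ.2⟩, rfl⟩
      calc ∑ ℓ ∈ F.filter (fun ℓ : ℤ ↦ M₃' * |(ℓ : ℝ) - ξ / m₁| ≤ Y), M₃' * ‖𝓕 psi1c (M₃' * (ℓ - ξ / m₁))‖
          ≤ ∑ ℓ ∈ F.filter (fun ℓ : ℤ ↦ M₃' * |(ℓ : ℝ) - ξ / m₁| ≤ Y), M₃' * K := by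
            refine Finset.sum_le_sum fun ℓ _ ↦ mul_le_mul_of_nonneg_left ?_ hM₃'0.le
            refine (hK _).trans (div_le_self hK0 (one_le_pow₀ (by have := abs_nonneg (M₃' * ((ℓ : ℝ) - ξ / m₁)); linarith)))
        _ = ((F.filter fun ℓ : ℤ ↦ M₃' * |(ℓ : ℝ) - ξ / m₁| ≤ Y).card : ℝ) * (M₃' * K) := by
            rw [Finset.sum_const, nsmul_eq_mul]
        _ ≤ ((P.filter fun p ↦ p.1 = m₁).card : ℝ) * (M₃' * K) := by gcongr
        _ = M₃' * K * ((P.filter fun p ↦ p.1 = m₁).card : ℝ) := by ring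
    · exact sum_far_le hK0 hj hK hM₃' hY1 (ξ / m₁) _ fun ℓ hℓ ↦ by
        rw [Finset.mem_filter] at hℓ; push Not at hℓ; exact hℓ.2.le
  -- sum over `m₁`
  have hI₁card : (I₁.card : ℝ) ≤ 6 * M₁ := by
    have h1 : I₁ ⊆ (Finset.Icc (-(⌊2 * M₁⌋)) ⌊2 * M₁⌋) := by
      intro m hm
      obtain ⟨-, h2⟩ := hI₁ m hm
      rw [Finset.mem_Icc]
      rw [abs_le] at h2
      constructor
      · have : -(2 * M₁) ≤ (m : ℝ) := h2.1
        have : -⌊2 * M₁⌋ ≤ m := by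
          rw [neg_le]; exact Int.le_floor.mpr (by push_cast; linarith)
        exact this
      · exact Int.le_floor.mpr h2.2
    have h2 : (I₁.card : ℝ) ≤ ((Finset.Icc (-(⌊2 * M₁⌋)) ⌊2 * M₁⌋).card : ℝ) := by exact_mod_cast Finset.card_le_card h1
    refine h2.trans ?_
    rw [Int.card_Icc]
    have h3 : (0 : ℤ) ≤ ⌊2 * M₁⌋ := Int.floor_nonneg.mpr (by linarith)
    have h4 : ((⌊2 * M₁⌋ + 1 - -⌊2 * M₁⌋).toNat : ℝ) = 2 * (⌊2 * M₁⌋ : ℝ) + 1 := by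
      have : (⌊2 * M₁⌋ + 1 - -⌊2 * M₁⌋).toNat = (2 * ⌊2 * M₁⌋ + 1 : ℤ) := by
        rw [Int.toNat_of_nonneg (by omega)]; ring
      exact_mod_cast this
    rw [h4]
    have := Int.floor_le (2 * M₁)
    linarith
  have hsumcard : ∑ m₁ ∈ I₁, ((P.filter fun p ↦ p.1 = m₁).card : ℝ) ≤ (P.card : ℝ) := by
    have h := Finset.card_eq_sum_card_fiberwise (f := fun p : ℤ × ℤ ↦ p.1) (s := P) (t := I₁) fun p hp ↦ by
      have hp' : p ∈ nearPairs I₁ L₀ M₃' Y ξ := hp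
      rw [nearPairs, Finset.mem_filter, Finset.mem_product] at hp'
      exact hp'.1.1
    rw [h]; push_cast; rfl
  have hPcard := card_nearPairs_le I₁ hM₁ hI₁ L₀ hM₃' hY1 hsmall hT1 hξ2 hCd1 hε hCd
  -- `(2T⁶)^{η/14} ≤ 2 T^{η/2} / ... `: crude `(2T^6)^{η/14} ≤ 2 T^{3η/7} ≤ 2 Y`
  have hpow : (2 * T ^ 6) ^ (η / 14) ≤ 2 * Y := by
    rw [Real.mul_rpow (by norm_num) (by positivity)]
    have h1 : (2 : ℝ) ^ (η / 14) ≤ 2 := by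
      calc (2 : ℝ) ^ (η / 14) ≤ 2 ^ (1 : ℝ) := Real.rpow_le_rpow_of_exponent_le (by norm_num) (by linarith)
        _ = 2 := Real.rpow_one 2
    have h2 : (T ^ 6 : ℝ) ^ (η / 14) ≤ Y := by
      rw [show (T ^ 6 : ℝ) = T ^ (6 : ℝ) by norm_cast, ← Real.rpow_mul hT0.le]
      exact Real.rpow_le_rpow_of_exponent_le hT1 (by linarith)
    exact mul_le_mul h1 h2 (by positivity) zero_le_two
  calc ∑ m₁ ∈ I₁, perK (𝓕 psi1c) M₃' (ξ / m₁)
      ≤ ∑ m₁ ∈ I₁, (M₃' * K * ((P.filter fun p ↦ p.1 = m₁).card : ℝ) + 8 * K * M₃' * Y ^ ((2 : ℝ) - j)) :=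
        Finset.sum_le_sum hper
    _ = M₃' * K * ∑ m₁ ∈ I₁, ((P.filter fun p ↦ p.1 = m₁).card : ℝ) + (I₁.card : ℝ) * (8 * K * M₃' * Y ^ ((2 : ℝ) - j)) := by
        rw [Finset.sum_add_distrib, Finset.mul_sum, Finset.sum_const, nsmul_eq_mul]
    _ ≤ M₃' * K * (P.card : ℝ) + 6 * M₁ * (8 * K * M₃' * Y ^ ((2 : ℝ) - j)) := by
        gcongr
    _ ≤ M₃' * K * ((4 * M₁ * Y / M₃' + 1) * (2 * Cd * (2 * T ^ 6) ^ (η / 14))) +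
        6 * M₁ * (8 * K * M₃' * Y ^ ((2 : ℝ) - j)) := by gcongr
    _ ≤ M₃' * K * ((4 * M₁ * Y / M₃' + 1) * (2 * Cd * (2 * Y))) + 6 * M₁ * (8 * K * M₃' * Y ^ ((2 : ℝ) - j)) := by
        gcongr
    _ = 16 * Cd * K * (M₁ * (Y * Y)) + 4 * Cd * K * M₃' * Y + 48 * K * (M₁ * M₃' * Y ^ ((2 : ℝ) - j)) := by
        field_simp; ring
    _ ≤ 16 * Cd * K * (M₁ * T ^ η) + 4 * Cd * K * M₃' * T ^ η + 48 * K * (M₁ * 1) := by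
        have e : Y * Y = T ^ η := by rw [hY, ← Real.rpow_add hT0]; ring_nf
        have hYη : Y ≤ T ^ η := by
          rw [hY]; exact Real.rpow_le_rpow_of_exponent_le hT1 (by linarith)
        have hsmallj : M₃' * Y ^ ((2 : ℝ) - j) ≤ 1 := by
          -- `Y^{j-2} = T^{η(j-2)/2} ≥ T^2 ≥ 2T ≥ M₃'`
          have h1 : Y ^ ((2 : ℝ) - j) = (T ^ (η * (j - 2) / 2))⁻¹ := by
            rw [hY, ← Real.rpow_mul hT0.le, ← Real.rpow_neg hT0.le]; congr 1; ring
          rw [h1, ← div_eq_mul_inv, div_le_one (by positivity)]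
          calc M₃' ≤ T ^ 2 := hM₃'T
            _ = T ^ (2 : ℝ) := (Real.rpow_two T).symm
            _ ≤ T ^ (η * (j - 2) / 2) := Real.rpow_le_rpow_of_exponent_le hT1 (by linarith)
        have hA : 16 * Cd * K * (M₁ * (Y * Y)) ≤ 16 * Cd * K * (M₁ * T ^ η) := by rw [e]
        have hB : 4 * Cd * K * M₃' * Y ≤ 4 * Cd * K * M₃' * T ^ η :=
          mul_le_mul_of_nonneg_left hYη (by positivity)
        have hC : 48 * K * (M₁ * M₃' * Y ^ ((2 : ℝ) - j)) ≤ 48 * K * (M₁ * 1) := by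
          refine mul_le_mul_of_nonneg_left ?_ (by positivity)
          calc M₁ * M₃' * Y ^ ((2 : ℝ) - j) = M₁ * (M₃' * Y ^ ((2 : ℝ) - j)) := by ring
            _ ≤ M₁ * 1 := mul_le_mul_of_nonneg_left hsmallj (by linarith)
        linarith
    _ ≤ (32 * Cd * K + 8 * K * 6) * T ^ η * (M₁ + M₃') := by
        have hTη1 : 1 ≤ T ^ η := Real.one_le_rpow hT1 hη.le
        have : 0 ≤ Cd * K := by positivity
        nlinarith [mul_nonneg this (by positivity : (0:ℝ) ≤ T ^ η * (M₁ + M₃')),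
          mul_nonneg hK0 (by positivity : (0:ℝ) ≤ M₁ * (T ^ η - 1)), mul_nonneg this (by positivity : (0:ℝ) ≤ M₁),
          mul_nonneg this (by positivity : (0:ℝ) ≤ M₃' * T ^ η), mul_nonneg hK0 (by positivity : (0:ℝ) ≤ T ^ η * M₃')]

/-! ## §4. The function `Ψ` and pointwise bounds for `Φ` -/

/-- `Ψ(x) = ∑_{m₂∈I₂} |m₂| f̂(m₂x)`. [cite: GuthMaynard2026, proof of Lemma 9.2, before (9.13)] -/
def PsiF (f : ℝ → ℝ) (I₂ : Finset ℤ) (x : ℝ) : ℂ :=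
  ∑ m₂ ∈ I₂, ((|(m₂ : ℝ)| : ℝ) : ℂ) * 𝓕 (fun y ↦ ((f y : ℝ) : ℂ)) ((m₂ : ℝ) * x)

/-- **`Φ_{m₁}(m₁x) = |Ψ(x)|/|m₁|`** (`m₁ ≠ 0`). [cite: GuthMaynard2026, proof of Lemma 9.2] -/
theorem Phifun_mul_eq (f : ℝ → ℝ) (I₂ : Finset ℤ) {m₁ : ℤ} (hm₁ : m₁ ≠ 0) (x : ℝ) :
    Phifun f I₂ m₁ ((m₁ : ℝ) * x) = ‖PsiF f I₂ x‖ / |(m₁ : ℝ)| := by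
  have hm : (m₁ : ℝ) ≠ 0 := by exact_mod_cast hm₁
  have e : ∑ m₂ ∈ I₂, ((|(m₂ : ℝ) / m₁| : ℝ) : ℂ) * 𝓕 (fun y ↦ ((f y : ℝ) : ℂ)) ((m₂ : ℝ) * ((m₁ : ℝ) * x) / m₁) =
      ((|(m₁ : ℝ)|⁻¹ : ℝ) : ℂ) * PsiF f I₂ x := by
    rw [PsiF, Finset.mul_sum]
    refine Finset.sum_congr rfl fun m₂ _ ↦ ?_
    have e1 : (m₂ : ℝ) * ((m₁ : ℝ) * x) / m₁ = (m₂ : ℝ) * x := by field_simp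
    rw [e1, abs_div, Complex.ofReal_div, div_eq_inv_mul, mul_assoc, Complex.ofReal_inv]
  rw [Phifun, e, norm_mul, Complex.norm_real, Real.norm_of_nonneg (inv_nonneg.mpr (abs_nonneg _)),
    inv_mul_eq_div]

section props

variable {f : ℝ → ℝ} (hf : ContDiff ℝ ∞ f) (hfs : HasCompactSupport f) (hf0 : ∀ x, 0 ≤ f x)
include hf hfs

/-- The complexification of `f` is integrable. [folklore] -/
theorem integrable_fc : Integrable (fun y ↦ ((f y : ℝ) : ℂ)) :=
  ((hf.continuous).integrable_of_hasCompactSupport hfs).ofReal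

/-- `f̂` is continuous. [folklore] -/
theorem continuous_fourier_fc : Continuous (𝓕 (fun y ↦ ((f y : ℝ) : ℂ))) :=
  VectorFourier.fourierIntegral_continuous Real.continuous_fourierChar (by exact continuous_inner)
    (integrable_fc hf hfs)

omit hf hfs in
include hf0 in
/-- `|f̂(ξ)| ≤ ∫ f` for `f ≥ 0`. [folklore] -/
theorem norm_fourier_fc_le (ξ : ℝ) : ‖𝓕 (fun y ↦ ((f y : ℝ) : ℂ)) ξ‖ ≤ ∫ y, f y := by
  refine (norm_fourier_le_integral_norm _ _).trans (le_of_eq ?_)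
  refine integral_congr_ae (Eventually.of_forall fun y ↦ ?_)
  simp only [Complex.norm_real, Real.norm_eq_abs, abs_of_nonneg (hf0 y)]

/-- **Plancherel for `f`**: `∫ |f̂|² = ∫ f²`. [folklore] -/
theorem integral_normSq_fourier_f : ∫ ξ, ‖𝓕 (fun y ↦ ((f y : ℝ) : ℂ)) ξ‖ ^ 2 = ∫ y, f y ^ 2 := by
  have hsm : ContDiff ℝ ∞ (fun y ↦ ((f y : ℝ) : ℂ)) := Complex.ofRealCLM.contDiff.comp hf
  have hcs : HasCompactSupport (fun y ↦ ((f y : ℝ) : ℂ)) := hfs.comp_left Complex.ofReal_zero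
  have h := SchwartzMap.integral_norm_sq_fourier (hcs.toSchwartzMap hsm)
  have e1 : ((hcs.toSchwartzMap hsm : SchwartzMap ℝ ℂ) : ℝ → ℂ) = fun y ↦ ((f y : ℝ) : ℂ) := rfl
  rw [SchwartzMap.fourier_coe, e1] at h
  rw [h]
  refine integral_congr_ae (Eventually.of_forall fun y ↦ ?_)
  simp only [Complex.norm_real, Real.norm_eq_abs, sq_abs]

/-- `f̂` is square integrable (it is a Schwartz function). [folklore] -/
theorem memLp_fourier_fc : MemLp (𝓕 (fun y ↦ ((f y : ℝ) : ℂ))) 2 volume := by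
  have hsm : ContDiff ℝ ∞ (fun y ↦ ((f y : ℝ) : ℂ)) := Complex.ofRealCLM.contDiff.comp hf
  have hcs : HasCompactSupport (fun y ↦ ((f y : ℝ) : ℂ)) := hfs.comp_left Complex.ofReal_zero
  have h := (𝓕 (hcs.toSchwartzMap hsm)).memLp 2 (volume : Measure ℝ)
  have e1 : ((𝓕 (hcs.toSchwartzMap hsm) : SchwartzMap ℝ ℂ) : ℝ → ℂ) = 𝓕 (fun y ↦ ((f y : ℝ) : ℂ)) := by
    rw [SchwartzMap.fourier_coe]; rfl
  rwa [e1] at h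

/-- `ξ ↦ |f̂(aξ)|²` is integrable with `∫ |f̂(aξ)|² dξ = |a|^{-1} ∫ f²` (`a ≠ 0`). [folklore] -/
theorem integral_normSq_fourier_comp_mul {a : ℝ} (ha : a ≠ 0) :
    Integrable (fun ξ ↦ ‖𝓕 (fun y ↦ ((f y : ℝ) : ℂ)) (a * ξ)‖ ^ 2) ∧
      ∫ ξ, ‖𝓕 (fun y ↦ ((f y : ℝ) : ℂ)) (a * ξ)‖ ^ 2 = |a|⁻¹ * ∫ y, f y ^ 2 := by
  have hint : Integrable (fun ξ ↦ ‖𝓕 (fun y ↦ ((f y : ℝ) : ℂ)) ξ‖ ^ 2) :=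
    (memLp_two_iff_integrable_sq_norm (memLp_fourier_fc hf hfs).1).mp (memLp_fourier_fc hf hfs)
  refine ⟨hint.comp_mul_left' ha, ?_⟩
  rw [Measure.integral_comp_mul_left (fun ξ ↦ ‖𝓕 (fun y ↦ ((f y : ℝ) : ℂ)) ξ‖ ^ 2) a, smul_eq_mul, abs_inv,
    integral_normSq_fourier_f hf hfs]

omit hf hfs in
/-- `|I₂| ≤ 6M₂` for `I₂ ⊂ {M₂ ≤ |m| ≤ 2M₂}`, `M₂ ≥ 1`. [folklore] -/
theorem card_shell_le {I : Finset ℤ} {Msz : ℝ} (_hM : 1 ≤ Msz) (hI : ∀ m ∈ I, Msz ≤ |(m : ℝ)| ∧ |(m : ℝ)| ≤ 2 * Msz) :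
    (I.card : ℝ) ≤ 6 * Msz := by
  have h1 : I ⊆ (Finset.Icc (-(⌊2 * Msz⌋)) ⌊2 * Msz⌋) := by
    intro m hm
    obtain ⟨-, h2⟩ := hI m hm
    rw [Finset.mem_Icc]
    rw [abs_le] at h2
    constructor
    · rw [neg_le]; exact Int.le_floor.mpr (by push_cast; linarith [h2.1])
    · exact Int.le_floor.mpr h2.2
  have h2 : (I.card : ℝ) ≤ ((Finset.Icc (-(⌊2 * Msz⌋)) ⌊2 * Msz⌋).card : ℝ) := by exact_mod_cast Finset.card_le_card h1
  refine h2.trans ?_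
  rw [Int.card_Icc]
  have h3 : (0 : ℤ) ≤ ⌊2 * Msz⌋ := Int.floor_nonneg.mpr (by linarith)
  have h4 : ((⌊2 * Msz⌋ + 1 - -⌊2 * Msz⌋).toNat : ℝ) = 2 * (⌊2 * Msz⌋ : ℝ) + 1 := by
    have : ((⌊2 * Msz⌋ + 1 - -⌊2 * Msz⌋).toNat : ℤ) = 2 * ⌊2 * Msz⌋ + 1 := by
      rw [Int.toNat_of_nonneg (by omega)]; ring
    exact_mod_cast this
  rw [h4]
  have := Int.floor_le (2 * Msz)
  linarith

omit hf hfs in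
include hf0 in
/-- **`Φ_{m₁}(ξ) ≤ 12M₂²‖f‖₁/M₁`** (trivial bound `|f̂| ≤ ‖f‖₁`). [cite: GuthMaynard2026, proof of Lemma 9.2, (9.9)] -/
theorem Phifun_le {I₂ : Finset ℤ} {M₁ M₂ : ℝ} (_hM₁ : 1 ≤ M₁) (hM₂ : 1 ≤ M₂)
    (hI₂ : ∀ m ∈ I₂, M₂ ≤ |(m : ℝ)| ∧ |(m : ℝ)| ≤ 2 * M₂) {m₁ : ℤ} (_hm₁ : M₁ ≤ |(m₁ : ℝ)|) (ξ : ℝ) :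
    Phifun f I₂ m₁ ξ ≤ 12 * M₂ ^ 2 * (∫ y, f y) / M₁ := by
  have hN0 : 0 ≤ ∫ y, f y := integral_nonneg hf0
  have hm0 : 0 < |(m₁ : ℝ)| := by linarith
  calc Phifun f I₂ m₁ ξ ≤ ∑ m₂ ∈ I₂, ‖((|(m₂ : ℝ) / m₁| : ℝ) : ℂ) * 𝓕 (fun y ↦ ((f y : ℝ) : ℂ)) ((m₂ : ℝ) * ξ / m₁)‖ :=
        norm_sum_le _ _
    _ ≤ ∑ m₂ ∈ I₂, (2 * M₂ / M₁) * ∫ y, f y := by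
        refine Finset.sum_le_sum fun m₂ hm₂ ↦ ?_
        rw [norm_mul, Complex.norm_real, Real.norm_of_nonneg (abs_nonneg _)]
        refine mul_le_mul ?_ (norm_fourier_fc_le hf0 _) (norm_nonneg _) (by positivity)
        rw [abs_div, div_le_div_iff₀ hm0 (by linarith)]
        have := (hI₂ m₂ hm₂).2
        nlinarith
    _ = (I₂.card : ℝ) * ((2 * M₂ / M₁) * ∫ y, f y) := by rw [Finset.sum_const, nsmul_eq_mul]
    _ ≤ 6 * M₂ * ((2 * M₂ / M₁) * ∫ y, f y) := mul_le_mul_of_nonneg_right (card_shell_le hM₂ hI₂) (by positivity)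
    _ = 12 * M₂ ^ 2 * (∫ y, f y) / M₁ := by ring

omit hf hfs in
/-- **Region-III pointwise bound**: if `|f̂(ζ)| ≤ A(T/|ζ|)⁴` for `ζ ≠ 0`, `1 ≤ M₁ ≤ T`, `1 ≤ M₂ ≤ T`, then for
`|ξ| ≥ T⁶` (indeed for all `ξ ≠ 0`), `Φ_{m₁}(ξ) ≤ 192 T^{10} A |ξ|^{-4}`.
[cite: GuthMaynard2026, proof of Lemma 9.2, (9.8)] -/
theorem Phifun_le_decay {I₂ : Finset ℤ} {M₁ M₂ T A : ℝ} (hM₁ : 1 ≤ M₁) (hM₁T : M₁ ≤ T) (hM₂ : 1 ≤ M₂) (_hM₂T : M₂ ≤ T)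
    (hA : 0 ≤ A) (hI₂ : ∀ m ∈ I₂, M₂ ≤ |(m : ℝ)| ∧ |(m : ℝ)| ≤ 2 * M₂) {m₁ : ℤ} (hm₁ : M₁ ≤ |(m₁ : ℝ)| ∧ |(m₁ : ℝ)| ≤ 2 * M₁)
    (hdec : ∀ ζ : ℝ, ζ ≠ 0 → ‖𝓕 (fun y ↦ ((f y : ℝ) : ℂ)) ζ‖ ≤ A * (T / |ζ|) ^ 4) {ξ : ℝ} (hξ : ξ ≠ 0) :
    Phifun f I₂ m₁ ξ ≤ 192 * T ^ 10 * A / |ξ| ^ 4 := by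
  have hT1 : 1 ≤ T := hM₁.trans hM₁T
  have hT0 : 0 < T := by linarith
  have hm0 : 0 < |(m₁ : ℝ)| := by linarith [hm₁.1]
  have hξ0 : 0 < |ξ| := abs_pos.mpr hξ
  calc Phifun f I₂ m₁ ξ ≤ ∑ m₂ ∈ I₂, ‖((|(m₂ : ℝ) / m₁| : ℝ) : ℂ) * 𝓕 (fun y ↦ ((f y : ℝ) : ℂ)) ((m₂ : ℝ) * ξ / m₁)‖ :=
        norm_sum_le _ _
    _ ≤ ∑ m₂ ∈ I₂, (2 * M₂ / M₁) * (A * (2 * T ^ 2 / |ξ|) ^ 4) := by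
        refine Finset.sum_le_sum fun m₂ hm₂ ↦ ?_
        obtain ⟨h21, h22⟩ := hI₂ m₂ hm₂
        have hm20 : (m₂ : ℝ) ≠ 0 := by intro h; rw [h, abs_zero] at h21; linarith
        have hζ : (m₂ : ℝ) * ξ / m₁ ≠ 0 := div_ne_zero (mul_ne_zero hm20 hξ) (by intro h; rw [h, abs_zero] at hm0; linarith)
        rw [norm_mul, Complex.norm_real, Real.norm_of_nonneg (abs_nonneg _)]
        refine mul_le_mul ?_ ((hdec _ hζ).trans ?_) (norm_nonneg _) (by positivity)
        · rw [abs_div, div_le_div_iff₀ hm0 (by linarith)]; nlinarith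
        · refine mul_le_mul_of_nonneg_left (pow_le_pow_left₀ (by positivity) ?_ 4) hA
          -- `T/|m₂ξ/m₁| = T|m₁|/(|m₂||ξ|) ≤ 2TM₁/|ξ| ≤ 2T²/|ξ|`
          rw [abs_div, abs_mul, div_le_div_iff₀ (by positivity) hξ0]
          calc T * |ξ| = T * 1 * |ξ| := by ring
            _ ≤ T * |(m₂ : ℝ)| * |ξ| := by gcongr; linarith
            _ ≤ 2 * T ^ 2 * (|(m₂ : ℝ)| * |ξ| / |(m₁ : ℝ)|) := by
                rw [mul_div_assoc', le_div_iff₀ hm0]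
                have : |(m₁ : ℝ)| ≤ 2 * T := by linarith [hm₁.2]
                have h0 : 0 ≤ T * |(m₂ : ℝ)| * |ξ| := by positivity
                nlinarith
    _ = (I₂.card : ℝ) * ((2 * M₂ / M₁) * (A * (2 * T ^ 2 / |ξ|) ^ 4)) := by rw [Finset.sum_const, nsmul_eq_mul]
    _ ≤ 6 * M₂ * ((2 * M₂ / M₁) * (A * (2 * T ^ 2 / |ξ|) ^ 4)) :=
        mul_le_mul_of_nonneg_right (card_shell_le hM₂ hI₂) (by positivity)
    _ = 192 * (M₂ ^ 2 / M₁) * T ^ 8 * A / |ξ| ^ 4 := by field_simp; ring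
    _ ≤ 192 * T ^ 2 * T ^ 8 * A / |ξ| ^ 4 := by
        gcongr
        rw [div_le_iff₀ (by linarith)]
        nlinarith
    _ = 192 * T ^ 10 * A / |ξ| ^ 4 := by ring

/-- `Φ_{m₁}` is continuous. [folklore] -/
theorem Phifun_continuous (I₂ : Finset ℤ) (m₁ : ℤ) : Continuous (Phifun f I₂ m₁) := by
  unfold Phifun
  refine (continuous_finsetSum _ fun m₂ _ ↦ ?_).norm
  exact continuous_const.mul ((continuous_fourier_fc hf hfs).comp (by fun_prop))

/-- `Ψ` is continuous. [folklore] -/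
theorem PsiF_continuous (I₂ : Finset ℤ) : Continuous (PsiF f I₂) := by
  unfold PsiF
  refine continuous_finsetSum _ fun m₂ _ ↦ ?_
  exact continuous_const.mul ((continuous_fourier_fc hf hfs).comp (by fun_prop))

/-- **`|Ψ|²` is integrable and `∫ |Ψ|² ≤ 72M₂³ ‖f‖₂²`** (Cauchy–Schwarz over `m₂`, dilation, Plancherel).
[cite: GuthMaynard2026, proof of Lemma 9.2] -/
theorem integral_normSq_PsiF_le {I₂ : Finset ℤ} {M₂ : ℝ} (hM₂ : 1 ≤ M₂)
    (hI₂ : ∀ m ∈ I₂, M₂ ≤ |(m : ℝ)| ∧ |(m : ℝ)| ≤ 2 * M₂) :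
    Integrable (fun x ↦ ‖PsiF f I₂ x‖ ^ 2) ∧ ∫ x, ‖PsiF f I₂ x‖ ^ 2 ≤ 72 * M₂ ^ 3 * ∫ y, f y ^ 2 := by
  -- pointwise Cauchy–Schwarz: `|Ψ(x)|² ≤ |I₂| ∑ |m₂|² |f̂(m₂x)|²`
  set h : ℝ → ℝ := fun x ↦ (I₂.card : ℝ) * ∑ m₂ ∈ I₂, |(m₂ : ℝ)| ^ 2 * ‖𝓕 (fun y ↦ ((f y : ℝ) : ℂ)) ((m₂ : ℝ) * x)‖ ^ 2
    with hh
  have hpt : ∀ x, ‖PsiF f I₂ x‖ ^ 2 ≤ h x := by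
    intro x
    have h1 : ‖PsiF f I₂ x‖ ≤ ∑ m₂ ∈ I₂, |(m₂ : ℝ)| * ‖𝓕 (fun y ↦ ((f y : ℝ) : ℂ)) ((m₂ : ℝ) * x)‖ := by
      refine (norm_sum_le _ _).trans (le_of_eq (Finset.sum_congr rfl fun m₂ _ ↦ ?_))
      rw [norm_mul, Complex.norm_real, Real.norm_of_nonneg (abs_nonneg _)]
    have h2 := Finset.sum_mul_sq_le_sq_mul_sq I₂ (fun _ ↦ (1 : ℝ))
      (fun m₂ ↦ |(m₂ : ℝ)| * ‖𝓕 (fun y ↦ ((f y : ℝ) : ℂ)) ((m₂ : ℝ) * x)‖)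
    simp only [one_mul, one_pow, Finset.sum_const, nsmul_eq_mul, mul_one] at h2
    calc ‖PsiF f I₂ x‖ ^ 2 ≤ (∑ m₂ ∈ I₂, |(m₂ : ℝ)| * ‖𝓕 (fun y ↦ ((f y : ℝ) : ℂ)) ((m₂ : ℝ) * x)‖) ^ 2 :=
          pow_le_pow_left₀ (norm_nonneg _) h1 2
      _ ≤ h x := by
          refine h2.trans (le_of_eq ?_)
          simp only [hh, mul_pow]
  have hm0 : ∀ m ∈ I₂, (m : ℝ) ≠ 0 := by
    intro m hm h; have := (hI₂ m hm).1; rw [h, abs_zero] at this; linarith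
  have hhi : Integrable h := by
    simp only [hh]
    refine Integrable.const_mul (integrable_finsetSum _ fun m₂ hm₂ ↦ ?_) _
    exact ((integral_normSq_fourier_comp_mul hf hfs (hm0 m₂ hm₂)).1).const_mul _
  have hmeas : AEStronglyMeasurable (fun x ↦ ‖PsiF f I₂ x‖ ^ 2) volume :=
    ((PsiF_continuous hf hfs I₂).norm.pow 2).aestronglyMeasurable
  have hint : Integrable (fun x ↦ ‖PsiF f I₂ x‖ ^ 2) :=
    hhi.mono' hmeas (Eventually.of_forall fun x ↦ by
      rw [Real.norm_of_nonneg (sq_nonneg _)]; exact hpt x)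
  refine ⟨hint, ?_⟩
  calc ∫ x, ‖PsiF f I₂ x‖ ^ 2 ≤ ∫ x, h x := integral_mono hint hhi hpt
    _ = (I₂.card : ℝ) * ∑ m₂ ∈ I₂, |(m₂ : ℝ)| ^ 2 * (|(m₂ : ℝ)|⁻¹ * ∫ y, f y ^ 2) := by
        simp only [hh]
        rw [integral_const_mul, integral_finsetSum _ (fun m₂ hm₂ ↦
          ((integral_normSq_fourier_comp_mul hf hfs (hm0 m₂ hm₂)).1).const_mul _)]
        congr 1
        refine Finset.sum_congr rfl fun m₂ hm₂ ↦ ?_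
        rw [integral_const_mul, (integral_normSq_fourier_comp_mul hf hfs (hm0 m₂ hm₂)).2]
    _ = (I₂.card : ℝ) * ∑ m₂ ∈ I₂, |(m₂ : ℝ)| * ∫ y, f y ^ 2 := by
        congr 1
        refine Finset.sum_congr rfl fun m₂ hm₂ ↦ ?_
        have := hm0 m₂ hm₂
        field_simp
    _ ≤ 6 * M₂ * ∑ m₂ ∈ I₂, 2 * M₂ * ∫ y, f y ^ 2 := by
        have hf2 : 0 ≤ ∫ y, f y ^ 2 := integral_nonneg fun y ↦ sq_nonneg _
        refine mul_le_mul (card_shell_le hM₂ hI₂) (Finset.sum_le_sum fun m₂ hm₂ ↦ ?_)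
          (Finset.sum_nonneg fun m₂ _ ↦ by positivity) (by positivity)
        exact mul_le_mul_of_nonneg_right (hI₂ m₂ hm₂).2 hf2
    _ = 6 * M₂ * ((I₂.card : ℝ) * (2 * M₂ * ∫ y, f y ^ 2)) := by rw [Finset.sum_const, nsmul_eq_mul]
    _ ≤ 6 * M₂ * (6 * M₂ * (2 * M₂ * ∫ y, f y ^ 2)) := by
        have hf2 : 0 ≤ ∫ y, f y ^ 2 := integral_nonneg fun y ↦ sq_nonneg _
        gcongr
        exact card_shell_le hM₂ hI₂
    _ = 72 * M₂ ^ 3 * ∫ y, f y ^ 2 := by ring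

/-- **`Φ_{m₁}²` is integrable** (`m₁ ≠ 0`). [folklore] -/
theorem integrable_Phifun_sq {I₂ : Finset ℤ} {M₂ : ℝ} (hM₂ : 1 ≤ M₂)
    (hI₂ : ∀ m ∈ I₂, M₂ ≤ |(m : ℝ)| ∧ |(m : ℝ)| ≤ 2 * M₂) {m₁ : ℤ} (hm₁ : m₁ ≠ 0) :
    Integrable (fun ξ ↦ Phifun f I₂ m₁ ξ ^ 2) := by
  have hm : (m₁ : ℝ) ≠ 0 := by exact_mod_cast hm₁
  -- `Φ(ξ)² = |Ψ(ξ/m₁)|²/m₁²`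
  have e : ∀ ξ, Phifun f I₂ m₁ ξ ^ 2 = (fun x ↦ ‖PsiF f I₂ x‖ ^ 2 / |(m₁ : ℝ)| ^ 2) (ξ / m₁) := by
    intro ξ
    have := Phifun_mul_eq f I₂ hm₁ (ξ / m₁)
    rw [mul_div_cancel₀ _ hm] at this
    simp only [this, div_pow]
  simp_rw [e]
  exact (((integral_normSq_PsiF_le hf hfs hM₂ hI₂).1).div_const _).comp_div hm

/-- `|ĝ|²` is integrable (`g` is smooth with compact support). [folklore] -/
theorem integrable_normSq_fourier_gfun (I₁ I₂ : Finset ℤ) (hI₁ : ∀ m ∈ I₁, m ≠ 0) (hI₂ : ∀ m ∈ I₂, m ≠ 0)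
    (M₃' : ℝ) (N₃ : ℕ) : Integrable (fun ξ ↦ ‖𝓕 (fun u ↦ ((gfun f I₁ I₂ M₃' N₃ u : ℝ) : ℂ)) ξ‖ ^ 2) := by
  have hsm : ContDiff ℝ ∞ (fun u ↦ ((gfun f I₁ I₂ M₃' N₃ u : ℝ) : ℂ)) :=
    Complex.ofRealCLM.contDiff.comp (gfun_contDiff hf I₁ I₂ M₃' N₃)
  have hcs : HasCompactSupport (fun u ↦ ((gfun f I₁ I₂ M₃' N₃ u : ℝ) : ℂ)) :=
    (hasCompactSupport_gfun hfs I₁ I₂ hI₁ hI₂ M₃' N₃).comp_left Complex.ofReal_zero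
  have h := (𝓕 (hcs.toSchwartzMap hsm)).memLp 2 (volume : Measure ℝ)
  have e1 : ((𝓕 (hcs.toSchwartzMap hsm) : SchwartzMap ℝ ℂ) : ℝ → ℂ) = 𝓕 (fun u ↦ ((gfun f I₁ I₂ M₃' N₃ u : ℝ) : ℂ)) := by
    rw [SchwartzMap.fourier_coe]; rfl
  rw [e1] at h
  exact (memLp_two_iff_integrable_sq_norm h.1).mp h

end props

/-! ## §5. The substitution `ξ = m₁x` -/

/-- **`∫ κ(ξ/m₁) Φ_{m₁}(ξ)² dξ = |m₁|^{-1} ∫ κ(x) |Ψ(x)|² dx`** for any function `κ` and `m₁ ≠ 0`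
("we write `ξ = ℓm₁ + (m₁/M₃)τ` and do a change of variables").
[cite: GuthMaynard2026, proof of Lemma 9.2, before (9.13)] -/
theorem integral_weight_Phifun_sq (f : ℝ → ℝ) (I₂ : Finset ℤ) (κ : ℝ → ℝ) {m₁ : ℤ} (hm₁ : m₁ ≠ 0) :
    ∫ ξ, κ (ξ / m₁) * Phifun f I₂ m₁ ξ ^ 2 = |(m₁ : ℝ)|⁻¹ * ∫ x, κ x * ‖PsiF f I₂ x‖ ^ 2 := by
  have hm : (m₁ : ℝ) ≠ 0 := by exact_mod_cast hm₁
  have h := Measure.integral_comp_mul_left (fun ξ ↦ κ (ξ / m₁) * Phifun f I₂ m₁ ξ ^ 2) (m₁ : ℝ)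
  -- `h : ∫ x, κ((m₁x)/m₁) Φ(m₁x)² = |m₁⁻¹| • ∫ ξ, κ(ξ/m₁)Φ(ξ)²`
  have e : ∀ x, κ ((m₁ : ℝ) * x / m₁) * Phifun f I₂ m₁ ((m₁ : ℝ) * x) ^ 2 =
      (|(m₁ : ℝ)| ^ 2)⁻¹ * (κ x * ‖PsiF f I₂ x‖ ^ 2) := by
    intro x
    rw [mul_div_cancel_left₀ _ hm, Phifun_mul_eq f I₂ hm₁ x, div_pow]
    field_simp
  simp only [e, integral_const_mul, smul_eq_mul, abs_inv] at h
  have habs : |(m₁ : ℝ)| ≠ 0 := abs_ne_zero.mpr hm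
  calc ∫ ξ, κ (ξ / m₁) * Phifun f I₂ m₁ ξ ^ 2
      = |(m₁ : ℝ)| * ((|(m₁ : ℝ)| ^ 2)⁻¹ * ∫ x, κ x * ‖PsiF f I₂ x‖ ^ 2) := by
        rw [h]; field_simp
    _ = |(m₁ : ℝ)|⁻¹ * ∫ x, κ x * ‖PsiF f I₂ x‖ ^ 2 := by field_simp

/-- `∑_{m₁∈I₁} |m₁|^{-1} ≤ 6` for `I₁ ⊂ {M₁ ≤ |m₁| ≤ 2M₁}`, `M₁ ≥ 1`. [folklore] -/
theorem sum_inv_abs_le {I₁ : Finset ℤ} {M₁ : ℝ} (hM₁ : 1 ≤ M₁) (hI₁ : ∀ m ∈ I₁, M₁ ≤ |(m : ℝ)| ∧ |(m : ℝ)| ≤ 2 * M₁) :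
    ∑ m₁ ∈ I₁, |(m₁ : ℝ)|⁻¹ ≤ 6 := by
  have hM0 : 0 < M₁ := by linarith
  calc ∑ m₁ ∈ I₁, |(m₁ : ℝ)|⁻¹ ≤ ∑ m₁ ∈ I₁, M₁⁻¹ :=
        Finset.sum_le_sum fun m₁ hm₁ ↦ inv_anti₀ hM0 (hI₁ m₁ hm₁).1
    _ = (I₁.card : ℝ) * M₁⁻¹ := by rw [Finset.sum_const, nsmul_eq_mul]
    _ ≤ 6 * M₁ * M₁⁻¹ := mul_le_mul_of_nonneg_right (card_shell_le hM₁ hI₁) (by positivity)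
    _ = 6 := by field_simp

/-! ## §6. The `ξ`-integral -/

/-- `(1+|ξ|)^{-2} ≤ (1+ξ²)^{-1}`, whose integral over `ℝ` is `π`. [folklore] -/
theorem inv_one_add_abs_sq_le (ξ : ℝ) : ((1 + |ξ|) ^ 2)⁻¹ ≤ (1 + ξ ^ 2)⁻¹ := by
  apply inv_anti₀ (by positivity)
  have : ξ ^ 2 = |ξ| ^ 2 := (sq_abs ξ).symm
  nlinarith [abs_nonneg ξ]

section main

variable {f : ℝ → ℝ} (hf : ContDiff ℝ ∞ f) (hfs : HasCompactSupport f) (hf0 : ∀ x, 0 ≤ f x)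
include hf hfs hf0

set_option maxHeartbeats 3200000 in
/-- **The `ξ`-integral of `|ĝ|²` (Guth–Maynard (9.7)–(9.12)).** Let `f ≥ 0` be smooth with compact
support, `fc` its complexification, `A ≥ 0` with `|f̂(ζ)| ≤ A(T/|ζ|)⁴` (`ζ ≠ 0`) and `A ≤ T²‖f‖₁`; let
`T ≥ 1`, `1 ≤ M₁, M₂ ≤ T`, `1 ≤ M₃' ≤ 1001T`, `I₁ ⊂ {M₁ ≤ |m| ≤ 2M₁}`, `I₂ ⊂ {M₂ ≤ |m| ≤ 2M₂}`, `N₃ ≥ 3M₃'`,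
`L ≥ T⁶ + T`; let `K` bound `ψ̂₁` through `|ψ̂₁(y)| ≤ K(1+|y|)^{-2}` and `≤ K(1+|y|)^{-j}` (`j ≥ 2`), and
let `S_II ≥ 0` bound `∑_{m₁} perK(ξ/m₁)` on `T^ηM₁/M₃' < |ξ| ≤ T⁶`. Then
`∫ g² ≤ 3·10⁶ K² T^η M₁M₂⁴M₃' ‖f‖₁² + 6 S_II (∫ ktil L M₃' x |Ψ(x)|² dx + 8KM₃'T^{2−j} ∫|Ψ|²) + 10¹⁸ K² T^{-8} ‖f‖₁²`.
[cite: GuthMaynard2026, proof of Lemma 9.2, (9.7)–(9.12)] -/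
theorem integral_gfun_sq_le {T η A K S_II : ℝ} {M₁ M₂ M₃' : ℝ} {I₁ I₂ : Finset ℤ} {N₃ L : ℕ} {j : ℕ}
    (hT : 1 ≤ T) (_hη : 0 ≤ η) (hA : 0 ≤ A) (hAT : A ≤ T ^ 2 * ∫ y, f y) (hK : 0 ≤ K) (hS : 0 ≤ S_II)
    (hM₁ : 1 ≤ M₁) (hM₁T : M₁ ≤ T) (hM₂ : 1 ≤ M₂) (hM₂T : M₂ ≤ T) (hM₃' : 1 ≤ M₃') (hM₃'T : M₃' ≤ 1001 * T)
    (hI₁ : ∀ m ∈ I₁, M₁ ≤ |(m : ℝ)| ∧ |(m : ℝ)| ≤ 2 * M₁) (hI₂ : ∀ m ∈ I₂, M₂ ≤ |(m : ℝ)| ∧ |(m : ℝ)| ≤ 2 * M₂)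
    (hN₃ : 3 * M₃' ≤ N₃) (hL : T ^ 6 + T ≤ L) (hj : 2 ≤ j)
    (hK2 : ∀ y, ‖𝓕 psi1c y‖ ≤ K / (1 + |y|) ^ 2) (hKj : ∀ y, ‖𝓕 psi1c y‖ ≤ K / (1 + |y|) ^ j)
    (hdec : ∀ ζ : ℝ, ζ ≠ 0 → ‖𝓕 (fun y ↦ ((f y : ℝ) : ℂ)) ζ‖ ≤ A * (T / |ζ|) ^ 4)
    (hSII : ∀ ξ : ℝ, T ^ η * M₁ / M₃' < |ξ| → |ξ| ≤ T ^ 6 →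
      ∑ m₁ ∈ I₁, perK (𝓕 psi1c) M₃' (ξ / m₁) ≤ S_II) :
    ∫ u, gfun f I₁ I₂ M₃' N₃ u ^ 2 ≤
      3000000 * K ^ 2 * T ^ η * M₁ * M₂ ^ 4 * M₃' * (∫ y, f y) ^ 2 +
      6 * S_II * ((∫ x, ktil L M₃' x * ‖PsiF f I₂ x‖ ^ 2) + 8 * K * M₃' * T ^ ((2 : ℝ) - j) * ∫ x, ‖PsiF f I₂ x‖ ^ 2) +
      (10 : ℝ) ^ 18 * K ^ 2 * T ^ (-(8 : ℝ)) * (∫ y, f y) ^ 2 := by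
  have hT0 : 0 < T := by linarith
  have hM₃'0 : 0 < M₃' := by linarith
  have hI₁0 : ∀ m ∈ I₁, m ≠ 0 := by
    intro m hm h; have := (hI₁ m hm).1; rw [h, Int.cast_zero, abs_zero] at this; linarith
  have hI₂0 : ∀ m ∈ I₂, m ≠ 0 := by
    intro m hm h; have := (hI₂ m hm).1; rw [h, Int.cast_zero, abs_zero] at this; linarith
  set fc : ℝ → ℂ := fun y ↦ ((f y : ℝ) : ℂ) with hfc
  set N1 : ℝ := ∫ y, f y with hN1
  have hN10 : 0 ≤ N1 := integral_nonneg hf0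
  set gc : ℝ → ℂ := fun u ↦ ((gfun f I₁ I₂ M₃' N₃ u : ℝ) : ℂ) with hgc
  set X₀ : ℝ := T ^ η * M₁ / M₃' with hX₀
  have hX₀0 : 0 ≤ X₀ := by positivity
  set εt : ℝ := 8 * K * M₃' * T ^ ((2 : ℝ) - j) with hεt
  have hεt0 : 0 ≤ εt := by positivity
  set κp : ℝ → ℝ := fun x ↦ ktil L M₃' x + εt with hκp
  have hκp0 : ∀ x, 0 ≤ κp x := fun x ↦ add_nonneg (ktil_nonneg L hM₃'0.le x) hεt0
  have hκpc : Continuous κp := (ktil_continuous L M₃').add continuous_const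
  have hκp_le : ∀ x, κp x ≤ 16 * K * M₃' := by
    intro x
    have h1 := ktil_le hK hK2 L hM₃' x
    have h2 : εt ≤ 8 * K * M₃' := by
      rw [hεt]
      have : T ^ ((2 : ℝ) - j) ≤ 1 := Real.rpow_le_one_of_one_le_of_nonpos hT (by
        have : (2:ℝ) ≤ j := by exact_mod_cast hj
        linarith)
      calc 8 * K * M₃' * T ^ ((2 : ℝ) - j) ≤ 8 * K * M₃' * 1 := by gcongr
        _ = _ := mul_one _
    simp only [hκp]; linarith
  -- `perK ≤ κp` on `|x| ≤ T⁶`, `perK ≤ 8KM₃'` everywhere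
  have hperK_le : ∀ x, |x| ≤ T ^ 6 → perK (𝓕 psi1c) M₃' x ≤ κp x := fun x hx ↦
    perK_le_ktil_add hK hj hKj hT hL hM₃' hx
  have hperK_max : ∀ x, perK (𝓕 psi1c) M₃' x ≤ 8 * K * M₃' := fun x ↦ perK_le hK hK2 hM₃' x
  -- the functions `Φ`, `V⁺`
  set Φ : ℤ → ℝ → ℝ := fun m₁ ξ ↦ Phifun f I₂ m₁ ξ with hΦ
  have hΦ0 : ∀ m₁ ξ, 0 ≤ Φ m₁ ξ := fun m₁ ξ ↦ norm_nonneg _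
  have hΦ_le : ∀ m₁ ∈ I₁, ∀ ξ, Φ m₁ ξ ≤ 12 * M₂ ^ 2 * N1 / M₁ := fun m₁ hm₁ ξ ↦
    Phifun_le hf0 hM₁ hM₂ hI₂ (hI₁ m₁ hm₁).1 ξ
  have hΦ_dec : ∀ m₁ ∈ I₁, ∀ ξ, ξ ≠ 0 → Φ m₁ ξ ≤ 192 * T ^ 10 * A / |ξ| ^ 4 := fun m₁ hm₁ ξ hξ ↦
    Phifun_le_decay hM₁ hM₁T hM₂ hM₂T hA hI₂ (hI₁ m₁ hm₁) hdec hξ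
  set Vp : ℝ → ℝ := fun ξ ↦ ∑ m₁ ∈ I₁, κp (ξ / m₁) * Φ m₁ ξ ^ 2 with hVp
  have hVp0 : ∀ ξ, 0 ≤ Vp ξ := fun ξ ↦ Finset.sum_nonneg fun m₁ _ ↦ mul_nonneg (hκp0 _) (sq_nonneg _)
  have hVpi : Integrable Vp := by
    simp only [hVp]
    refine integrable_finsetSum _ fun m₁ hm₁ ↦ ?_
    have h1 := integrable_Phifun_sq hf hfs hM₂ hI₂ (hI₁0 m₁ hm₁)
    refine (h1.const_mul (16 * K * M₃')).mono' ?_ (Eventually.of_forall fun ξ ↦ ?_)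
    · exact ((hκpc.comp (continuous_id.div_const _)).mul ((Phifun_continuous hf hfs I₂ m₁).pow 2)).aestronglyMeasurable
    · rw [Real.norm_of_nonneg (mul_nonneg (hκp0 _) (sq_nonneg _))]
      exact mul_le_mul_of_nonneg_right (hκp_le _) (sq_nonneg _)
  -- Plancherel and the pointwise majorant
  have hPl := integral_gfun_sq_eq hf hfs I₁ I₂ hI₁0 hI₂0 M₃' N₃
  set BI : ℝ := 6 * M₁ * (8 * K * M₃') * (12 * M₂ ^ 2 * N1 / M₁) with hBI
  have hBI0 : 0 ≤ BI := by positivity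
  set W₀ : ℝ := (8 * K * M₃' * (6 * M₁) * (192 * T ^ 10 * A)) ^ 2 with hW₀
  have hW₀0 : 0 ≤ W₀ := by positivity
  set maj : ℝ → ℝ := fun ξ ↦ (Set.Icc (-X₀) X₀).indicator (fun _ ↦ BI ^ 2) ξ + S_II * Vp ξ +
    2 * W₀ * T ^ (-(36 : ℝ)) * (1 + ξ ^ 2)⁻¹ with hmaj
  -- `#I₁ ≤ 6M₁`
  have hcard₁ := card_shell_le hM₁ hI₁
  -- pointwise: `‖ĝ(ξ)‖² ≤ maj ξ`
  have hpt : ∀ ξ, ‖𝓕 gc ξ‖ ^ 2 ≤ maj ξ := by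
    intro ξ
    have hbase := norm_fourier_gfun_le hf hfs I₁ I₂ hI₁0 hI₂0 hM₃'0 hN₃ ξ
    have hind0 : 0 ≤ (Set.Icc (-X₀) X₀).indicator (fun _ ↦ BI ^ 2) ξ := Set.indicator_nonneg (fun _ _ ↦ sq_nonneg _) _
    have hlast0 : 0 ≤ 2 * W₀ * T ^ (-(36 : ℝ)) * (1 + ξ ^ 2)⁻¹ := by positivity
    by_cases h1 : |ξ| ≤ X₀
    · -- region I: `‖ĝ‖ ≤ ∑ 8KM₃' Φ ≤ BI`
      have hmem : ξ ∈ Set.Icc (-X₀) X₀ := by rw [Set.mem_Icc, ← abs_le]; exact h1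
      have h2 : ‖𝓕 gc ξ‖ ≤ BI := by
        refine hbase.trans ?_
        calc ∑ m₁ ∈ I₁, perK (𝓕 psi1c) M₃' (ξ / m₁) * Phifun f I₂ m₁ ξ
            ≤ ∑ m₁ ∈ I₁, (8 * K * M₃') * (12 * M₂ ^ 2 * N1 / M₁) :=
              Finset.sum_le_sum fun m₁ hm₁ ↦ mul_le_mul (hperK_max _) (hΦ_le m₁ hm₁ ξ) (hΦ0 _ _) (by positivity)
          _ = (I₁.card : ℝ) * ((8 * K * M₃') * (12 * M₂ ^ 2 * N1 / M₁)) := by rw [Finset.sum_const, nsmul_eq_mul]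
          _ ≤ 6 * M₁ * ((8 * K * M₃') * (12 * M₂ ^ 2 * N1 / M₁)) := mul_le_mul_of_nonneg_right hcard₁ (by positivity)
          _ = BI := by rw [hBI]; ring
      simp only [hmaj]
      rw [Set.indicator_of_mem hmem]
      have : ‖𝓕 gc ξ‖ ^ 2 ≤ BI ^ 2 := pow_le_pow_left₀ (norm_nonneg _) h2 2
      have : 0 ≤ S_II * Vp ξ := mul_nonneg hS (hVp0 ξ)
      linarith
    · push Not at h1
      by_cases h2 : |ξ| ≤ T ^ 6
      · -- region II: `‖ĝ‖² ≤ S(ξ) V(ξ) ≤ S_II V⁺(ξ)`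
        have hCS := normSq_fourier_gfun_le hf hfs I₁ I₂ hI₁0 hI₂0 hM₃'0 hN₃ ξ
        have hSle := hSII ξ h1 h2
        have hVle : ∑ m₁ ∈ I₁, perK (𝓕 psi1c) M₃' (ξ / m₁) * Phifun f I₂ m₁ ξ ^ 2 ≤ Vp ξ := by
          simp only [hVp]
          refine Finset.sum_le_sum fun m₁ hm₁ ↦ mul_le_mul_of_nonneg_right (hperK_le _ ?_) (sq_nonneg _)
          rw [abs_div]
          exact (div_le_self (abs_nonneg ξ) (by linarith [(hI₁ m₁ hm₁).1])).trans h2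
        have hS0 : 0 ≤ ∑ m₁ ∈ I₁, perK (𝓕 psi1c) M₃' (ξ / m₁) := Finset.sum_nonneg fun m₁ _ ↦ perK_nonneg _ hM₃'0.le _
        have hV0 : 0 ≤ ∑ m₁ ∈ I₁, perK (𝓕 psi1c) M₃' (ξ / m₁) * Phifun f I₂ m₁ ξ ^ 2 :=
          Finset.sum_nonneg fun m₁ _ ↦ mul_nonneg (perK_nonneg _ hM₃'0.le _) (sq_nonneg _)
        calc ‖𝓕 gc ξ‖ ^ 2 ≤ _ := hCS
          _ ≤ S_II * Vp ξ := mul_le_mul hSle hVle hV0 hS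
          _ ≤ maj ξ := by simp only [hmaj]; linarith
      · -- region III: `‖ĝ‖ ≤ 8KM₃' · 6M₁ · 192T^{10}A/ξ⁴`
        push Not at h2
        have hξ1 : 1 ≤ |ξ| := le_trans (one_le_pow₀ hT) h2.le
        have hξ0 : ξ ≠ 0 := by intro h; rw [h, abs_zero] at hξ1; linarith
        have h3 : ‖𝓕 gc ξ‖ ≤ 8 * K * M₃' * (6 * M₁) * (192 * T ^ 10 * A) / |ξ| ^ 4 := by
          refine hbase.trans ?_
          calc ∑ m₁ ∈ I₁, perK (𝓕 psi1c) M₃' (ξ / m₁) * Phifun f I₂ m₁ ξ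
              ≤ ∑ m₁ ∈ I₁, (8 * K * M₃') * (192 * T ^ 10 * A / |ξ| ^ 4) :=
                Finset.sum_le_sum fun m₁ hm₁ ↦ mul_le_mul (hperK_max _) (hΦ_dec m₁ hm₁ ξ hξ0) (hΦ0 _ _) (by positivity)
            _ = (I₁.card : ℝ) * ((8 * K * M₃') * (192 * T ^ 10 * A / |ξ| ^ 4)) := by rw [Finset.sum_const, nsmul_eq_mul]
            _ ≤ 6 * M₁ * ((8 * K * M₃') * (192 * T ^ 10 * A / |ξ| ^ 4)) := mul_le_mul_of_nonneg_right hcard₁ (by positivity)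
            _ = _ := by ring
        have h4 : ‖𝓕 gc ξ‖ ^ 2 ≤ W₀ / |ξ| ^ 8 := by
          calc ‖𝓕 gc ξ‖ ^ 2 ≤ (8 * K * M₃' * (6 * M₁) * (192 * T ^ 10 * A) / |ξ| ^ 4) ^ 2 := pow_le_pow_left₀ (norm_nonneg _) h3 2
            _ = W₀ / |ξ| ^ 8 := by rw [hW₀, div_pow]; ring
        -- `W₀/|ξ|⁸ ≤ 2W₀ T^{-36} (1+ξ²)^{-1}` using `|ξ| ≥ T⁶ ≥ 1`
        have h5 : W₀ / |ξ| ^ 8 ≤ 2 * W₀ * T ^ (-(36 : ℝ)) * (1 + ξ ^ 2)⁻¹ := by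
          have hT36 : T ^ (-(36 : ℝ)) = ((T ^ 6) ^ 6)⁻¹ := by
            rw [Real.rpow_neg hT0.le, show (36 : ℝ) = ((36 : ℕ) : ℝ) by norm_num, Real.rpow_natCast]; ring
          rw [hT36, div_eq_mul_inv]
          have key : (T ^ 6) ^ 6 * (1 + ξ ^ 2) ≤ 2 * |ξ| ^ 8 := by
            have h7 : (T ^ 6) ^ 6 ≤ |ξ| ^ 6 := pow_le_pow_left₀ (by positivity) h2.le 6
            have h8 : 1 + ξ ^ 2 ≤ 2 * |ξ| ^ 2 := by rw [← sq_abs]; nlinarith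
            calc (T ^ 6) ^ 6 * (1 + ξ ^ 2) ≤ |ξ| ^ 6 * (2 * |ξ| ^ 2) := mul_le_mul h7 h8 (by positivity) (by positivity)
              _ = 2 * |ξ| ^ 8 := by ring
          have hpos1 : 0 < (T ^ 6) ^ 6 * (1 + ξ ^ 2) := by positivity
          have hpos2 : 0 < |ξ| ^ 8 := by positivity
          calc W₀ * (|ξ| ^ 8)⁻¹ ≤ W₀ * (2 / ((T ^ 6) ^ 6 * (1 + ξ ^ 2))) := by
                refine mul_le_mul_of_nonneg_left ?_ hW₀0
                rw [inv_eq_one_div, div_le_div_iff₀ hpos2 hpos1]; linarith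
            _ = 2 * W₀ * ((T ^ 6) ^ 6)⁻¹ * (1 + ξ ^ 2)⁻¹ := by field_simp
        calc ‖𝓕 gc ξ‖ ^ 2 ≤ W₀ / |ξ| ^ 8 := h4
          _ ≤ 2 * W₀ * T ^ (-(36 : ℝ)) * (1 + ξ ^ 2)⁻¹ := h5
          _ ≤ maj ξ := by
              simp only [hmaj]
              have : 0 ≤ S_II * Vp ξ := mul_nonneg hS (hVp0 ξ)
              linarith
  -- integrability of the majorant and of `|ĝ|²`
  have hgi := integrable_normSq_fourier_gfun hf hfs I₁ I₂ hI₁0 hI₂0 M₃' N₃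
  have hind_i : Integrable ((Set.Icc (-X₀) X₀).indicator (fun _ : ℝ ↦ BI ^ 2)) := by
    rw [integrable_indicator_iff measurableSet_Icc]
    exact integrableOn_const (by rw [Real.volume_Icc]; exact ENNReal.ofReal_ne_top)
  have hlast_i : Integrable (fun ξ : ℝ ↦ 2 * W₀ * T ^ (-(36 : ℝ)) * (1 + ξ ^ 2)⁻¹) :=
    integrable_inv_one_add_sq.const_mul _
  have hmaji : Integrable maj := by
    simp only [hmaj]
    exact (hind_i.add (hVpi.const_mul S_II)).add hlast_i
  -- integrate
  have hstep1 : ∫ u, gfun f I₁ I₂ M₃' N₃ u ^ 2 ≤ ∫ ξ, maj ξ := by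
    rw [hPl]
    exact integral_mono hgi hmaji hpt
  have hmaj_int : ∫ ξ, maj ξ = BI ^ 2 * (2 * X₀) + S_II * (∫ ξ, Vp ξ) + 2 * W₀ * T ^ (-(36 : ℝ)) * π := by
    simp only [hmaj]
    have hB : Integrable (fun ξ ↦ S_II * Vp ξ) := hVpi.const_mul S_II
    have hA : Integrable (fun ξ ↦ (Set.Icc (-X₀) X₀).indicator (fun _ ↦ BI ^ 2) ξ + S_II * Vp ξ) :=
      hind_i.add hB
    rw [integral_add hA hlast_i, integral_add hind_i hB,
      integral_indicator measurableSet_Icc, setIntegral_const, integral_const_mul, integral_const_mul,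
      integral_univ_inv_one_add_sq, Real.volume_real_Icc_of_le (by linarith)]
    simp only [smul_eq_mul]
    ring
  -- `∫ Vp ≤ 6 (∫ ktil |Ψ|² + εt ∫ |Ψ|²)`
  have hPsi := integral_normSq_PsiF_le hf hfs hM₂ hI₂
  have hktil_i : Integrable (fun x ↦ ktil L M₃' x * ‖PsiF f I₂ x‖ ^ 2) := by
    refine (hPsi.1.const_mul (8 * K * M₃')).mono' ?_ (Eventually.of_forall fun x ↦ ?_)
    · exact ((ktil_continuous L M₃').mul ((PsiF_continuous hf hfs I₂).norm.pow 2)).aestronglyMeasurable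
    · rw [Real.norm_of_nonneg (mul_nonneg (ktil_nonneg L hM₃'0.le x) (sq_nonneg _))]
      exact mul_le_mul_of_nonneg_right (ktil_le hK hK2 L hM₃' x) (sq_nonneg _)
  have hκp_int : ∫ x, κp x * ‖PsiF f I₂ x‖ ^ 2 = (∫ x, ktil L M₃' x * ‖PsiF f I₂ x‖ ^ 2) + εt * ∫ x, ‖PsiF f I₂ x‖ ^ 2 := by
    simp only [hκp, add_mul]
    rw [integral_add hktil_i (hPsi.1.const_mul εt), integral_const_mul]
  have hQ0 : 0 ≤ ∫ x, κp x * ‖PsiF f I₂ x‖ ^ 2 := integral_nonneg fun x ↦ mul_nonneg (hκp0 x) (sq_nonneg _)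
  have hVp_int : ∫ ξ, Vp ξ ≤ 6 * ((∫ x, ktil L M₃' x * ‖PsiF f I₂ x‖ ^ 2) + εt * ∫ x, ‖PsiF f I₂ x‖ ^ 2) := by
    have hterm_i : ∀ m₁ ∈ I₁, Integrable (fun ξ ↦ κp (ξ / m₁) * Φ m₁ ξ ^ 2) := by
      intro m₁ hm₁
      have h1 := integrable_Phifun_sq hf hfs hM₂ hI₂ (hI₁0 m₁ hm₁)
      refine (h1.const_mul (16 * K * M₃')).mono' ?_ (Eventually.of_forall fun ξ ↦ ?_)
      · exact ((hκpc.comp (continuous_id.div_const _)).mul ((Phifun_continuous hf hfs I₂ m₁).pow 2)).aestronglyMeasurable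
      · rw [Real.norm_of_nonneg (mul_nonneg (hκp0 _) (sq_nonneg _))]
        exact mul_le_mul_of_nonneg_right (hκp_le _) (sq_nonneg _)
    calc ∫ ξ, Vp ξ = ∑ m₁ ∈ I₁, ∫ ξ, κp (ξ / m₁) * Φ m₁ ξ ^ 2 := by
          simp only [hVp]; rw [integral_finsetSum _ hterm_i]
      _ = ∑ m₁ ∈ I₁, |(m₁ : ℝ)|⁻¹ * ∫ x, κp x * ‖PsiF f I₂ x‖ ^ 2 :=
          Finset.sum_congr rfl fun m₁ hm₁ ↦ integral_weight_Phifun_sq f I₂ κp (hI₁0 m₁ hm₁)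
      _ = (∑ m₁ ∈ I₁, |(m₁ : ℝ)|⁻¹) * ∫ x, κp x * ‖PsiF f I₂ x‖ ^ 2 := by rw [Finset.sum_mul]
      _ ≤ 6 * ∫ x, κp x * ‖PsiF f I₂ x‖ ^ 2 := mul_le_mul_of_nonneg_right (sum_inv_abs_le hM₁ hI₁) hQ0
      _ = _ := by rw [hκp_int]
  -- numerical constants
  have hPsi2 : 0 ≤ ∫ x, ‖PsiF f I₂ x‖ ^ 2 := integral_nonneg fun x ↦ sq_nonneg _
  have hmain0 : 0 ≤ (∫ x, ktil L M₃' x * ‖PsiF f I₂ x‖ ^ 2) + εt * ∫ x, ‖PsiF f I₂ x‖ ^ 2 := by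
    have : 0 ≤ ∫ x, ktil L M₃' x * ‖PsiF f I₂ x‖ ^ 2 := integral_nonneg fun x ↦ mul_nonneg (ktil_nonneg L hM₃'0.le x) (sq_nonneg _)
    positivity
  have hBI_val : BI ^ 2 * (2 * X₀) = 663552 * K ^ 2 * T ^ η * M₁ * M₂ ^ 4 * M₃' * N1 ^ 2 := by
    rw [hBI, hX₀]; field_simp; ring
  have hW_val : 2 * W₀ * T ^ (-(36 : ℝ)) * π ≤ (10 : ℝ) ^ 18 * K ^ 2 * T ^ (-(8 : ℝ)) * N1 ^ 2 := by
    -- `W₀ ≤ (9216 K M₃' M₁ T^{10} A)² ≤ (9216·1001 K T^{14} N1)²`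
    have h1 : 8 * K * M₃' * (6 * M₁) * (192 * T ^ 10 * A) ≤ 9216 * 1001 * K * T ^ 14 * N1 := by
      have e : 8 * K * M₃' * (6 * M₁) * (192 * T ^ 10 * A) = 9216 * K * (M₃' * M₁ * A) * T ^ 10 := by ring
      rw [e]
      have h2 : M₃' * M₁ * A ≤ 1001 * T * T * (T ^ 2 * N1) := by
        have := mul_le_mul hM₃'T hM₁T (by linarith) (by positivity)
        exact mul_le_mul this hAT hA (by positivity)
      calc 9216 * K * (M₃' * M₁ * A) * T ^ 10 ≤ 9216 * K * (1001 * T * T * (T ^ 2 * N1)) * T ^ 10 := by gcongr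
        _ = 9216 * 1001 * K * T ^ 14 * N1 := by ring
    have h3 : W₀ ≤ (9216 * 1001 * K * T ^ 14 * N1) ^ 2 := by
      rw [hW₀]; exact pow_le_pow_left₀ (by positivity) h1 2
    have hπ4 : π ≤ 4 := Real.pi_le_four
    have hT36 : T ^ (-(36 : ℝ)) * (T ^ 14) ^ 2 = T ^ (-(8 : ℝ)) := by
      rw [show (T ^ 14 : ℝ) ^ 2 = T ^ (28 : ℝ) by norm_cast; ring, ← Real.rpow_add hT0]; norm_num
    calc 2 * W₀ * T ^ (-(36 : ℝ)) * π ≤ 2 * (9216 * 1001 * K * T ^ 14 * N1) ^ 2 * T ^ (-(36 : ℝ)) * 4 := by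
          gcongr
      _ = 8 * (9216 * 1001) ^ 2 * K ^ 2 * (T ^ (-(36 : ℝ)) * (T ^ 14) ^ 2) * N1 ^ 2 := by ring
      _ = 8 * (9216 * 1001) ^ 2 * K ^ 2 * T ^ (-(8 : ℝ)) * N1 ^ 2 := by rw [hT36]
      _ ≤ (10 : ℝ) ^ 18 * K ^ 2 * T ^ (-(8 : ℝ)) * N1 ^ 2 := by
          have : 0 ≤ K ^ 2 * T ^ (-(8 : ℝ)) * N1 ^ 2 := by positivity
          nlinarith
  calc ∫ u, gfun f I₁ I₂ M₃' N₃ u ^ 2 ≤ ∫ ξ, maj ξ := hstep1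
    _ = BI ^ 2 * (2 * X₀) + S_II * (∫ ξ, Vp ξ) + 2 * W₀ * T ^ (-(36 : ℝ)) * π := hmaj_int
    _ ≤ 663552 * K ^ 2 * T ^ η * M₁ * M₂ ^ 4 * M₃' * N1 ^ 2 +
        S_II * (6 * ((∫ x, ktil L M₃' x * ‖PsiF f I₂ x‖ ^ 2) + εt * ∫ x, ‖PsiF f I₂ x‖ ^ 2)) +
        (10 : ℝ) ^ 18 * K ^ 2 * T ^ (-(8 : ℝ)) * N1 ^ 2 := by
        rw [hBI_val]
        gcongr
    _ ≤ 3000000 * K ^ 2 * T ^ η * M₁ * M₂ ^ 4 * M₃' * N1 ^ 2 +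
        6 * S_II * ((∫ x, ktil L M₃' x * ‖PsiF f I₂ x‖ ^ 2) + εt * ∫ x, ‖PsiF f I₂ x‖ ^ 2) +
        (10 : ℝ) ^ 18 * K ^ 2 * T ^ (-(8 : ℝ)) * N1 ^ 2 := by
        have : 0 ≤ K ^ 2 * T ^ η * M₁ * M₂ ^ 4 * M₃' * N1 ^ 2 := by positivity
        nlinarith
    _ = _ := by rw [hεt]

end main

/-! # Part B — the second Poisson summation and the smoothing `f̃` -/


/-! ## §1. The smoothing kernel `ρ_T` and `f̃ = ρ_T ⋆ f` -/

/-- The smoothing kernel `ρ_T(z) = 2LM₂K'(1+LM₂|z|)^{-j} 1_{|z| ≤ T^{-2}}` (the paper's `Tψ(T(u−u'))`, here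
chosen non-smooth but dominating; `f` itself is smooth). [cite: GuthMaynard2026, Lemma 9.2 (definition of `f̃`)] -/
def rhoT (L M₂ K' T : ℝ) (j : ℕ) : ℝ → ℝ :=
  (Set.Icc (-(T ^ 2)⁻¹) (T ^ 2)⁻¹).indicator (fun z ↦ 2 * L * M₂ * K' / (1 + L * M₂ * |z|) ^ j)

/-- **`f̃ = ρ_T ⋆ f`**. [cite: GuthMaynard2026, Lemma 9.2 (definition of `f̃`)] -/
def fsm (L M₂ K' T : ℝ) (j : ℕ) (f : ℝ → ℝ) : ℝ → ℝ := rhoT L M₂ K' T j ⋆ f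

section kernel

variable {L M₂ K' T : ℝ} {j : ℕ}

/-- The un-truncated kernel is bounded by its value at `0`. [folklore] -/
theorem kernel_aux_le (_hL : 0 ≤ L) (_hM₂ : 0 ≤ M₂) (_hK' : 0 ≤ K') (j : ℕ) (z : ℝ) :
    2 * L * M₂ * K' / (1 + L * M₂ * |z|) ^ j ≤ 2 * L * M₂ * K' := by
  refine div_le_self (by positivity) (one_le_pow₀ ?_)
  have : 0 ≤ L * M₂ * |z| := by positivity
  linarith

/-- `ρ_T ≥ 0`. [folklore] -/
theorem rhoT_nonneg (_hL : 0 ≤ L) (_hM₂ : 0 ≤ M₂) (_hK' : 0 ≤ K') (T : ℝ) (j : ℕ) (z : ℝ) :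
    0 ≤ rhoT L M₂ K' T j z := by
  unfold rhoT
  exact Set.indicator_nonneg (fun _ _ ↦ by positivity) _

/-- `ρ_T ≤ 2LM₂K'`. [folklore] -/
theorem rhoT_le (hL : 0 ≤ L) (hM₂ : 0 ≤ M₂) (hK' : 0 ≤ K') (T : ℝ) (j : ℕ) (z : ℝ) :
    rhoT L M₂ K' T j z ≤ 2 * L * M₂ * K' := by
  unfold rhoT
  by_cases hz : z ∈ Set.Icc (-(T ^ 2)⁻¹) (T ^ 2)⁻¹
  · rw [Set.indicator_of_mem hz]
    exact kernel_aux_le hL hM₂ hK' j z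
  · rw [Set.indicator_of_notMem hz]; positivity

/-- `ρ_T ≤` the un-truncated kernel. [folklore] -/
theorem rhoT_le_kernel (_hL : 0 ≤ L) (_hM₂ : 0 ≤ M₂) (_hK' : 0 ≤ K') (T : ℝ) (j : ℕ) (z : ℝ) :
    rhoT L M₂ K' T j z ≤ 2 * L * M₂ * K' / (1 + L * M₂ * |z|) ^ j := by
  unfold rhoT
  by_cases hz : z ∈ Set.Icc (-(T ^ 2)⁻¹) (T ^ 2)⁻¹
  · rw [Set.indicator_of_mem hz]
  · rw [Set.indicator_of_notMem hz]; positivity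

/-- `ρ_T(z) = 0` for `|z| > T^{-2}`. [folklore] -/
theorem rhoT_eq_zero (L M₂ K' : ℝ) {T : ℝ} (j : ℕ) {z : ℝ} (hz : (T ^ 2)⁻¹ < |z|) : rhoT L M₂ K' T j z = 0 := by
  unfold rhoT
  rw [Set.indicator_of_notMem]
  rw [Set.mem_Icc, ← abs_le]
  exact not_le.mpr hz

/-- `ρ_T` is measurable. [folklore] -/
theorem rhoT_measurable (L M₂ K' T : ℝ) (j : ℕ) : Measurable (rhoT L M₂ K' T j) := by
  unfold rhoT
  refine Measurable.indicator ?_ measurableSet_Icc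
  fun_prop

/-- `ρ_T` is integrable. [folklore] -/
theorem rhoT_integrable (hL : 0 ≤ L) (hM₂ : 0 ≤ M₂) (hK' : 0 ≤ K') (T : ℝ) (j : ℕ) :
    Integrable (rhoT L M₂ K' T j) := by
  unfold rhoT
  rw [integrable_indicator_iff measurableSet_Icc]
  refine Measure.integrableOn_of_bounded (M := 2 * L * M₂ * K') (by rw [Real.volume_Icc]; exact ENNReal.ofReal_ne_top)
    (by fun_prop : Measurable fun z : ℝ ↦ 2 * L * M₂ * K' / (1 + L * M₂ * |z|) ^ j).aestronglyMeasurable ?_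
  refine Eventually.of_forall fun z ↦ ?_
  rw [Real.norm_of_nonneg (by positivity)]
  exact kernel_aux_le hL hM₂ hK' j z

/-- `ρ_T` has compact support. [folklore] -/
theorem hasCompactSupport_rhoT (L M₂ K' T : ℝ) (j : ℕ) : HasCompactSupport (rhoT L M₂ K' T j) := by
  unfold rhoT
  exact HasCompactSupport.of_support_subset_isCompact (isCompact_Icc (a := -(T ^ 2)⁻¹) (b := (T ^ 2)⁻¹))
    Set.support_indicator_subset

/-- **`∫ ρ_T ≤ 8K'`** (`j ≥ 2`; compare with `∫ 2B(1+B|z|)^{-2} dz = 4`): the smoothing does not increase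
`L¹` norms by more than a constant ("`∫ f̃ ⪅ ∫ f`"). [cite: GuthMaynard2026, proof of Proposition 9.1] -/
theorem integral_rhoT_le (hL : 0 < L) (hM₂ : 0 < M₂) (hK' : 0 ≤ K') (T : ℝ) (hj : 2 ≤ j) :
    ∫ z, rhoT L M₂ K' T j z ≤ 8 * K' := by
  set B : ℝ := L * M₂ with hB
  have hB0 : 0 < B := mul_pos hL hM₂
  -- majorant `2BK'(1 + (Bz)²)^{-1}`
  have hmaj : ∀ z, rhoT L M₂ K' T j z ≤ 2 * B * K' * (1 + (B * z) ^ 2)⁻¹ := by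
    intro z
    refine (rhoT_le_kernel hL.le hM₂.le hK' T j z).trans ?_
    have h1 : (1 + L * M₂ * |z|) ^ 2 ≤ (1 + L * M₂ * |z|) ^ j := by
      refine pow_le_pow_right₀ ?_ hj
      have : 0 ≤ L * M₂ * |z| := by positivity
      linarith
    have h2 : 1 + (B * z) ^ 2 ≤ (1 + L * M₂ * |z|) ^ 2 := by
      rw [← hB]
      have : (B * z) ^ 2 = (B * |z|) ^ 2 := by rw [mul_pow B |z| 2, sq_abs, mul_pow B z 2]
      rw [this]
      have : 0 ≤ B * |z| := by positivity
      nlinarith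
    rw [show 2 * L * M₂ * K' = 2 * B * K' by rw [hB]; ring, div_eq_mul_inv]
    refine mul_le_mul_of_nonneg_left ?_ (by positivity)
    exact inv_anti₀ (by positivity) (h2.trans h1)
  have hi : Integrable (fun z : ℝ ↦ 2 * B * K' * (1 + (B * z) ^ 2)⁻¹) :=
    ((integrable_inv_one_add_sq.comp_mul_left' hB0.ne')).const_mul _
  calc ∫ z, rhoT L M₂ K' T j z ≤ ∫ z : ℝ, 2 * B * K' * (1 + (B * z) ^ 2)⁻¹ :=
        integral_mono (rhoT_integrable hL.le hM₂.le hK' T j) hi hmaj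
    _ = 2 * B * K' * (B⁻¹ * π) := by
        rw [integral_const_mul]
        congr 1
        have h := Measure.integral_comp_mul_left (fun y : ℝ ↦ (1 + y ^ 2)⁻¹) B
        simp only [smul_eq_mul] at h
        rw [h, integral_univ_inv_one_add_sq, abs_of_pos (inv_pos.mpr hB0)]
    _ = 2 * K' * π := by field_simp
    _ ≤ 8 * K' := by nlinarith [Real.pi_lt_four, Real.pi_pos]

/-- `∫ ρ_T ≥ 0`. [folklore] -/
theorem integral_rhoT_nonneg (hL : 0 ≤ L) (hM₂ : 0 ≤ M₂) (hK' : 0 ≤ K') (T : ℝ) (j : ℕ) :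
    0 ≤ ∫ z, rhoT L M₂ K' T j z :=
  integral_nonneg (rhoT_nonneg hL hM₂ hK' T j)

/-- **Kernel domination**: if `|ψ̂₁(t)| ≤ K'(1+|t|)^{-j}`, `M₂ ≤ |m₂'| ≤ 2M₂`, `LM₂ ≥ T⁶`, `T ≥ 1`, then for
all `c, u'`: `L |ψ̂₁(L m₂' (c − u'))| ≤ |m₂'|^{-1} (ρ_T(c − u') + 2K'LM₂T^{-4j})` ("We can choose `ψ` such
that the integral over `u'` … is bounded by `f̃((m₂u+j)/m₂')`").
[cite: GuthMaynard2026, proof of Lemma 9.2, before (9.15)] -/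
theorem kernel_le_rhoT (hL : 0 < L) (_hM₂ : 0 < M₂) (hK' : 0 ≤ K') (_hT : 1 ≤ T)
    (hKj : ∀ t, ‖𝓕 psi1c t‖ ≤ K' / (1 + |t|) ^ j) (hLM : T ^ 6 ≤ L * M₂)
    {m₂' : ℤ} (hm : M₂ ≤ |(m₂' : ℝ)| ∧ |(m₂' : ℝ)| ≤ 2 * M₂) (c u' : ℝ) :
    L * ‖𝓕 psi1c (L * m₂' * (c - u'))‖ ≤
      |(m₂' : ℝ)|⁻¹ * (rhoT L M₂ K' T j (c - u') + 2 * K' * L * M₂ * T ^ (-(4 * j : ℝ))) := by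
  have hT0 : 0 < T := by linarith
  have hm0 : 0 < |(m₂' : ℝ)| := by linarith [hm.1]
  have hLM0 : 0 < L * M₂ := by positivity
  set z : ℝ := c - u' with hz
  have h1 := hKj (L * m₂' * z)
  -- `(1 + L|m₂'||z|)^j ≥ (1 + LM₂|z|)^j`
  have h2 : (1 + L * M₂ * |z|) ^ j ≤ (1 + |L * m₂' * z|) ^ j := by
    apply pow_le_pow_left₀ (by positivity)
    rw [abs_mul, abs_mul, abs_of_pos hL]
    have : L * M₂ * |z| ≤ L * |(m₂' : ℝ)| * |z| := by gcongr; exact hm.1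
    linarith
  have h3 : L * ‖𝓕 psi1c (L * m₂' * z)‖ ≤ L * K' / (1 + L * M₂ * |z|) ^ j := by
    calc L * ‖𝓕 psi1c (L * m₂' * z)‖ ≤ L * (K' / (1 + |L * m₂' * z|) ^ j) := mul_le_mul_of_nonneg_left h1 hL.le
      _ ≤ L * (K' / (1 + L * M₂ * |z|) ^ j) := by gcongr
      _ = _ := by ring
  refine h3.trans ?_
  rw [le_inv_mul_iff₀ hm0]
  -- `|m₂'| L K'/(1+LM₂|z|)^j ≤ 2LM₂K'/(1+LM₂|z|)^j ≤ ρ_T(z) + tail`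
  have h4 : |(m₂' : ℝ)| * (L * K' / (1 + L * M₂ * |z|) ^ j) ≤ 2 * L * M₂ * K' / (1 + L * M₂ * |z|) ^ j := by
    rw [mul_div_assoc', div_le_div_iff_of_pos_right (by positivity)]
    nlinarith [hm.2, mul_nonneg hL.le hK']
  refine h4.trans ?_
  by_cases hzr : |z| ≤ (T ^ 2)⁻¹
  · have hmem : z ∈ Set.Icc (-(T ^ 2)⁻¹) (T ^ 2)⁻¹ := by rw [Set.mem_Icc, ← abs_le]; exact hzr
    rw [rhoT, Set.indicator_of_mem hmem]
    have : 0 ≤ 2 * K' * L * M₂ * T ^ (-(4 * j : ℝ)) := by positivity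
    linarith
  · push Not at hzr
    rw [rhoT_eq_zero L M₂ K' j hzr, zero_add]
    -- `(1 + LM₂|z|)^j ≥ (LM₂ T^{-2})^j ≥ T^{4j}`
    have h5 : T ^ 4 ≤ 1 + L * M₂ * |z| := by
      have : T ^ 6 * (T ^ 2)⁻¹ ≤ L * M₂ * |z| :=
        mul_le_mul hLM hzr.le (by positivity) (by positivity)
      have e : T ^ 6 * (T ^ 2)⁻¹ = T ^ 4 := by field_simp
      linarith
    have h6 : (T ^ (4 * j : ℝ)) ≤ (1 + L * M₂ * |z|) ^ j := by
      rw [show (4 * j : ℝ) = ((4 * j : ℕ) : ℝ) by push_cast; ring, Real.rpow_natCast, pow_mul]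
      exact pow_le_pow_left₀ (by positivity) h5 j
    rw [div_le_iff₀ (by positivity), Real.rpow_neg hT0.le]
    calc 2 * L * M₂ * K' = 2 * K' * L * M₂ * (T ^ (4 * j : ℝ))⁻¹ * T ^ (4 * j : ℝ) := by
          field_simp
      _ ≤ 2 * K' * L * M₂ * (T ^ (4 * j : ℝ))⁻¹ * (1 + L * M₂ * |z|) ^ j := by gcongr

end kernel

section fsm

variable {L M₂ K' T : ℝ} {j : ℕ}
variable {f : ℝ → ℝ} (hf : ContDiff ℝ ∞ f) (hfs : HasCompactSupport f) (hf0 : ∀ x, 0 ≤ f x)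

/-- `f̃(c) = ∫ ρ_T(c − u') f(u') du'`. [cite: GuthMaynard2026, Lemma 9.2] -/
theorem fsm_apply (L M₂ K' T : ℝ) (j : ℕ) (f : ℝ → ℝ) (c : ℝ) :
    fsm L M₂ K' T j f c = ∫ u', rhoT L M₂ K' T j (c - u') * f u' := by
  rw [fsm, convolution_eq_swap]
  rfl

include hf0 in
/-- `f̃ ≥ 0`. [folklore] -/
theorem fsm_nonneg (hL : 0 ≤ L) (hM₂ : 0 ≤ M₂) (hK' : 0 ≤ K') (T : ℝ) (j : ℕ) (c : ℝ) :
    0 ≤ fsm L M₂ K' T j f c := by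
  rw [fsm_apply]
  exact integral_nonneg fun u' ↦ mul_nonneg (rhoT_nonneg hL hM₂ hK' T j _) (hf0 u')

include hf hfs in
/-- `f̃` is smooth (`f` is). [folklore] -/
theorem fsm_contDiff (hL : 0 ≤ L) (hM₂ : 0 ≤ M₂) (hK' : 0 ≤ K') (T : ℝ) (j : ℕ) :
    ContDiff ℝ ∞ (fsm L M₂ K' T j f) := by
  unfold fsm
  exact hfs.contDiff_convolution_right _ (rhoT_integrable hL hM₂ hK' T j).locallyIntegrable hf

include hf hfs in
/-- `f̃` is continuous. [folklore] -/
theorem fsm_continuous (hL : 0 ≤ L) (hM₂ : 0 ≤ M₂) (hK' : 0 ≤ K') (T : ℝ) (j : ℕ) :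
    Continuous (fsm L M₂ K' T j f) :=
  (fsm_contDiff hf hfs hL hM₂ hK' T j).continuous

/-- **Support of `f̃`**: if `f = 0` off `[a, b]` then `f̃(c) = 0` unless `a − T^{-2} ≤ c ≤ b + T^{-2}`.
[cite: GuthMaynard2026, proof of Proposition 9.1 ("`f̃` is also supported on `u ≍ 1`")] -/
theorem fsm_eq_zero_of_notMem (L M₂ K' T : ℝ) (j : ℕ) {a b : ℝ} (hfab : ∀ x, f x ≠ 0 → a ≤ x ∧ x ≤ b) {c : ℝ}
    (hc : ¬(a - (T ^ 2)⁻¹ ≤ c ∧ c ≤ b + (T ^ 2)⁻¹)) : fsm L M₂ K' T j f c = 0 := by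
  rw [fsm_apply]
  refine integral_eq_zero_of_ae (Eventually.of_forall fun u' ↦ ?_)
  simp only [Pi.zero_apply]
  by_cases hfu : f u' = 0
  · rw [hfu, mul_zero]
  · obtain ⟨h1, h2⟩ := hfab u' hfu
    have hρ : rhoT L M₂ K' T j (c - u') = 0 := by
      apply rhoT_eq_zero L M₂ K' j
      by_contra h
      push Not at h
      rw [abs_le] at h
      apply hc
      constructor <;> linarith [h.1, h.2]
    rw [hρ, zero_mul]

include hfs in
/-- `f̃` has compact support. [folklore] -/
theorem hasCompactSupport_fsm (L M₂ K' T : ℝ) (j : ℕ) : HasCompactSupport (fsm L M₂ K' T j f) := by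
  unfold fsm
  exact (hasCompactSupport_rhoT L M₂ K' T j).convolution _ hfs

include hf hfs in
/-- `f̃` is integrable. [folklore] -/
theorem fsm_integrable (hL : 0 ≤ L) (hM₂ : 0 ≤ M₂) (hK' : 0 ≤ K') (T : ℝ) (j : ℕ) :
    Integrable (fsm L M₂ K' T j f) :=
  (fsm_continuous hf hfs hL hM₂ hK' T j).integrable_of_hasCompactSupport (hasCompactSupport_fsm hfs L M₂ K' T j)

include hf hfs in
/-- `∫ f̃ = (∫ ρ_T)(∫ f)`. [cite: GuthMaynard2026, proof of Proposition 9.1 ("`∫ f̃ ⪅ ∫ f`")] -/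
theorem integral_fsm (hL : 0 ≤ L) (hM₂ : 0 ≤ M₂) (hK' : 0 ≤ K') (T : ℝ) (j : ℕ) :
    ∫ c, fsm L M₂ K' T j f c = (∫ z, rhoT L M₂ K' T j z) * ∫ y, f y := by
  rw [fsm, integral_convolution _ (rhoT_integrable hL hM₂ hK' T j) (hf.continuous.integrable_of_hasCompactSupport hfs),
    ContinuousLinearMap.lsmul_apply, smul_eq_mul]

include hf hfs hf0 in
/-- `f̃ ≤ 2LM₂K' ∫ f` pointwise. [folklore] -/
theorem fsm_le (hL : 0 ≤ L) (hM₂ : 0 ≤ M₂) (hK' : 0 ≤ K') (T : ℝ) (j : ℕ) (c : ℝ) :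
    fsm L M₂ K' T j f c ≤ 2 * L * M₂ * K' * ∫ y, f y := by
  rw [fsm_apply, ← integral_const_mul]
  refine integral_mono_of_nonneg (Eventually.of_forall fun u' ↦ mul_nonneg (rhoT_nonneg hL hM₂ hK' T j _) (hf0 u'))
    ((hf.continuous.integrable_of_hasCompactSupport hfs).const_mul _) (Eventually.of_forall fun u' ↦ ?_)
  exact mul_le_mul_of_nonneg_right (rhoT_le hL hM₂ hK' T j _) (hf0 u')

end fsm

/-! ## §2. The expansion of `|Ψ|²` and the second Poisson summation -/

/-- `Z(w) = ∑_{|ℓ| ≤ 3L} ψ₁(ℓ/L) e(−ℓw)`. [cite: GuthMaynard2026, (9.13) (`Z₂`)] -/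
def Zsum (L : ℕ) (w : ℝ) : ℂ := ∑ ℓ ∈ Finset.Icc (-(3 * L : ℤ)) (3 * L), psi1c ((ℓ : ℝ) / L) * ech ((ℓ : ℝ) * (-w))

/-- **`|Z(w)| ≤ perK ψ̂₁ L (−w)`** by Poisson summation (`L ≥ 1`) ("By Poisson summation, and the rapid decay of
`ψ̂₂`, …"). [cite: GuthMaynard2026, proof of Lemma 9.2, after (9.13)] -/
theorem norm_Zsum_le {L : ℕ} (hL : 1 ≤ L) (w : ℝ) : ‖Zsum L w‖ ≤ perK (𝓕 psi1c) L (-w) := by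
  have hL0 : (0 : ℝ) < L := by exact_mod_cast hL
  have hψ3 : ∀ y, 3 ≤ |y| → psi1c y = 0 := by
    intro y hy
    have : psi1 y = 0 := by
      by_contra h; have := abs_lt_of_psi1_ne_zero h; linarith
    simp only [psi1c, this, Complex.ofReal_zero]
  obtain ⟨hsum, hP⟩ := tsum_bump_modulate_eq psi1c_contDiff psi1c_hasCompactSupport hL0 (-w)
  have hIcc : Finset.Icc (-((3 * L : ℕ) : ℤ)) ((3 * L : ℕ) : ℤ) = Finset.Icc (-(3 * L : ℤ)) (3 * L) := by simp
  have h1 : Zsum L w = ∑' n : ℤ, psi1c (n / L) * ech (n * (-w)) := by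
    rw [tsum_bump_modulate_eq_sum hψ3 hL0 (-w) (3 * L) (by simp), hIcc, Zsum]
  rw [h1, hP]
  refine (norm_tsum_le_tsum_norm hsum.norm).trans (le_of_eq ?_)
  rw [perK]
  refine tsum_congr fun ℓ ↦ ?_
  rw [norm_mul, Complex.norm_real, Real.norm_of_nonneg hL0.le]

section expansion

variable {f : ℝ → ℝ} (hf : ContDiff ℝ ∞ f) (hfs : HasCompactSupport f) (hf0 : ∀ x, 0 ≤ f x)
include hf hfs

omit hf hfs in
/-- `conj e(x) = e(−x)`. [folklore] -/
theorem conj_ech (x : ℝ) : (starRingEnd ℂ) (ech x) = ech (-x) := by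
  rw [ech, ech, ← Complex.exp_conj, map_mul, Complex.conj_ofReal, Complex.conj_I]
  congr 1
  push_cast
  ring

omit hf hfs in
/-- `f̂(a) conj(f̂(b)) = ∫∫ f(u)f(u') e(−(au − bu')) du du'` for real `f`. [folklore] -/
theorem fourier_mul_conj_eq (a b : ℝ) :
    𝓕 (fun y ↦ ((f y : ℝ) : ℂ)) a * (starRingEnd ℂ) (𝓕 (fun y ↦ ((f y : ℝ) : ℂ)) b) =
      ∫ p : ℝ × ℝ, ((f p.1 * f p.2 : ℝ) : ℂ) * ech (-(a * p.1 - b * p.2)) := by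
  rw [fourier_eq_integral_ech, fourier_eq_integral_ech, ← integral_conj]
  have e1 : (fun u' : ℝ ↦ (starRingEnd ℂ) (ech (-(u' * b)) * ((f u' : ℝ) : ℂ))) =
      fun u' ↦ ech (u' * b) * ((f u' : ℝ) : ℂ) := by
    ext u'
    rw [map_mul, Complex.conj_ofReal, conj_ech, neg_neg]
  rw [e1]
  have h : (∫ u, ech (-(u * a)) * ((f u : ℝ) : ℂ)) * (∫ u', ech (u' * b) * ((f u' : ℝ) : ℂ)) =
      ∫ p : ℝ × ℝ, (ech (-(p.1 * a)) * ((f p.1 : ℝ) : ℂ)) * (ech (p.2 * b) * ((f p.2 : ℝ) : ℂ)) :=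
    (integral_prod_mul (μ := (volume : Measure ℝ)) (ν := (volume : Measure ℝ))
      (fun u ↦ ech (-(u * a)) * ((f u : ℝ) : ℂ)) (fun u' ↦ ech (u' * b) * ((f u' : ℝ) : ℂ))).symm
  rw [h]
  refine integral_congr_ae (Eventually.of_forall fun p ↦ ?_)
  simp only
  have : ech (-(p.1 * a)) * ech (p.2 * b) = ech (-(a * p.1 - b * p.2)) := by
    rw [← ech_add]; congr 1; ring
  calc ech (-(p.1 * a)) * ((f p.1 : ℝ) : ℂ) * (ech (p.2 * b) * ((f p.2 : ℝ) : ℂ))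
      = (ech (-(p.1 * a)) * ech (p.2 * b)) * (((f p.1 : ℝ) : ℂ) * ((f p.2 : ℝ) : ℂ)) := by ring
    _ = _ := by rw [this]; push_cast; ring

omit hf hfs in
/-- **`|Ψ(z)|² = ∑_{m₂,m₂'∈I₂} |m₂||m₂'| ∫∫ f(u)f(u') e(−z(m₂u − m₂'u')) du du'`** (as a complex number).
[cite: GuthMaynard2026, (9.13)] -/
theorem normSq_PsiF_eq (I₂ : Finset ℤ) (z : ℝ) :
    (((‖PsiF f I₂ z‖ ^ 2 : ℝ)) : ℂ) = ∑ m₂ ∈ I₂, ∑ m₂' ∈ I₂, (((|(m₂ : ℝ)| * |(m₂' : ℝ)| : ℝ)) : ℂ) *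
      ∫ p : ℝ × ℝ, ((f p.1 * f p.2 : ℝ) : ℂ) * ech (-(z * ((m₂ : ℝ) * p.1 - (m₂' : ℝ) * p.2))) := by
  rw [Complex.ofReal_pow, ← Complex.mul_conj', PsiF, map_sum, Finset.sum_mul_sum]
  refine Finset.sum_congr rfl fun m₂ _ ↦ Finset.sum_congr rfl fun m₂' _ ↦ ?_
  rw [map_mul, Complex.conj_ofReal]
  have h := fourier_mul_conj_eq (f := f) ((m₂ : ℝ) * z) ((m₂' : ℝ) * z)
  calc ((|(m₂ : ℝ)| : ℝ) : ℂ) * 𝓕 (fun y ↦ ((f y : ℝ) : ℂ)) ((m₂ : ℝ) * z) *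
        ((((|(m₂' : ℝ)| : ℝ)) : ℂ) * (starRingEnd ℂ) (𝓕 (fun y ↦ ((f y : ℝ) : ℂ)) ((m₂' : ℝ) * z)))
      = (((|(m₂ : ℝ)| * |(m₂' : ℝ)| : ℝ)) : ℂ) * (𝓕 (fun y ↦ ((f y : ℝ) : ℂ)) ((m₂ : ℝ) * z) *
          (starRingEnd ℂ) (𝓕 (fun y ↦ ((f y : ℝ) : ℂ)) ((m₂' : ℝ) * z))) := by push_cast; ring
    _ = _ := by
        rw [h]
        congr 1
        refine integral_congr_ae (Eventually.of_forall fun p ↦ ?_)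
        ring_nf

/-- The integrand `f(u)f(u')·(bounded)` on `ℝ²` is integrable when the bounded factor is continuous. [folklore] -/
theorem integrable_ff_mul {k : ℝ × ℝ → ℂ} (hk : Continuous k) {C : ℝ} (hC : ∀ p, ‖k p‖ ≤ C) :
    Integrable (fun p : ℝ × ℝ ↦ ((f p.1 * f p.2 : ℝ) : ℂ) * k p) := by
  have h1 : Integrable (fun p : ℝ × ℝ ↦ ((f p.1 * f p.2 : ℝ) : ℂ)) := by
    have := (integrable_fc hf hfs).mul_prod (μ := (volume : Measure ℝ)) (ν := (volume : Measure ℝ)) (integrable_fc hf hfs)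
    refine this.congr (Eventually.of_forall fun p ↦ ?_)
    simp only; push_cast; ring
  exact h1.mul_bdd hk.aestronglyMeasurable (Eventually.of_forall hC)

/-- The real integrand `f(u)f(u')·(bounded continuous)` on `ℝ²` is integrable. [folklore] -/
theorem integrable_ff_mul_real {k : ℝ × ℝ → ℝ} (hk : Continuous k) {C : ℝ} (hC : ∀ p, ‖k p‖ ≤ C) :
    Integrable (fun p : ℝ × ℝ ↦ f p.1 * f p.2 * k p) := by
  have h1 : Integrable (fun p : ℝ × ℝ ↦ f p.1 * f p.2) :=
    (hf.continuous.integrable_of_hasCompactSupport hfs).mul_prod (μ := (volume : Measure ℝ))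
      (ν := (volume : Measure ℝ)) (hf.continuous.integrable_of_hasCompactSupport hfs)
  exact h1.mul_bdd hk.aestronglyMeasurable (Eventually.of_forall hC)

include hf0 in
/-- **The pointwise bound for `B(y) = ∑_ℓ ψ₁(ℓ/L)|Ψ(ℓ − y/M₃')|²`**: for any non-negative bounded
continuous `ζ` with `|Z(w)| ≤ ζ(w)` whenever `f(u)f(u') ≠ 0`, `w = m₂u − m₂'u'`,
`B(y) ≤ ∑_{m₂,m₂'} |m₂m₂'| ∫∫ f(u)f(u') ζ(m₂u − m₂'u') du du'` — independent of `y`.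
[cite: GuthMaynard2026, proof of Lemma 9.2, (9.13)–(9.14)] -/
theorem Bfun_le (I₂ : Finset ℤ) (L : ℕ) (M₃' y : ℝ) {ζ : ℝ → ℝ} (hζc : Continuous ζ) (hζ0 : ∀ w, 0 ≤ ζ w)
    {Cζ : ℝ} (hζb : ∀ w, ζ w ≤ Cζ)
    (hZ : ∀ m₂ ∈ I₂, ∀ m₂' ∈ I₂, ∀ u u' : ℝ, f u ≠ 0 → f u' ≠ 0 →
      ‖Zsum L ((m₂ : ℝ) * u - (m₂' : ℝ) * u')‖ ≤ ζ ((m₂ : ℝ) * u - (m₂' : ℝ) * u')) :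
    ∑ ℓ ∈ Finset.Icc (-(3 * L : ℤ)) (3 * L), psi1 ((ℓ : ℝ) / L) * ‖PsiF f I₂ (ℓ - y / M₃')‖ ^ 2 ≤
      ∑ m₂ ∈ I₂, ∑ m₂' ∈ I₂, |(m₂ : ℝ)| * |(m₂' : ℝ)| *
        ∫ p : ℝ × ℝ, f p.1 * f p.2 * ζ ((m₂ : ℝ) * p.1 - (m₂' : ℝ) * p.2) := by
  -- complexify the left-hand side and expand
  set lhs : ℝ := ∑ ℓ ∈ Finset.Icc (-(3 * L : ℤ)) (3 * L), psi1 ((ℓ : ℝ) / L) * ‖PsiF f I₂ (ℓ - y / M₃')‖ ^ 2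
    with hlhs
  have hexp : ((lhs : ℝ) : ℂ) = ∑ m₂ ∈ I₂, ∑ m₂' ∈ I₂, (((|(m₂ : ℝ)| * |(m₂' : ℝ)| : ℝ)) : ℂ) *
      ∫ p : ℝ × ℝ, ((f p.1 * f p.2 : ℝ) : ℂ) * (ech (y * ((m₂ : ℝ) * p.1 - (m₂' : ℝ) * p.2) / M₃') *
        Zsum L ((m₂ : ℝ) * p.1 - (m₂' : ℝ) * p.2)) := by
    rw [hlhs, Complex.ofReal_sum]
    simp_rw [Complex.ofReal_mul (psi1 _), normSq_PsiF_eq I₂, Finset.mul_sum]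
    rw [Finset.sum_comm]
    refine Finset.sum_congr rfl fun m₂ _ ↦ ?_
    rw [Finset.sum_comm]
    refine Finset.sum_congr rfl fun m₂' _ ↦ ?_
    have hint : ∀ ℓ : ℤ, Integrable (fun p : ℝ × ℝ ↦ ((f p.1 * f p.2 : ℝ) : ℂ) *
        ech (-(((ℓ : ℝ) - y / M₃') * ((m₂ : ℝ) * p.1 - (m₂' : ℝ) * p.2)))) := fun ℓ ↦
      integrable_ff_mul hf hfs (continuous_ech.comp (by fun_prop)) (C := 1) fun p ↦ (norm_ech _).le
    calc ∑ ℓ ∈ Finset.Icc (-(3 * L : ℤ)) (3 * L), ((psi1 ((ℓ : ℝ) / L) : ℝ) : ℂ) *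
          ((((|(m₂ : ℝ)| * |(m₂' : ℝ)| : ℝ)) : ℂ) * ∫ p : ℝ × ℝ, ((f p.1 * f p.2 : ℝ) : ℂ) *
            ech (-(((ℓ : ℝ) - y / M₃') * ((m₂ : ℝ) * p.1 - (m₂' : ℝ) * p.2))))
        = (((|(m₂ : ℝ)| * |(m₂' : ℝ)| : ℝ)) : ℂ) * ∑ ℓ ∈ Finset.Icc (-(3 * L : ℤ)) (3 * L),
            ∫ p : ℝ × ℝ, ((psi1 ((ℓ : ℝ) / L) : ℝ) : ℂ) * (((f p.1 * f p.2 : ℝ) : ℂ) *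
              ech (-(((ℓ : ℝ) - y / M₃') * ((m₂ : ℝ) * p.1 - (m₂' : ℝ) * p.2)))) := by
          rw [Finset.mul_sum]
          refine Finset.sum_congr rfl fun ℓ _ ↦ ?_
          rw [integral_const_mul]; ring
      _ = (((|(m₂ : ℝ)| * |(m₂' : ℝ)| : ℝ)) : ℂ) * ∫ p : ℝ × ℝ, ∑ ℓ ∈ Finset.Icc (-(3 * L : ℤ)) (3 * L),
            ((psi1 ((ℓ : ℝ) / L) : ℝ) : ℂ) * (((f p.1 * f p.2 : ℝ) : ℂ) *
              ech (-(((ℓ : ℝ) - y / M₃') * ((m₂ : ℝ) * p.1 - (m₂' : ℝ) * p.2)))) := by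
          rw [integral_finsetSum _ (fun ℓ _ ↦ (hint ℓ).const_mul _)]
      _ = (((|(m₂ : ℝ)| * |(m₂' : ℝ)| : ℝ)) : ℂ) * ∫ p : ℝ × ℝ, ((f p.1 * f p.2 : ℝ) : ℂ) *
            (ech (y * ((m₂ : ℝ) * p.1 - (m₂' : ℝ) * p.2) / M₃') * Zsum L ((m₂ : ℝ) * p.1 - (m₂' : ℝ) * p.2)) := by
          congr 1
          refine integral_congr_ae (Eventually.of_forall fun p ↦ ?_)
          simp only [Zsum, Finset.mul_sum]
          refine Finset.sum_congr rfl fun ℓ _ ↦ ?_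
          have : ech (-(((ℓ : ℝ) - y / M₃') * ((m₂ : ℝ) * p.1 - (m₂' : ℝ) * p.2))) =
              ech (y * ((m₂ : ℝ) * p.1 - (m₂' : ℝ) * p.2) / M₃') *
                ech ((ℓ : ℝ) * (-((m₂ : ℝ) * p.1 - (m₂' : ℝ) * p.2))) := by
            rw [← ech_add]; congr 1; ring
          rw [this, psi1c]; ring
  -- take real parts / norms
  have hre : lhs = (((lhs : ℝ) : ℂ)).re := (Complex.ofReal_re _).symm
  rw [hre, hexp, Complex.re_sum]
  refine Finset.sum_le_sum fun m₂ hm₂ ↦ ?_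
  rw [Complex.re_sum]
  refine Finset.sum_le_sum fun m₂' hm₂' ↦ ?_
  refine (Complex.re_le_norm _).trans ?_
  rw [norm_mul, Complex.norm_real, Real.norm_of_nonneg (by positivity)]
  refine mul_le_mul_of_nonneg_left ?_ (by positivity)
  have hmaj_i : Integrable (fun p : ℝ × ℝ ↦ f p.1 * f p.2 * ζ ((m₂ : ℝ) * p.1 - (m₂' : ℝ) * p.2)) :=
    integrable_ff_mul_real hf hfs (hζc.comp (by fun_prop)) (C := Cζ) fun p ↦ by
      rw [Real.norm_of_nonneg (hζ0 _)]; exact hζb _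
  refine (norm_integral_le_integral_norm _).trans (integral_mono_of_nonneg
    (Eventually.of_forall fun p ↦ norm_nonneg _) hmaj_i (Eventually.of_forall fun p ↦ ?_))
  simp only
  rw [norm_mul, norm_mul, norm_ech, one_mul, Complex.norm_real,
    Real.norm_of_nonneg (mul_nonneg (hf0 _) (hf0 _))]
  by_cases hfp : f p.1 * f p.2 = 0
  · rw [hfp, zero_mul, zero_mul]
  · have h1 : f p.1 ≠ 0 := fun h ↦ hfp (by rw [h, zero_mul])
    have h2 : f p.2 ≠ 0 := fun h ↦ hfp (by rw [h, mul_zero])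
    exact mul_le_mul_of_nonneg_left (hZ m₂ hm₂ m₂' hm₂' p.1 p.2 h1 h2) (mul_nonneg (hf0 _) (hf0 _))

end expansion

/-! ## §3. The bound for `Q̃ = ∫ ktil · |Ψ|²` -/

/-- Continuity of `ψ̂₁`. [folklore] -/
theorem continuous_fourier_psi1c : Continuous (𝓕 psi1c) :=
  VectorFourier.fourierIntegral_continuous Real.continuous_fourierChar (by exact continuous_inner)
    ((psi1c_contDiff.continuous).integrable_of_hasCompactSupport psi1c_hasCompactSupport)

/-- `‖ψ̂₁‖` is integrable with `∫ ‖ψ̂₁‖ ≤ 4K` when `|ψ̂₁(y)| ≤ K(1+|y|)^{-2}`. [folklore] -/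
theorem integrable_norm_fourier_psi1c {K : ℝ} (hK : 0 ≤ K) (hK2 : ∀ y, ‖𝓕 psi1c y‖ ≤ K / (1 + |y|) ^ 2) :
    Integrable (fun y ↦ ‖𝓕 psi1c y‖) ∧ ∫ y, ‖𝓕 psi1c y‖ ≤ 4 * K := by
  have hmaj : ∀ y, ‖𝓕 psi1c y‖ ≤ K * (1 + y ^ 2)⁻¹ := fun y ↦ (hK2 y).trans (by
    rw [div_eq_mul_inv]; exact mul_le_mul_of_nonneg_left (inv_one_add_abs_sq_le y) hK)
  have hi : Integrable (fun y : ℝ ↦ K * (1 + y ^ 2)⁻¹) := integrable_inv_one_add_sq.const_mul K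
  have hint : Integrable (fun y ↦ ‖𝓕 psi1c y‖) :=
    hi.mono' continuous_fourier_psi1c.norm.aestronglyMeasurable
      (Eventually.of_forall fun y ↦ by rw [norm_norm]; exact hmaj y)
  refine ⟨hint, ?_⟩
  calc ∫ y, ‖𝓕 psi1c y‖ ≤ ∫ y : ℝ, K * (1 + y ^ 2)⁻¹ := integral_mono hint hi hmaj
    _ = K * π := by rw [integral_const_mul, integral_univ_inv_one_add_sq]
    _ ≤ 4 * K := by nlinarith [Real.pi_lt_four]

/-- Substitution `x = ℓ − y/M`: `∫ Mφ(M(ℓ−x))F(x) dx = ∫ φ(y)F(ℓ − y/M) dy` (`M > 0`). [folklore] -/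
theorem integral_subst_shift_scale (φ F : ℝ → ℝ) {M : ℝ} (hM : 0 < M) (ℓ : ℝ) :
    ∫ x, M * φ (M * (ℓ - x)) * F x = ∫ y, φ y * F (ℓ - y / M) := by
  calc ∫ x, M * φ (M * (ℓ - x)) * F x
      = ∫ x, (fun t ↦ M * (φ (M * t) * F (ℓ - t))) (ℓ - x) := by
        refine integral_congr_ae (Eventually.of_forall fun x ↦ ?_)
        simp only [sub_sub_cancel]
        ring
    _ = ∫ t, M * (φ (M * t) * F (ℓ - t)) := integral_sub_left_eq_self (fun t ↦ M * (φ (M * t) * F (ℓ - t))) volume ℓ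
    _ = M * ∫ t, φ (M * t) * F (ℓ - t) := integral_const_mul _ _
    _ = ∫ y, (fun t ↦ φ (M * t) * F (ℓ - t)) (y / M) := by
        rw [Measure.integral_comp_div (fun t ↦ φ (M * t) * F (ℓ - t)) M, smul_eq_mul, abs_of_pos hM]
    _ = ∫ y, φ y * F (ℓ - y / M) := by
        refine integral_congr_ae (Eventually.of_forall fun y ↦ ?_)
        simp only [mul_div_cancel₀ _ hM.ne']

/-- `|Icc(−N, N)| = 2N + 1` as a real number. [folklore] -/
theorem card_Icc_neg_real (N : ℕ) : ((Finset.Icc (-(N : ℤ)) N).card : ℝ) = 2 * N + 1 := by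
  rw [Int.card_Icc]
  have : ((N : ℤ) + 1 - -(N : ℤ)).toNat = 2 * N + 1 := by omega
  rw [this]; push_cast; ring

/-- `affSum` of a continuous function is continuous. [folklore] -/
theorem affSum_continuous {g : ℝ → ℝ} (_hg : Continuous g) (I₁ I₂ : Finset ℤ) (M₃ : ℕ) :
    Continuous (affSum g I₁ I₂ M₃) := by
  unfold affSum
  fun_prop

section Qtil

variable {f : ℝ → ℝ} (hf : ContDiff ℝ ∞ f) (hfs : HasCompactSupport f) (hf0 : ∀ x, 0 ≤ f x)
include hf hfs hf0

/-- **The `u'`-integral against one kernel** (`M₂ ≤ |m₂'| ≤ 2M₂`, `LM₂ ≥ T⁶`):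
`∫ f(u') L|ψ̂₁(L(k − (m₂'u' − m₂u)))| du' ≤ |m₂'|^{-1} (f̃((m₂u+k)/m₂') + 2K'LM₂T^{-4j} ∫ f)`.
[cite: GuthMaynard2026, proof of Lemma 9.2, before (9.15)] -/
theorem integral_f_kernel_le {L M₂ K T : ℝ} {j : ℕ} (hL : 0 < L) (hM₂ : 0 < M₂) (hK : 0 ≤ K) (hT : 1 ≤ T)
    (hKj : ∀ t, ‖𝓕 psi1c t‖ ≤ K / (1 + |t|) ^ j) (hLM : T ^ 6 ≤ L * M₂)
    {m₂' : ℤ} (hm : M₂ ≤ |(m₂' : ℝ)| ∧ |(m₂' : ℝ)| ≤ 2 * M₂) (m₂ k : ℤ) (u : ℝ) :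
    ∫ u', f u' * (L * ‖𝓕 psi1c (L * ((k : ℝ) - ((m₂' : ℝ) * u' - (m₂ : ℝ) * u)))‖) ≤
      |(m₂' : ℝ)|⁻¹ * (fsm L M₂ K T j f (((m₂ : ℝ) * u + k) / m₂') +
        2 * K * L * M₂ * T ^ (-(4 * j : ℝ)) * ∫ y, f y) := by
  have hT0 : 0 < T := by linarith
  have hm0 : (m₂' : ℝ) ≠ 0 := by
    intro h; rw [h, abs_zero] at hm; linarith [hm.1]
  set c : ℝ := ((m₂ : ℝ) * u + k) / m₂' with hc
  have e : ∀ u', L * ((k : ℝ) - ((m₂' : ℝ) * u' - (m₂ : ℝ) * u)) = L * m₂' * (c - u') := by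
    intro u'; simp only [hc]; field_simp; ring
  set εe : ℝ := 2 * K * L * M₂ * T ^ (-(4 * j : ℝ)) with hεe
  have : 0 ≤ εe := by rw [hεe]; positivity
  have hfi : Integrable f := hf.continuous.integrable_of_hasCompactSupport hfs
  have hpt : ∀ u', f u' * (L * ‖𝓕 psi1c (L * ((k : ℝ) - ((m₂' : ℝ) * u' - (m₂ : ℝ) * u)))‖) ≤
      |(m₂' : ℝ)|⁻¹ * (rhoT L M₂ K T j (c - u') * f u' + εe * f u') := by
    intro u'
    rw [e u']
    have h := kernel_le_rhoT hL hM₂ hK hT hKj hLM hm c u'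
    calc f u' * (L * ‖𝓕 psi1c (L * m₂' * (c - u'))‖)
        ≤ f u' * (|(m₂' : ℝ)|⁻¹ * (rhoT L M₂ K T j (c - u') + εe)) := mul_le_mul_of_nonneg_left h (hf0 u')
      _ = _ := by ring
  have hi1 : Integrable (fun u' ↦ rhoT L M₂ K T j (c - u') * f u') :=
    hfi.bdd_mul ((rhoT_measurable L M₂ K T j).comp (measurable_const.sub measurable_id)).aestronglyMeasurable
      (Eventually.of_forall fun u' ↦ by
        rw [Real.norm_of_nonneg (rhoT_nonneg hL.le hM₂.le hK T j _)]; exact rhoT_le hL.le hM₂.le hK T j _)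
  have hi2 : Integrable (fun u' ↦ |(m₂' : ℝ)|⁻¹ * (rhoT L M₂ K T j (c - u') * f u' + εe * f u')) :=
    (hi1.add (hfi.const_mul _)).const_mul _
  calc ∫ u', f u' * (L * ‖𝓕 psi1c (L * ((k : ℝ) - ((m₂' : ℝ) * u' - (m₂ : ℝ) * u)))‖)
      ≤ ∫ u', |(m₂' : ℝ)|⁻¹ * (rhoT L M₂ K T j (c - u') * f u' + εe * f u') :=
        integral_mono_of_nonneg (Eventually.of_forall fun u' ↦ mul_nonneg (hf0 u') (by positivity)) hi2
          (Eventually.of_forall hpt)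
    _ = |(m₂' : ℝ)|⁻¹ * (fsm L M₂ K T j f c + εe * ∫ y, f y) := by
        rw [integral_const_mul, integral_add hi1 (hfi.const_mul _), integral_const_mul, fsm_apply]

/-- **The `u'`-integral against `ktil L L`**:
`∫ f(u') ktil_{L,L}(m₂'u' − m₂u) du' ≤ |m₂'|^{-1} (∑_{|k|≤3L} f̃((m₂u+k)/m₂') + (6L+1) 2K'LM₂T^{-4j} ∫f)`.
[cite: GuthMaynard2026, proof of Lemma 9.2, (9.15)] -/
theorem integral_f_ktil_le {L : ℕ} {M₂ K T : ℝ} {j : ℕ} (_hL : 1 ≤ L) (hM₂ : 0 < M₂) (hK : 0 ≤ K) (hT : 1 ≤ T)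
    (hKj : ∀ t, ‖𝓕 psi1c t‖ ≤ K / (1 + |t|) ^ j) (hLM : T ^ 6 ≤ L * M₂)
    {m₂' : ℤ} (hm : M₂ ≤ |(m₂' : ℝ)| ∧ |(m₂' : ℝ)| ≤ 2 * M₂) (m₂ : ℤ) (u : ℝ) :
    ∫ u', f u' * ktil L L ((m₂' : ℝ) * u' - (m₂ : ℝ) * u) ≤
      |(m₂' : ℝ)|⁻¹ * (∑ k ∈ Finset.Icc (-(3 * L : ℤ)) (3 * L), fsm L M₂ K T j f (((m₂ : ℝ) * u + k) / m₂') +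
        (6 * L + 1) * (2 * K * L * M₂ * T ^ (-(4 * j : ℝ))) * ∫ y, f y) := by
  have hL0 : (0 : ℝ) < L := by exact_mod_cast (show 0 < L by omega)
  have hT0 : 0 < T := by linarith
  have hfi : Integrable f := hf.continuous.integrable_of_hasCompactSupport hfs
  have hN10 : 0 ≤ ∫ y, f y := integral_nonneg hf0
  set εe : ℝ := 2 * K * L * M₂ * T ^ (-(4 * j : ℝ)) with hεe
  have hεe0 : 0 ≤ εe := by rw [hεe]; positivity
  have hm0 : 0 < |(m₂' : ℝ)| := by linarith [hm.1]
  -- each term of `ktil` integrates to at most `|m₂'|⁻¹ (f̃(c_k) + εe ∫ f)`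
  have hKb : ∀ t, ‖𝓕 psi1c t‖ ≤ K := fun t ↦ (hKj t).trans (div_le_self hK (one_le_pow₀ (by
    linarith [abs_nonneg t])))
  have hterm_i : ∀ k : ℤ, Integrable (fun u' ↦ f u' * (psi1 ((k : ℝ) / L) *
      ((L : ℝ) * ‖𝓕 psi1c ((L : ℝ) * (k - ((m₂' : ℝ) * u' - (m₂ : ℝ) * u)))‖))) := by
    intro k
    refine hfi.mul_bdd (c := 1 * (L * K)) ?_ (Eventually.of_forall fun u' ↦ ?_)
    · exact (continuous_const.mul (continuous_const.mul
        ((continuous_fourier_psi1c.comp (by fun_prop)).norm))).aestronglyMeasurable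
    · rw [Real.norm_of_nonneg (mul_nonneg (psi1_nonneg _) (by positivity))]
      exact mul_le_mul (psi1_le_one _) (mul_le_mul_of_nonneg_left (hKb _) hL0.le) (by positivity) zero_le_one
  have hterm : ∀ k : ℤ, ∫ u', f u' * (psi1 ((k : ℝ) / L) *
      ((L : ℝ) * ‖𝓕 psi1c ((L : ℝ) * (k - ((m₂' : ℝ) * u' - (m₂ : ℝ) * u)))‖)) ≤
      |(m₂' : ℝ)|⁻¹ * (fsm L M₂ K T j f (((m₂ : ℝ) * u + k) / m₂') + εe * ∫ y, f y) := by
    intro k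
    have h1 := integral_f_kernel_le hf hfs hf0 hL0 hM₂ hK hT hKj hLM hm m₂ k u
    have hpos : 0 ≤ |(m₂' : ℝ)|⁻¹ * (fsm L M₂ K T j f (((m₂ : ℝ) * u + k) / m₂') + εe * ∫ y, f y) :=
      mul_nonneg (inv_nonneg.mpr (abs_nonneg _)) (add_nonneg (fsm_nonneg hf0 hL0.le hM₂.le hK T j _) (by positivity))
    calc ∫ u', f u' * (psi1 ((k : ℝ) / L) * ((L : ℝ) * ‖𝓕 psi1c ((L : ℝ) * (k - ((m₂' : ℝ) * u' - (m₂ : ℝ) * u)))‖))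
        = psi1 ((k : ℝ) / L) * ∫ u', f u' * ((L : ℝ) * ‖𝓕 psi1c ((L : ℝ) * (k - ((m₂' : ℝ) * u' - (m₂ : ℝ) * u)))‖) := by
          rw [← integral_const_mul]
          refine integral_congr_ae (Eventually.of_forall fun u' ↦ ?_); simp only; ring
      _ ≤ psi1 ((k : ℝ) / L) * (|(m₂' : ℝ)|⁻¹ * (fsm L M₂ K T j f (((m₂ : ℝ) * u + k) / m₂') + εe * ∫ y, f y)) :=
          mul_le_mul_of_nonneg_left h1 (psi1_nonneg _)
      _ ≤ 1 * (|(m₂' : ℝ)|⁻¹ * (fsm L M₂ K T j f (((m₂ : ℝ) * u + k) / m₂') + εe * ∫ y, f y)) :=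
          mul_le_mul_of_nonneg_right (psi1_le_one _) hpos
      _ = _ := one_mul _
  calc ∫ u', f u' * ktil L L ((m₂' : ℝ) * u' - (m₂ : ℝ) * u)
      = ∫ u', ∑ k ∈ Finset.Icc (-(3 * L : ℤ)) (3 * L), f u' * (psi1 ((k : ℝ) / L) *
          ((L : ℝ) * ‖𝓕 psi1c ((L : ℝ) * (k - ((m₂' : ℝ) * u' - (m₂ : ℝ) * u)))‖)) := by
        refine integral_congr_ae (Eventually.of_forall fun u' ↦ ?_)
        simp only [ktil, Finset.mul_sum]
    _ = ∑ k ∈ Finset.Icc (-(3 * L : ℤ)) (3 * L), ∫ u', f u' * (psi1 ((k : ℝ) / L) *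
          ((L : ℝ) * ‖𝓕 psi1c ((L : ℝ) * (k - ((m₂' : ℝ) * u' - (m₂ : ℝ) * u)))‖)) :=
        integral_finsetSum _ fun k _ ↦ hterm_i k
    _ ≤ ∑ k ∈ Finset.Icc (-(3 * L : ℤ)) (3 * L),
          |(m₂' : ℝ)|⁻¹ * (fsm L M₂ K T j f (((m₂ : ℝ) * u + k) / m₂') + εe * ∫ y, f y) :=
        Finset.sum_le_sum fun k _ ↦ hterm k
    _ = |(m₂' : ℝ)|⁻¹ * (∑ k ∈ Finset.Icc (-(3 * L : ℤ)) (3 * L), fsm L M₂ K T j f (((m₂ : ℝ) * u + k) / m₂') +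
          (6 * L + 1) * εe * ∫ y, f y) := by
        rw [← Finset.mul_sum, Finset.sum_add_distrib, Finset.sum_const, nsmul_eq_mul]
        congr 2
        have : ((Finset.Icc (-(3 * L : ℤ)) (3 * L)).card : ℝ) = 6 * L + 1 := by
          have h := card_Icc_neg_real (3 * L)
          push_cast at h ⊢
          linarith [h]
        rw [this]; ring

omit hf hfs hf0 in
/-- **Reduction of the `k`-range** on the support of `f`: if `f` lives on `[a, b] ⊂ [0, 5]`, `f(u) ≠ 0`,
`m₂, m₂' ∈ {M₂ ≤ |m| ≤ 2M₂}`, `T ≥ 1` and `22M₂ ≤ K₁ ≤ 3L`, then the terms `f̃((m₂u+k)/m₂')` with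
`K₁ < |k| ≤ 3L` vanish. [cite: GuthMaynard2026, proof of Lemma 9.2 ("for `j` in the range `|j| ⪅ M₂ …`")] -/
theorem sum_fsm_restrict {L K₁ : ℕ} {M₂ K T a b : ℝ} {j : ℕ} (_hM₂ : 0 < M₂) (hT : 1 ≤ T)
    (_ha : 0 ≤ a) (_hb : b ≤ 5) (hfS : ∀ x, f x ≠ 0 → a ≤ x ∧ x ≤ b) (_hK₁ : 22 * M₂ ≤ K₁) (_hK₁L : K₁ ≤ 3 * L)
    {m₂ m₂' : ℤ} (hm₂ : M₂ ≤ |(m₂ : ℝ)| ∧ |(m₂ : ℝ)| ≤ 2 * M₂) (hm₂' : M₂ ≤ |(m₂' : ℝ)| ∧ |(m₂' : ℝ)| ≤ 2 * M₂)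
    {u : ℝ} (hu : f u ≠ 0) :
    ∑ k ∈ Finset.Icc (-(3 * L : ℤ)) (3 * L), fsm L M₂ K T j f (((m₂ : ℝ) * u + k) / m₂') =
      ∑ k ∈ Finset.Icc (-(K₁ : ℤ)) K₁, fsm L M₂ K T j f (((m₂ : ℝ) * u + k) / m₂') := by
  symm
  apply Finset.sum_subset
  · intro k hk; rw [Finset.mem_Icc] at hk ⊢; omega
  · intro k hk hk'
    rw [Finset.mem_Icc] at hk hk'
    have hkK : (K₁ : ℝ) + 1 ≤ |(k : ℝ)| := by
      rw [← Int.cast_abs]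
      have : (K₁ : ℤ) + 1 ≤ |k| := by rw [le_abs]; omega
      exact_mod_cast this
    obtain ⟨hu1, hu2⟩ := hfS u hu
    have hm0 : 0 < |(m₂' : ℝ)| := by linarith [hm₂'.1]
    apply fsm_eq_zero_of_notMem L M₂ K T j hfS
    -- `|c| > 6`
    have hc : 6 < |((m₂ : ℝ) * u + k) / m₂'| := by
      rw [abs_div, lt_div_iff₀ hm0]
      have h1 : |(k : ℝ)| - |(m₂ : ℝ) * u| ≤ |(m₂ : ℝ) * u + k| := by
        have := abs_sub_abs_le_abs_sub (k : ℝ) (-((m₂ : ℝ) * u))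
        rw [abs_neg, sub_neg_eq_add, add_comm] at this
        exact this
      have h2 : |(m₂ : ℝ) * u| ≤ 2 * M₂ * 5 := by
        rw [abs_mul, abs_of_nonneg (show (0 : ℝ) ≤ u by linarith)]
        exact mul_le_mul hm₂.2 (by linarith) (by linarith) (by linarith)
      linarith [hm₂'.2]
    have hT2 : (T ^ 2)⁻¹ ≤ 1 := inv_le_one_of_one_le₀ (one_le_pow₀ hT)
    intro h
    have : |((m₂ : ℝ) * u + k) / m₂'| ≤ 6 := abs_le.mpr ⟨by linarith [h.1], by linarith [h.2]⟩
    linarith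

set_option maxHeartbeats 1600000 in
/-- **The bound for `Q̃` (Guth–Maynard (9.13)–(9.16)).** Let `f ≥ 0` be smooth, supported in `[a, b] ⊂ [0, 5]`,
`T ≥ 4`, `1 ≤ M₂ ≤ T`, `M₃' ≥ 1`, `I₂ ⊂ {M₂ ≤ |m| ≤ 2M₂}`, `L ≥ T⁶ + T`, `22M₂ ≤ K₁ ≤ 3L`, `j ≥ 2`, and let
`K ≥ 0` bound `ψ̂₁` via `|ψ̂₁(y)| ≤ K(1+|y|)^{-2}` and `≤ K(1+|y|)^{-j}`. Then
`∫ ktil_{L,M₃'}(x)|Ψ(x)|² dx ≤ 4K (2M₂ ‖f‖₂ J(f̃; I₂, I₂, K₁)^{1/2} + 1152 K L M₂⁴ T^{2−j} ‖f‖₁²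
  + 144 K L M₂⁴ (6L+1) T^{-4j} ‖f‖₁²)` with `f̃ = fsm L M₂ K T j f`.
[cite: GuthMaynard2026, proof of Lemma 9.2, (9.13)–(9.16)] -/
theorem Qtil_le {T K M₂ M₃' a b : ℝ} {I₂ : Finset ℤ} {L K₁ j : ℕ}
    (hT : 4 ≤ T) (hM₂ : 1 ≤ M₂) (_hM₂T : M₂ ≤ T) (_hM₃' : 1 ≤ M₃')
    (hI₂ : ∀ m ∈ I₂, M₂ ≤ |(m : ℝ)| ∧ |(m : ℝ)| ≤ 2 * M₂)
    (ha : 0 ≤ a) (hb : b ≤ 5) (hfS : ∀ x, f x ≠ 0 → a ≤ x ∧ x ≤ b)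
    (hL : T ^ 6 + T ≤ L) (hK₁ : 22 * M₂ ≤ K₁) (hK₁L : K₁ ≤ 3 * L) (hj : 2 ≤ j) (hK : 0 ≤ K)
    (hK2 : ∀ y, ‖𝓕 psi1c y‖ ≤ K / (1 + |y|) ^ 2) (hKj : ∀ y, ‖𝓕 psi1c y‖ ≤ K / (1 + |y|) ^ j) :
    ∫ x, ktil L M₃' x * ‖PsiF f I₂ x‖ ^ 2 ≤
      4 * K * (2 * M₂ * (∫ y, f y ^ 2) ^ (1 / 2 : ℝ) * (Jfun (fsm L M₂ K T j f) I₂ I₂ K₁) ^ (1 / 2 : ℝ)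
        + 144 * M₂ ^ 4 * (8 * K * L * T ^ ((2 : ℝ) - j)) * (∫ y, f y) ^ 2
        + 72 * M₂ ^ 3 * ((6 * L + 1) * (2 * K * L * M₂ * T ^ (-(4 * j : ℝ)))) * (∫ y, f y) ^ 2) := by
  have hT1 : 1 ≤ T := by linarith
  have hT0 : 0 < T := by linarith
  have hM₂0 : 0 < M₂ := by linarith
  have hM₃'0 : 0 < M₃' := by linarith
  have hT6 : (4 : ℝ) ^ 6 ≤ T ^ 6 := pow_le_pow_left₀ (by norm_num) hT 6
  have hLr : T ^ 6 + T ≤ (L : ℝ) := hL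
  have hLr1 : (1 : ℝ) ≤ L := by nlinarith
  have hLr0 : (0 : ℝ) < L := by linarith
  have hL1 : 1 ≤ L := by exact_mod_cast hLr1
  have hLM : T ^ 6 ≤ (L : ℝ) * M₂ := by nlinarith
  have hfi : Integrable f := hf.continuous.integrable_of_hasCompactSupport hfs
  set N1 : ℝ := ∫ y, f y with hN1
  set N2 : ℝ := ∫ y, f y ^ 2 with hN2
  have hN10 : 0 ≤ N1 := integral_nonneg hf0
  have hN20 : 0 ≤ N2 := integral_nonneg fun y ↦ sq_nonneg _
  set ε₃ : ℝ := 8 * K * L * T ^ ((2 : ℝ) - j) with hε₃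
  set εe : ℝ := 2 * K * L * M₂ * T ^ (-(4 * j : ℝ)) with hεe
  have hε₃0 : 0 ≤ ε₃ := by rw [hε₃]; positivity
  have hεe0 : 0 ≤ εe := by rw [hεe]; positivity
  have hI₂0 : ∀ m ∈ I₂, (m : ℝ) ≠ 0 := by
    intro m hm h; have := (hI₂ m hm).1; rw [h, abs_zero] at this; linarith
  have hKb : ∀ t, ‖𝓕 psi1c t‖ ≤ K := fun t ↦ (hK2 t).trans (div_le_self hK (one_le_pow₀ (by
    linarith [abs_nonneg t])))
  have hΨi := (integral_normSq_PsiF_le hf hfs hM₂ hI₂).1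
  set fs : ℝ → ℝ := fsm L M₂ K T j f with hfsdef
  have hfs_c : Continuous fs := fsm_continuous hf hfs hLr0.le hM₂0.le hK T j
  have hfs_0 : ∀ x, 0 ≤ fs x := fsm_nonneg hf0 hLr0.le hM₂0.le hK T j
  ----------------------------------------------------------------
  -- Step 1: `Q̃ = ∫ ‖ψ̂₁(y)‖ B(y) dy`
  ----------------------------------------------------------------
  set Bf : ℝ → ℝ := fun y ↦ ∑ ℓ ∈ Finset.Icc (-(3 * L : ℤ)) (3 * L),
    psi1 ((ℓ : ℝ) / L) * ‖PsiF f I₂ (ℓ - y / M₃')‖ ^ 2 with hBf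
  have hBf0 : ∀ y, 0 ≤ Bf y := fun y ↦ Finset.sum_nonneg fun ℓ _ ↦ mul_nonneg (psi1_nonneg _) (sq_nonneg _)
  have hterm_i : ∀ ℓ : ℤ, Integrable (fun x ↦ psi1 ((ℓ : ℝ) / L) * (M₃' * ‖𝓕 psi1c (M₃' * (ℓ - x))‖) *
      ‖PsiF f I₂ x‖ ^ 2) := by
    intro ℓ
    refine hΨi.bdd_mul (c := 1 * (M₃' * K)) ?_ (Eventually.of_forall fun x ↦ ?_)
    · exact (continuous_const.mul (continuous_const.mul
        ((continuous_fourier_psi1c.comp (by fun_prop)).norm))).aestronglyMeasurable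
    · rw [Real.norm_of_nonneg (mul_nonneg (psi1_nonneg _) (by positivity))]
      exact mul_le_mul (psi1_le_one _) (mul_le_mul_of_nonneg_left (hKb _) hM₃'0.le) (by positivity) zero_le_one
  have hterm_i' : ∀ ℓ : ℤ, Integrable (fun y ↦ ‖𝓕 psi1c y‖ *
      (psi1 ((ℓ : ℝ) / L) * ‖PsiF f I₂ (ℓ - y / M₃')‖ ^ 2)) := by
    intro ℓ
    have h1 : Integrable (fun y ↦ ‖PsiF f I₂ (ℓ - y / M₃')‖ ^ 2) :=
      (hΨi.comp_sub_left (ℓ : ℝ)).comp_div hM₃'0.ne'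
    refine (h1.const_mul (psi1 ((ℓ : ℝ) / L))).bdd_mul (c := K) continuous_fourier_psi1c.norm.aestronglyMeasurable
      (Eventually.of_forall fun y ↦ ?_)
    rw [norm_norm]; exact hKb y
  have hstep1 : ∫ x, ktil L M₃' x * ‖PsiF f I₂ x‖ ^ 2 = ∫ y, ‖𝓕 psi1c y‖ * Bf y := by
    calc ∫ x, ktil L M₃' x * ‖PsiF f I₂ x‖ ^ 2
        = ∫ x, ∑ ℓ ∈ Finset.Icc (-(3 * L : ℤ)) (3 * L), psi1 ((ℓ : ℝ) / L) *
            (M₃' * ‖𝓕 psi1c (M₃' * (ℓ - x))‖) * ‖PsiF f I₂ x‖ ^ 2 := by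
          refine integral_congr_ae (Eventually.of_forall fun x ↦ ?_)
          simp only [ktil, Finset.sum_mul]
      _ = ∑ ℓ ∈ Finset.Icc (-(3 * L : ℤ)) (3 * L), ∫ x, psi1 ((ℓ : ℝ) / L) *
            (M₃' * ‖𝓕 psi1c (M₃' * (ℓ - x))‖) * ‖PsiF f I₂ x‖ ^ 2 :=
          integral_finsetSum _ fun ℓ _ ↦ hterm_i ℓ
      _ = ∑ ℓ ∈ Finset.Icc (-(3 * L : ℤ)) (3 * L), ∫ y, ‖𝓕 psi1c y‖ *
            (psi1 ((ℓ : ℝ) / L) * ‖PsiF f I₂ (ℓ - y / M₃')‖ ^ 2) := by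
          refine Finset.sum_congr rfl fun ℓ _ ↦ ?_
          have h := integral_subst_shift_scale (fun t ↦ ‖𝓕 psi1c t‖)
            (fun x ↦ psi1 ((ℓ : ℝ) / L) * ‖PsiF f I₂ x‖ ^ 2) hM₃'0 ℓ
          rw [← h]
          refine integral_congr_ae (Eventually.of_forall fun x ↦ ?_)
          simp only
          ring
      _ = ∫ y, ∑ ℓ ∈ Finset.Icc (-(3 * L : ℤ)) (3 * L), ‖𝓕 psi1c y‖ *
            (psi1 ((ℓ : ℝ) / L) * ‖PsiF f I₂ (ℓ - y / M₃')‖ ^ 2) :=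
          (integral_finsetSum _ fun ℓ _ ↦ hterm_i' ℓ).symm
      _ = ∫ y, ‖𝓕 psi1c y‖ * Bf y := by
          refine integral_congr_ae (Eventually.of_forall fun y ↦ ?_)
          simp only [hBf, Finset.mul_sum]
  ----------------------------------------------------------------
  -- Step 2: `B(y) ≤ B⋆` pointwise (`Bfun_le` with `ζ = ktil L L (−w) + ε₃`)
  ----------------------------------------------------------------
  set ζ : ℝ → ℝ := fun w ↦ ktil L L (-w) + ε₃ with hζ
  have hζc : Continuous ζ := ((ktil_continuous L L).comp continuous_neg).add continuous_const
  have hζ0 : ∀ w, 0 ≤ ζ w := fun w ↦ add_nonneg (ktil_nonneg L hLr0.le _) hε₃0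
  have hζb : ∀ w, ζ w ≤ 8 * K * L + ε₃ := fun w ↦ add_le_add (ktil_le hK hK2 L hLr1 _) le_rfl
  have hZ : ∀ m₂ ∈ I₂, ∀ m₂' ∈ I₂, ∀ u u' : ℝ, f u ≠ 0 → f u' ≠ 0 →
      ‖Zsum L ((m₂ : ℝ) * u - (m₂' : ℝ) * u')‖ ≤ ζ ((m₂ : ℝ) * u - (m₂' : ℝ) * u') := by
    intro m₂ hm₂ m₂' hm₂' u u' hu hu'
    have hw : |(m₂ : ℝ) * u - (m₂' : ℝ) * u'| ≤ T ^ 6 := by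
      obtain ⟨hu1, hu2⟩ := hfS u hu
      obtain ⟨hu1', hu2'⟩ := hfS u' hu'
      have h1 : |(m₂ : ℝ) * u| ≤ 2 * T * 5 := by
        rw [abs_mul, abs_of_nonneg (show (0 : ℝ) ≤ u by linarith)]
        exact mul_le_mul ((hI₂ m₂ hm₂).2.trans (by linarith)) (by linarith) (by linarith) (by linarith)
      have h2 : |(m₂' : ℝ) * u'| ≤ 2 * T * 5 := by
        rw [abs_mul, abs_of_nonneg (show (0 : ℝ) ≤ u' by linarith)]
        exact mul_le_mul ((hI₂ m₂' hm₂').2.trans (by linarith)) (by linarith) (by linarith) (by linarith)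
      have h3 := abs_sub ((m₂ : ℝ) * u) ((m₂' : ℝ) * u')
      have h4 : (20 : ℝ) * T ≤ T ^ 6 := by
        have h5 : (4 : ℝ) ^ 5 ≤ T ^ 5 := pow_le_pow_left₀ (by norm_num) hT 5
        nlinarith
      linarith
    calc ‖Zsum L ((m₂ : ℝ) * u - (m₂' : ℝ) * u')‖
        ≤ perK (𝓕 psi1c) L (-((m₂ : ℝ) * u - (m₂' : ℝ) * u')) := norm_Zsum_le hL1 _
      _ ≤ ktil L L (-((m₂ : ℝ) * u - (m₂' : ℝ) * u')) + 8 * K * L * T ^ ((2 : ℝ) - j) :=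
          perK_le_ktil_add hK hj hKj hT1 hL hLr1 (by rwa [abs_neg])
      _ = ζ ((m₂ : ℝ) * u - (m₂' : ℝ) * u') := rfl
  set Bstar : ℝ := ∑ m₂ ∈ I₂, ∑ m₂' ∈ I₂, |(m₂ : ℝ)| * |(m₂' : ℝ)| *
    ∫ p : ℝ × ℝ, f p.1 * f p.2 * ζ ((m₂ : ℝ) * p.1 - (m₂' : ℝ) * p.2) with hBstar
  have hB_le : ∀ y, Bf y ≤ Bstar := fun y ↦ Bfun_le hf hfs hf0 I₂ L M₃' y hζc hζ0 hζb hZ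
  have hBstar0 : 0 ≤ Bstar := Finset.sum_nonneg fun m₂ _ ↦ Finset.sum_nonneg fun m₂' _ ↦
    mul_nonneg (by positivity) (integral_nonneg fun p ↦ mul_nonneg (mul_nonneg (hf0 _) (hf0 _)) (hζ0 _))
  ----------------------------------------------------------------
  -- Step 3: `Q̃ ≤ 4K · B⋆`
  ----------------------------------------------------------------
  obtain ⟨hψi, hψ4⟩ := integrable_norm_fourier_psi1c hK hK2
  have hstep3 : ∫ y, ‖𝓕 psi1c y‖ * Bf y ≤ 4 * K * Bstar := by
    calc ∫ y, ‖𝓕 psi1c y‖ * Bf y ≤ ∫ y, ‖𝓕 psi1c y‖ * Bstar :=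
          integral_mono_of_nonneg (Eventually.of_forall fun y ↦ mul_nonneg (norm_nonneg _) (hBf0 y))
            (hψi.mul_const _) (Eventually.of_forall fun y ↦ mul_le_mul_of_nonneg_left (hB_le y) (norm_nonneg _))
      _ = (∫ y, ‖𝓕 psi1c y‖) * Bstar := integral_mul_const _ _
      _ ≤ 4 * K * Bstar := mul_le_mul_of_nonneg_right hψ4 hBstar0
  ----------------------------------------------------------------
  -- Step 4: `B⋆ = main + ε₃-part`
  ----------------------------------------------------------------
  have hff_prod : ∫ p : ℝ × ℝ, f p.1 * f p.2 = N1 * N1 :=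
    integral_prod_mul (μ := (volume : Measure ℝ)) (ν := (volume : Measure ℝ)) f f
  have hsplit : ∀ m₂ m₂' : ℤ, ∫ p : ℝ × ℝ, f p.1 * f p.2 * ζ ((m₂ : ℝ) * p.1 - (m₂' : ℝ) * p.2) =
      (∫ p : ℝ × ℝ, f p.1 * f p.2 * ktil L L ((m₂' : ℝ) * p.2 - (m₂ : ℝ) * p.1)) + ε₃ * (N1 * N1) := by
    intro m₂ m₂'
    have hi1 : Integrable (fun p : ℝ × ℝ ↦ f p.1 * f p.2 * ktil L L ((m₂' : ℝ) * p.2 - (m₂ : ℝ) * p.1)) :=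
      integrable_ff_mul_real hf hfs ((ktil_continuous L L).comp (by fun_prop)) (C := 8 * K * L) fun p ↦ by
        rw [Real.norm_of_nonneg (ktil_nonneg L hLr0.le _)]; exact ktil_le hK hK2 L hLr1 _
    have hi2 : Integrable (fun p : ℝ × ℝ ↦ f p.1 * f p.2 * ε₃) :=
      integrable_ff_mul_real hf hfs continuous_const (C := ‖ε₃‖) fun p ↦ le_rfl
    have hi2' : Integrable (fun p : ℝ × ℝ ↦ ε₃ * (f p.1 * f p.2)) :=
      hi2.congr (Eventually.of_forall fun p ↦ by show f p.1 * f p.2 * ε₃ = ε₃ * (f p.1 * f p.2); ring)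
    rw [← hff_prod, ← integral_const_mul, ← integral_add hi1 hi2']
    refine integral_congr_ae (Eventually.of_forall fun p ↦ ?_)
    simp only [hζ, neg_sub]
    ring
  ----------------------------------------------------------------
  -- Step 5: the main double integral, iterated, and the `u'`-integral bounded via `f̃`
  ----------------------------------------------------------------
  set S : ℤ → ℤ → ℝ → ℝ := fun m₂ m₂' u ↦ ∑ k ∈ Finset.Icc (-(K₁ : ℤ)) K₁, fs (((m₂ : ℝ) * u + k) / m₂')
    with hS
  have hS0 : ∀ m₂ m₂' u, 0 ≤ S m₂ m₂' u := fun m₂ m₂' u ↦ Finset.sum_nonneg fun k _ ↦ hfs_0 _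
  have hSc : ∀ m₂ m₂', Continuous (S m₂ m₂') := by
    intro m₂ m₂'
    simp only [hS]
    fun_prop
  have hfS_i : ∀ m₂ m₂', Integrable (fun u ↦ f u * S m₂ m₂' u) := fun m₂ m₂' ↦
    (hf.continuous.mul (hSc m₂ m₂')).integrable_of_hasCompactSupport hfs.mul_right
  have hmain : ∀ m₂ ∈ I₂, ∀ m₂' ∈ I₂,
      ∫ p : ℝ × ℝ, f p.1 * f p.2 * ktil L L ((m₂' : ℝ) * p.2 - (m₂ : ℝ) * p.1) ≤
        |(m₂' : ℝ)|⁻¹ * ((∫ u, f u * S m₂ m₂' u) + (6 * L + 1) * εe * N1 * N1) := by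
    intro m₂ hm₂ m₂' hm₂'
    have hm₂'0 : 0 < |(m₂' : ℝ)| := by linarith [(hI₂ m₂' hm₂').1]
    have hi1 : Integrable (fun p : ℝ × ℝ ↦ f p.1 * f p.2 * ktil L L ((m₂' : ℝ) * p.2 - (m₂ : ℝ) * p.1)) :=
      integrable_ff_mul_real hf hfs ((ktil_continuous L L).comp (by fun_prop)) (C := 8 * K * L) fun p ↦ by
        rw [Real.norm_of_nonneg (ktil_nonneg L hLr0.le _)]; exact ktil_le hK hK2 L hLr1 _
    -- iterate
    have hiter : ∫ p : ℝ × ℝ, f p.1 * f p.2 * ktil L L ((m₂' : ℝ) * p.2 - (m₂ : ℝ) * p.1) =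
        ∫ u, f u * ∫ u', f u' * ktil L L ((m₂' : ℝ) * u' - (m₂ : ℝ) * u) := by
      have e : ∫ p : ℝ × ℝ, f p.1 * f p.2 * ktil L L ((m₂' : ℝ) * p.2 - (m₂ : ℝ) * p.1) =
          ∫ u, ∫ u', f u * f u' * ktil L L ((m₂' : ℝ) * u' - (m₂ : ℝ) * u) :=
        integral_prod (μ := (volume : Measure ℝ)) (ν := (volume : Measure ℝ)) _ hi1
      rw [e]
      refine integral_congr_ae (Eventually.of_forall fun u ↦ ?_)
      simp only
      rw [← integral_const_mul]
      refine integral_congr_ae (Eventually.of_forall fun u' ↦ ?_)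
      simp only
      ring
    rw [hiter]
    -- pointwise bound in `u`
    have hpt : ∀ u, f u * ∫ u', f u' * ktil L L ((m₂' : ℝ) * u' - (m₂ : ℝ) * u) ≤
        |(m₂' : ℝ)|⁻¹ * (f u * S m₂ m₂' u + (6 * L + 1) * εe * N1 * f u) := by
      intro u
      by_cases hu : f u = 0
      · rw [hu]; simp
      · have h1 := integral_f_ktil_le hf hfs hf0 hL1 hM₂0 hK hT1 hKj hLM (hI₂ m₂' hm₂') m₂ u
        rw [sum_fsm_restrict hM₂0 hT1 ha hb hfS hK₁ hK₁L (hI₂ m₂ hm₂) (hI₂ m₂' hm₂') hu] at h1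
        calc f u * ∫ u', f u' * ktil L L ((m₂' : ℝ) * u' - (m₂ : ℝ) * u)
            ≤ f u * (|(m₂' : ℝ)|⁻¹ * (S m₂ m₂' u + (6 * L + 1) * εe * N1)) :=
              mul_le_mul_of_nonneg_left h1 (hf0 u)
          _ = _ := by ring
    have hrhs_i : Integrable (fun u ↦ |(m₂' : ℝ)|⁻¹ * (f u * S m₂ m₂' u + (6 * L + 1) * εe * N1 * f u)) :=
      ((hfS_i m₂ m₂').add (hfi.const_mul _)).const_mul _
    calc ∫ u, f u * ∫ u', f u' * ktil L L ((m₂' : ℝ) * u' - (m₂ : ℝ) * u)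
        ≤ ∫ u, |(m₂' : ℝ)|⁻¹ * (f u * S m₂ m₂' u + (6 * L + 1) * εe * N1 * f u) :=
          integral_mono_of_nonneg (Eventually.of_forall fun u ↦ mul_nonneg (hf0 u)
            (integral_nonneg fun u' ↦ mul_nonneg (hf0 u') (ktil_nonneg L hLr0.le _))) hrhs_i
            (Eventually.of_forall hpt)
      _ = |(m₂' : ℝ)|⁻¹ * ((∫ u, f u * S m₂ m₂' u) + (6 * L + 1) * εe * N1 * N1) := by
          rw [integral_const_mul, integral_add (hfS_i m₂ m₂') (hfi.const_mul _), integral_const_mul]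
  ----------------------------------------------------------------
  -- Step 6: sum over `m₂, m₂'` and Cauchy–Schwarz
  ----------------------------------------------------------------
  have hcard : (I₂.card : ℝ) ≤ 6 * M₂ := card_shell_le hM₂ hI₂
  have hsumS : ∑ m₂ ∈ I₂, ∑ m₂' ∈ I₂, ∫ u, f u * S m₂ m₂' u = ∫ u, f u * affSum fs I₂ I₂ K₁ u := by
    calc ∑ m₂ ∈ I₂, ∑ m₂' ∈ I₂, ∫ u, f u * S m₂ m₂' u
        = ∑ m₂ ∈ I₂, ∫ u, ∑ m₂' ∈ I₂, f u * S m₂ m₂' u := by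
          refine Finset.sum_congr rfl fun m₂ _ ↦ ?_
          rw [integral_finsetSum _ (fun m₂' _ ↦ hfS_i m₂ m₂')]
      _ = ∫ u, ∑ m₂ ∈ I₂, ∑ m₂' ∈ I₂, f u * S m₂ m₂' u := by
          rw [integral_finsetSum _ (fun m₂ _ ↦ integrable_finsetSum _ fun m₂' _ ↦ hfS_i m₂ m₂')]
      _ = ∫ u, f u * affSum fs I₂ I₂ K₁ u := by
          refine integral_congr_ae (Eventually.of_forall fun u ↦ ?_)
          simp only [affSum, hS, Finset.mul_sum]
  have hCS : ∫ u, f u * affSum fs I₂ I₂ K₁ u ≤ N2 ^ (1 / 2 : ℝ) * (Jfun fs I₂ I₂ K₁) ^ (1 / 2 : ℝ) := by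
    have hA_c : Continuous (affSum fs I₂ I₂ K₁) := affSum_continuous hfs_c I₂ I₂ K₁
    have hA_cs : HasCompactSupport (affSum fs I₂ I₂ K₁) := by
      unfold affSum
      refine hasCompactSupport_fun_sum fun m₂ hm₂ ↦ hasCompactSupport_fun_sum fun m₂' hm₂' ↦
        hasCompactSupport_fun_sum fun k _ ↦ ?_
      have e : (fun u : ℝ ↦ fs (((m₂ : ℝ) * u + k) / m₂')) = fun u ↦ fs (((m₂ : ℝ) / m₂') * u + (k : ℝ) / m₂') := by
        ext u; congr 1; ring
      rw [e]
      exact hasCompactSupport_comp_affine (hasCompactSupport_fsm hfs L M₂ K T j)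
        (div_ne_zero (hI₂0 m₂ hm₂) (hI₂0 m₂' hm₂')) _
    have hfm : MemLp f (ENNReal.ofReal 2) volume := by
      rw [show ENNReal.ofReal 2 = 2 by simp]
      exact hf.continuous.memLp_of_hasCompactSupport hfs
    have hgm : MemLp (affSum fs I₂ I₂ K₁) (ENNReal.ofReal 2) volume := by
      rw [show ENNReal.ofReal 2 = 2 by simp]
      exact hA_c.memLp_of_hasCompactSupport hA_cs
    have h := integral_mul_le_Lp_mul_Lq_of_nonneg (μ := (volume : Measure ℝ)) Real.HolderConjugate.two_two
      (Eventually.of_forall hf0) (Eventually.of_forall (affSum_nonneg hfs_0 I₂ I₂ K₁)) hfm hgm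
    have e2 : ∀ g : ℝ → ℝ, (fun x ↦ g x ^ (2 : ℝ)) = fun x ↦ g x ^ 2 := fun g ↦ funext fun x ↦ Real.rpow_two _
    simp only [e2, one_div] at h
    rw [one_div]
    exact h
  ----------------------------------------------------------------
  -- Step 7: assemble
  ----------------------------------------------------------------
  have hsum_abs : ∑ m ∈ I₂, |(m : ℝ)| ≤ 12 * M₂ ^ 2 := by
    calc ∑ m ∈ I₂, |(m : ℝ)| ≤ ∑ m ∈ I₂, 2 * M₂ := Finset.sum_le_sum fun m hm ↦ (hI₂ m hm).2
      _ = (I₂.card : ℝ) * (2 * M₂) := by rw [Finset.sum_const, nsmul_eq_mul]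
      _ ≤ 6 * M₂ * (2 * M₂) := by gcongr
      _ = 12 * M₂ ^ 2 := by ring
  have hBstar_le : Bstar ≤ 2 * M₂ * (N2 ^ (1 / 2 : ℝ) * (Jfun fs I₂ I₂ K₁) ^ (1 / 2 : ℝ)) +
      72 * M₂ ^ 3 * ((6 * L + 1) * εe) * N1 ^ 2 + 144 * M₂ ^ 4 * ε₃ * N1 ^ 2 := by
    set Cc : ℝ := 2 * M₂ * ((6 * L + 1) * εe * N1 * N1) + 2 * M₂ * (2 * M₂) * (ε₃ * (N1 * N1)) with hCc
    have hCc0 : 0 ≤ Cc := by rw [hCc]; positivity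
    -- termwise
    have hterm : ∀ m₂ ∈ I₂, ∀ m₂' ∈ I₂, |(m₂ : ℝ)| * |(m₂' : ℝ)| *
        ∫ p : ℝ × ℝ, f p.1 * f p.2 * ζ ((m₂ : ℝ) * p.1 - (m₂' : ℝ) * p.2) ≤
        2 * M₂ * (∫ u, f u * S m₂ m₂' u) + Cc := by
      intro m₂ hm₂ m₂' hm₂'
      have hm₂'0 : 0 < |(m₂' : ℝ)| := by linarith [(hI₂ m₂' hm₂').1]
      have hm₂'ne : |(m₂' : ℝ)| ≠ 0 := hm₂'0.ne'
      have hIS0 : 0 ≤ ∫ u, f u * S m₂ m₂' u := integral_nonneg fun u ↦ mul_nonneg (hf0 u) (hS0 _ _ u)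
      have hab : |(m₂ : ℝ)| * |(m₂' : ℝ)| ≤ 2 * M₂ * (2 * M₂) :=
        mul_le_mul (hI₂ m₂ hm₂).2 (hI₂ m₂' hm₂').2 (abs_nonneg _) (by positivity)
      rw [hsplit m₂ m₂', mul_add]
      calc |(m₂ : ℝ)| * |(m₂' : ℝ)| * (∫ p : ℝ × ℝ, f p.1 * f p.2 * ktil L L ((m₂' : ℝ) * p.2 - (m₂ : ℝ) * p.1)) +
            |(m₂ : ℝ)| * |(m₂' : ℝ)| * (ε₃ * (N1 * N1))
          ≤ |(m₂ : ℝ)| * |(m₂' : ℝ)| * (|(m₂' : ℝ)|⁻¹ * ((∫ u, f u * S m₂ m₂' u) + (6 * L + 1) * εe * N1 * N1)) +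
            2 * M₂ * (2 * M₂) * (ε₃ * (N1 * N1)) :=
            add_le_add (mul_le_mul_of_nonneg_left (hmain m₂ hm₂ m₂' hm₂') (by positivity))
              (mul_le_mul_of_nonneg_right hab (by positivity))
        _ = |(m₂ : ℝ)| * ((∫ u, f u * S m₂ m₂' u) + (6 * L + 1) * εe * N1 * N1) +
            2 * M₂ * (2 * M₂) * (ε₃ * (N1 * N1)) := by
            rw [← mul_assoc, mul_inv_cancel_right₀ hm₂'ne]
        _ ≤ 2 * M₂ * ((∫ u, f u * S m₂ m₂' u) + (6 * L + 1) * εe * N1 * N1) +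
            2 * M₂ * (2 * M₂) * (ε₃ * (N1 * N1)) :=
            add_le_add (mul_le_mul_of_nonneg_right (hI₂ m₂ hm₂).2 (by positivity)) le_rfl
        _ = 2 * M₂ * (∫ u, f u * S m₂ m₂' u) + Cc := by simp only [hCc]; ring
    calc Bstar ≤ ∑ m₂ ∈ I₂, ∑ m₂' ∈ I₂, (2 * M₂ * (∫ u, f u * S m₂ m₂' u) + Cc) :=
          Finset.sum_le_sum fun m₂ hm₂ ↦ Finset.sum_le_sum fun m₂' hm₂' ↦ hterm m₂ hm₂ m₂' hm₂'
      _ = 2 * M₂ * (∑ m₂ ∈ I₂, ∑ m₂' ∈ I₂, ∫ u, f u * S m₂ m₂' u) + (I₂.card : ℝ) * ((I₂.card : ℝ) * Cc) := by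
          simp only [Finset.sum_add_distrib, Finset.sum_const, nsmul_eq_mul, ← Finset.mul_sum]
      _ ≤ 2 * M₂ * (N2 ^ (1 / 2 : ℝ) * (Jfun fs I₂ I₂ K₁) ^ (1 / 2 : ℝ)) + (6 * M₂) * ((6 * M₂) * Cc) := by
          have h1 : ∑ m₂ ∈ I₂, ∑ m₂' ∈ I₂, ∫ u, f u * S m₂ m₂' u ≤
              N2 ^ (1 / 2 : ℝ) * (Jfun fs I₂ I₂ K₁) ^ (1 / 2 : ℝ) := by rw [hsumS]; exact hCS
          have h2 : (I₂.card : ℝ) * ((I₂.card : ℝ) * Cc) ≤ (6 * M₂) * ((6 * M₂) * Cc) :=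
            mul_le_mul hcard (mul_le_mul_of_nonneg_right hcard hCc0) (by positivity) (by positivity)
          exact add_le_add (mul_le_mul_of_nonneg_left h1 (by positivity)) h2
      _ = _ := by simp only [hCc]; ring
  calc ∫ x, ktil L M₃' x * ‖PsiF f I₂ x‖ ^ 2 = ∫ y, ‖𝓕 psi1c y‖ * Bf y := hstep1
    _ ≤ 4 * K * Bstar := hstep3
    _ ≤ 4 * K * (2 * M₂ * (N2 ^ (1 / 2 : ℝ) * (Jfun fs I₂ I₂ K₁) ^ (1 / 2 : ℝ)) +
        72 * M₂ ^ 3 * ((6 * L + 1) * εe) * N1 ^ 2 + 144 * M₂ ^ 4 * ε₃ * N1 ^ 2) :=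
        mul_le_mul_of_nonneg_left hBstar_le (by positivity)
    _ = _ := by simp only [hε₃, hεe, hfsdef]; ring

end Qtil

/-! # Part C — Lemma 9.2 assembled and Proposition 9.1 -/


/-! ## §1. `J ≤ ∫ g²` and the trivial bound -/

/-- `∫ F(au + b) du = |a|^{-1} ∫ F` (`a ≠ 0`). [folklore] -/
theorem integral_comp_affine (F : ℝ → ℝ) {a : ℝ} (_ha : a ≠ 0) (b : ℝ) :
    ∫ u, F (a * u + b) = |a|⁻¹ * ∫ y, F y := by
  have h1 : (fun u ↦ F (a * u + b)) = fun u ↦ (fun t ↦ F (t + b)) (a * u) := rfl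
  rw [h1, Measure.integral_comp_mul_left (fun t ↦ F (t + b)) a, smul_eq_mul, abs_inv]
  congr 1
  exact integral_add_right_eq_self (μ := volume) F b

section basic

variable {f : ℝ → ℝ} (hf : ContDiff ℝ ∞ f) (hfs : HasCompactSupport f) (hf0 : ∀ x, 0 ≤ f x)
include hf hfs hf0

/-- **`J(f) ≤ ∫ g²`** (eq. (9.3): `affSum ≤ gfun` pointwise, both non-negative).
[cite: GuthMaynard2026, (9.3)] -/
theorem Jfun_le_integral_gfun_sq (I₁ I₂ : Finset ℤ) (hI₁ : ∀ m ∈ I₁, m ≠ 0) (hI₂ : ∀ m ∈ I₂, m ≠ 0)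
    {M₃ N₃ : ℕ} {M₃' : ℝ} (hM₃' : 0 < M₃') (hM : (M₃ : ℝ) ≤ 2 * M₃') (hN : M₃ ≤ N₃) :
    Jfun f I₁ I₂ M₃ ≤ ∫ u, gfun f I₁ I₂ M₃' N₃ u ^ 2 := by
  have hc : Continuous (gfun f I₁ I₂ M₃' N₃) := gfun_continuous hf I₁ I₂ M₃' N₃
  have hs : HasCompactSupport (gfun f I₁ I₂ M₃' N₃) := hasCompactSupport_gfun hfs I₁ I₂ hI₁ hI₂ M₃' N₃
  have hi : Integrable (fun u ↦ gfun f I₁ I₂ M₃' N₃ u * gfun f I₁ I₂ M₃' N₃ u) :=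
    (hc.mul hc).integrable_of_hasCompactSupport hs.mul_right
  have e : (fun u ↦ gfun f I₁ I₂ M₃' N₃ u ^ 2) = fun u ↦ gfun f I₁ I₂ M₃' N₃ u * gfun f I₁ I₂ M₃' N₃ u := by
    ext u; ring
  have hi2 : Integrable (fun u ↦ gfun f I₁ I₂ M₃' N₃ u ^ 2) := by rw [e]; exact hi
  unfold Jfun
  exact integral_mono_of_nonneg (Eventually.of_forall fun u ↦ sq_nonneg _) hi2
    (Eventually.of_forall fun u ↦
      pow_le_pow_left₀ (affSum_nonneg hf0 I₁ I₂ M₃ u) (affSum_le_gfun hf0 I₁ I₂ hM₃' hM hN u) 2)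

set_option maxHeartbeats 800000 in
omit hf0 in
/-- **The trivial bound** ("By a simple Cauchy–Schwarz argument, we can bound the left hand side by
`M⁶ ∫|f|²`"; here with the ranges made explicit):
`J(f; I₁, I₂, M₃) ≤ |I₁|²|I₂|²(2M₃+1)² (2M₂/M₁) ‖f‖₂²` for `I₁ ⊂ {M₁ ≤ |m| ≤ 2M₁}`, `I₂ ⊂ {M₂ ≤ |m| ≤ 2M₂}`.
[cite: GuthMaynard2026, Remark after Proposition 9.1] -/
theorem Jfun_trivial {I₁ I₂ : Finset ℤ} {M₁ M₂ : ℝ} (_hM₁ : 1 ≤ M₁) (_hM₂ : 1 ≤ M₂)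
    (hI₁ : ∀ m ∈ I₁, M₁ ≤ |(m : ℝ)| ∧ |(m : ℝ)| ≤ 2 * M₁) (hI₂ : ∀ m ∈ I₂, M₂ ≤ |(m : ℝ)| ∧ |(m : ℝ)| ≤ 2 * M₂)
    (M₃ : ℕ) :
    Jfun f I₁ I₂ M₃ ≤ (I₁.card : ℝ) ^ 2 * (I₂.card : ℝ) ^ 2 * (2 * M₃ + 1) ^ 2 * (2 * M₂ / M₁) * ∫ y, f y ^ 2 := by
  have hM₁0 : 0 < M₁ := by linarith
  have hI₁0 : ∀ m ∈ I₁, (m : ℝ) ≠ 0 := by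
    intro m hm h; have := (hI₁ m hm).1; rw [h, abs_zero] at this; linarith
  have hI₂0 : ∀ m ∈ I₂, (m : ℝ) ≠ 0 := by
    intro m hm h; have := (hI₂ m hm).1; rw [h, abs_zero] at this; linarith
  set I₃ : Finset ℤ := Finset.Icc (-(M₃ : ℤ)) M₃ with hI₃
  have hI₃card : (I₃.card : ℝ) = 2 * M₃ + 1 := card_Icc_neg_real M₃
  set N2 : ℝ := ∫ y, f y ^ 2 with hN2
  have hN20 : 0 ≤ N2 := integral_nonneg fun y ↦ sq_nonneg _
  have hf2i : Integrable (fun y ↦ f y ^ 2) := by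
    have e : (fun y ↦ f y ^ 2) = fun y ↦ f y * f y := by ext y; ring
    rw [e]
    exact (hf.continuous.mul hf.continuous).integrable_of_hasCompactSupport hfs.mul_right
  -- pointwise Cauchy–Schwarz
  have hpt : ∀ u, affSum f I₁ I₂ M₃ u ^ 2 ≤ (I₁.card : ℝ) * (I₂.card : ℝ) * (I₃.card : ℝ) *
      ∑ m₁ ∈ I₁, ∑ m₂ ∈ I₂, ∑ m₃ ∈ I₃, f (((m₁ : ℝ) * u + m₃) / m₂) ^ 2 := by
    intro u
    unfold affSum
    calc (∑ m₁ ∈ I₁, ∑ m₂ ∈ I₂, ∑ m₃ ∈ I₃, f (((m₁ : ℝ) * u + m₃) / m₂)) ^ 2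
        ≤ I₁.card * ∑ m₁ ∈ I₁, (∑ m₂ ∈ I₂, ∑ m₃ ∈ I₃, f (((m₁ : ℝ) * u + m₃) / m₂)) ^ 2 :=
          sq_sum_le_card_mul_sum_sq
      _ ≤ I₁.card * ∑ m₁ ∈ I₁, (I₂.card * ∑ m₂ ∈ I₂, (∑ m₃ ∈ I₃, f (((m₁ : ℝ) * u + m₃) / m₂)) ^ 2) := by
          gcongr with m₁ _
          exact sq_sum_le_card_mul_sum_sq
      _ ≤ I₁.card * ∑ m₁ ∈ I₁, (I₂.card * ∑ m₂ ∈ I₂, (I₃.card * ∑ m₃ ∈ I₃, f (((m₁ : ℝ) * u + m₃) / m₂) ^ 2)) := by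
          gcongr with m₁ _ m₂ _
          exact sq_sum_le_card_mul_sum_sq
      _ = _ := by
          simp only [Finset.mul_sum]
          exact Finset.sum_congr rfl fun _ _ ↦ Finset.sum_congr rfl fun _ _ ↦
            Finset.sum_congr rfl fun _ _ ↦ by ring
  -- integrate
  have hterm : ∀ m₁ ∈ I₁, ∀ m₂ ∈ I₂, ∀ m₃ : ℤ,
      Integrable (fun u ↦ f (((m₁ : ℝ) * u + m₃) / m₂) ^ 2) ∧
        ∫ u, f (((m₁ : ℝ) * u + m₃) / m₂) ^ 2 ≤ 2 * M₂ / M₁ * N2 := by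
    intro m₁ hm₁ m₂ hm₂ m₃
    have ha : (m₁ : ℝ) / m₂ ≠ 0 := div_ne_zero (hI₁0 m₁ hm₁) (hI₂0 m₂ hm₂)
    have e : (fun u ↦ f (((m₁ : ℝ) * u + m₃) / m₂) ^ 2) =
        fun u ↦ (fun t ↦ f t ^ 2) ((m₁ : ℝ) / m₂ * u + (m₃ : ℝ) / m₂) := by
      ext u; congr 2; field_simp
    rw [e]
    refine ⟨(hf2i.comp_add_right ((m₃ : ℝ) / m₂)).comp_mul_left' ha, ?_⟩
    rw [integral_comp_affine (fun t ↦ f t ^ 2) ha]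
    refine mul_le_mul_of_nonneg_right ?_ hN20
    rw [abs_div, inv_div, div_le_div_iff₀ (by linarith [(hI₁ m₁ hm₁).1]) hM₁0]
    have h1 := (hI₂ m₂ hm₂).2
    have h2 := (hI₁ m₁ hm₁).1
    nlinarith [abs_nonneg (m₂ : ℝ)]
  have hrhs_i : Integrable (fun u ↦ (I₁.card : ℝ) * (I₂.card : ℝ) * (I₃.card : ℝ) *
      ∑ m₁ ∈ I₁, ∑ m₂ ∈ I₂, ∑ m₃ ∈ I₃, f (((m₁ : ℝ) * u + m₃) / m₂) ^ 2) := by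
    refine Integrable.const_mul (integrable_finsetSum _ fun m₁ hm₁ ↦ integrable_finsetSum _ fun m₂ hm₂ ↦
      integrable_finsetSum _ fun m₃ _ ↦ (hterm m₁ hm₁ m₂ hm₂ m₃).1) _
  unfold Jfun
  calc ∫ u, affSum f I₁ I₂ M₃ u ^ 2
      ≤ ∫ u, (I₁.card : ℝ) * (I₂.card : ℝ) * (I₃.card : ℝ) *
          ∑ m₁ ∈ I₁, ∑ m₂ ∈ I₂, ∑ m₃ ∈ I₃, f (((m₁ : ℝ) * u + m₃) / m₂) ^ 2 :=
        integral_mono_of_nonneg (Eventually.of_forall fun u ↦ sq_nonneg _) hrhs_i (Eventually.of_forall hpt)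
    _ = (I₁.card : ℝ) * (I₂.card : ℝ) * (I₃.card : ℝ) *
          ∑ m₁ ∈ I₁, ∑ m₂ ∈ I₂, ∑ m₃ ∈ I₃, ∫ u, f (((m₁ : ℝ) * u + m₃) / m₂) ^ 2 := by
        rw [integral_const_mul, integral_finsetSum _ fun m₁ hm₁ ↦ integrable_finsetSum _ fun m₂ hm₂ ↦
          integrable_finsetSum _ fun m₃ _ ↦ (hterm m₁ hm₁ m₂ hm₂ m₃).1]
        congr 1
        refine Finset.sum_congr rfl fun m₁ hm₁ ↦ ?_
        rw [integral_finsetSum _ fun m₂ hm₂ ↦ integrable_finsetSum _ fun m₃ _ ↦ (hterm m₁ hm₁ m₂ hm₂ m₃).1]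
        refine Finset.sum_congr rfl fun m₂ hm₂ ↦ ?_
        rw [integral_finsetSum _ fun m₃ _ ↦ (hterm m₁ hm₁ m₂ hm₂ m₃).1]
    _ ≤ (I₁.card : ℝ) * (I₂.card : ℝ) * (I₃.card : ℝ) *
          ∑ m₁ ∈ I₁, ∑ m₂ ∈ I₂, ∑ m₃ ∈ I₃, (2 * M₂ / M₁ * N2) := by
        gcongr with m₁ hm₁ m₂ hm₂ m₃ _
        exact (hterm m₁ hm₁ m₂ hm₂ m₃).2
    _ = (I₁.card : ℝ) ^ 2 * (I₂.card : ℝ) ^ 2 * (I₃.card : ℝ) ^ 2 * (2 * M₂ / M₁) * N2 := by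
        simp only [Finset.sum_const, nsmul_eq_mul]; ring
    _ = _ := by rw [hI₃card]

omit hf0 in
/-- The trivial bound in the shape used as the base of the iteration: for `M₁, M₂ ≤ M`, `M₃ ≤ 23M`,
`J(f) ≤ 6·10⁶ M⁷ ‖f‖₂²`. [cite: GuthMaynard2026, Remark after Proposition 9.1] -/
theorem Jfun_trivial' {I₁ I₂ : Finset ℤ} {M M₁ M₂ : ℝ} (hM₁ : 1 ≤ M₁) (_hM₁M : M₁ ≤ M) (hM₂ : 1 ≤ M₂) (_hM₂M : M₂ ≤ M)
    (hI₁ : ∀ m ∈ I₁, M₁ ≤ |(m : ℝ)| ∧ |(m : ℝ)| ≤ 2 * M₁) (hI₂ : ∀ m ∈ I₂, M₂ ≤ |(m : ℝ)| ∧ |(m : ℝ)| ≤ 2 * M₂)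
    {M₃ : ℕ} (_hM₃ : (M₃ : ℝ) ≤ 23 * M) :
    Jfun f I₁ I₂ M₃ ≤ 6000000 * M ^ 7 * ∫ y, f y ^ 2 := by
  have h := Jfun_trivial hf hfs hM₁ hM₂ hI₁ hI₂ M₃
  have hN20 : 0 ≤ ∫ y, f y ^ 2 := integral_nonneg fun y ↦ sq_nonneg _
  have h1 : (I₁.card : ℝ) ≤ 6 * M := (card_shell_le hM₁ hI₁).trans (by linarith)
  have h2 : (I₂.card : ℝ) ≤ 6 * M := (card_shell_le hM₂ hI₂).trans (by linarith)
  have h3 : (2 * M₃ + 1 : ℝ) ≤ 47 * M := by linarith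
  have h4 : 2 * M₂ / M₁ ≤ 2 * M := by
    rw [div_le_iff₀ (by linarith)]; nlinarith
  have hM0 : 0 ≤ M := by linarith
  calc Jfun f I₁ I₂ M₃ ≤ (I₁.card : ℝ) ^ 2 * (I₂.card : ℝ) ^ 2 * (2 * M₃ + 1) ^ 2 * (2 * M₂ / M₁) * ∫ y, f y ^ 2 := h
    _ ≤ (6 * M) ^ 2 * (6 * M) ^ 2 * (47 * M) ^ 2 * (2 * M) * ∫ y, f y ^ 2 := by gcongr
    _ = 5725728 * M ^ 7 * ∫ y, f y ^ 2 := by ring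
    _ ≤ _ := by gcongr; norm_num

end basic

/-! ## §2. The smoothing step on the class of admissible `f` -/

section smoothing

variable {L M₂ K' T : ℝ} {j : ℕ}
variable {f : ℝ → ℝ} (hf : ContDiff ℝ ∞ f) (hfs : HasCompactSupport f) (hf0 : ∀ x, 0 ≤ f x)

include hf hfs hf0 in
/-- **`‖f̃‖₂² ≤ ‖ρ_T‖₁² ‖f‖₂²`** (Cauchy–Schwarz in the convolution, then Fubini) ("`∫ f̃² ⪅ ∫ f²`").
[cite: GuthMaynard2026, proof of Proposition 9.1] -/
theorem integral_fsm_sq_le (hL : 0 ≤ L) (hM₂ : 0 ≤ M₂) (hK' : 0 ≤ K') (T : ℝ) (j : ℕ) :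
    ∫ c, fsm L M₂ K' T j f c ^ 2 ≤ (∫ z, rhoT L M₂ K' T j z) ^ 2 * ∫ y, f y ^ 2 := by
  set I₁ : ℝ := ∫ z, rhoT L M₂ K' T j z with hI₁
  have hρi := rhoT_integrable hL hM₂ hK' T j
  have hf2c : Continuous fun y ↦ f y ^ 2 := hf.continuous.pow 2
  have hf2s : HasCompactSupport fun y ↦ f y ^ 2 := hfs.comp_left (g := fun y : ℝ ↦ y ^ 2) (by simp)
  have hf2i : Integrable fun y ↦ f y ^ 2 := hf2c.integrable_of_hasCompactSupport hf2s
  -- pointwise Cauchy–Schwarz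
  have hpt : ∀ x, fsm L M₂ K' T j f x ^ 2 ≤ I₁ * ∫ u, rhoT L M₂ K' T j (x - u) * f u ^ 2 := by
    intro x
    rw [fsm_apply]
    have hρx : Integrable (fun u ↦ rhoT L M₂ K' T j (x - u)) := hρi.comp_sub_left x
    have hρf2 : Integrable (fun u ↦ rhoT L M₂ K' T j (x - u) * f u ^ 2) :=
      hf2i.bdd_mul ((rhoT_measurable L M₂ K' T j).comp (measurable_const.sub measurable_id)).aestronglyMeasurable
        (Eventually.of_forall fun u ↦ by
          rw [Real.norm_of_nonneg (rhoT_nonneg hL hM₂ hK' T j _)]; exact rhoT_le hL hM₂ hK' T j _)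
    have h := GuthMaynardS2.sq_integral_mul_le (f := fun u ↦ rhoT L M₂ K' T j (x - u)) (g := f)
      (fun u ↦ rhoT_nonneg hL hM₂ hK' T j _) hf0 hρx hf.continuous.aestronglyMeasurable hρf2
    have hρint : ∫ u, rhoT L M₂ K' T j (x - u) = I₁ := integral_sub_left_eq_self (rhoT L M₂ K' T j) volume x
    rw [hρint] at h
    exact h
  have hconv : ∀ x, ∫ u, rhoT L M₂ K' T j (x - u) * f u ^ 2 = (rhoT L M₂ K' T j ⋆ fun u ↦ f u ^ 2) x := by
    intro x; rw [convolution_eq_swap]; rfl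
  have hint : ∫ x, (rhoT L M₂ K' T j ⋆ fun u ↦ f u ^ 2) x = I₁ * ∫ u, f u ^ 2 := by
    rw [integral_convolution _ hρi hf2i, ContinuousLinearMap.lsmul_apply, smul_eq_mul]
  have hci : Integrable (rhoT L M₂ K' T j ⋆ fun u ↦ f u ^ 2) := by
    have hc : Continuous (rhoT L M₂ K' T j ⋆ fun u ↦ f u ^ 2) :=
      hf2s.continuous_convolution_right _ hρi.locallyIntegrable hf2c
    exact hc.integrable_of_hasCompactSupport ((hasCompactSupport_rhoT L M₂ K' T j).convolution _ hf2s)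
  calc ∫ x, fsm L M₂ K' T j f x ^ 2 ≤ ∫ x, I₁ * (rhoT L M₂ K' T j ⋆ fun u ↦ f u ^ 2) x := by
        refine integral_mono_of_nonneg (Eventually.of_forall fun x ↦ sq_nonneg _) (hci.const_mul I₁)
          (Eventually.of_forall fun x ↦ ?_)
        simp only
        rw [← hconv]; exact hpt x
    _ = I₁ * (I₁ * ∫ u, f u ^ 2) := by rw [integral_const_mul, hint]
    _ = I₁ ^ 2 * ∫ u, f u ^ 2 := by ring

/-- `f̃` as a complex function is the convolution (for multiplication) of the complexified kernel and `f`.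
[folklore] -/
theorem fsm_ofReal_eq (L M₂ K' T : ℝ) (j : ℕ) (f : ℝ → ℝ) :
    (fun x ↦ ((fsm L M₂ K' T j f x : ℝ) : ℂ)) =
      (fun y ↦ ((rhoT L M₂ K' T j y : ℝ) : ℂ)) ⋆[ContinuousLinearMap.mul ℂ ℂ] (fun u ↦ ((f u : ℝ) : ℂ)) := by
  ext x
  rw [fsm, convolution_def, convolution_def, ← integral_complex_ofReal]
  refine integral_congr_ae (Eventually.of_forall fun t ↦ ?_)
  simp only [ContinuousLinearMap.lsmul_apply, smul_eq_mul, ContinuousLinearMap.mul_apply']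
  push_cast
  rfl

include hf hfs in
/-- **`|𝓕f̃(ζ)| ≤ ‖ρ_T‖₁ |𝓕f(ζ)|`** ("`f̃` has Fourier transform `f̂(ξ)ψ̂(ξ/T)`, so also satisfies the rapid
decay assumption"). [cite: GuthMaynard2026, proof of Proposition 9.1] -/
theorem norm_fourier_fsm_le (hL : 0 ≤ L) (hM₂ : 0 ≤ M₂) (hK' : 0 ≤ K') (T : ℝ) (j : ℕ) (ζ : ℝ) :
    ‖𝓕 (fun x ↦ ((fsm L M₂ K' T j f x : ℝ) : ℂ)) ζ‖ ≤
      (∫ z, rhoT L M₂ K' T j z) * ‖𝓕 (fun y ↦ ((f y : ℝ) : ℂ)) ζ‖ := by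
  rw [fsm_ofReal_eq]
  have h := Real.fourier_mul_convolution_eq (rhoT_integrable hL hM₂ hK' T j).ofReal (integrable_fc hf hfs) ζ
  calc ‖𝓕 ((fun y ↦ ((rhoT L M₂ K' T j y : ℝ) : ℂ)) ⋆[ContinuousLinearMap.mul ℂ ℂ] (fun u ↦ ((f u : ℝ) : ℂ))) ζ‖
      = ‖𝓕 (fun y ↦ ((rhoT L M₂ K' T j y : ℝ) : ℂ)) ζ * 𝓕 (fun y ↦ ((f y : ℝ) : ℂ)) ζ‖ := congrArg _ h
    _ = ‖𝓕 (fun y ↦ ((rhoT L M₂ K' T j y : ℝ) : ℂ)) ζ‖ * ‖𝓕 (fun y ↦ ((f y : ℝ) : ℂ)) ζ‖ := norm_mul _ _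
    _ ≤ (∫ z, rhoT L M₂ K' T j z) * ‖𝓕 (fun y ↦ ((f y : ℝ) : ℂ)) ζ‖ := by
        refine mul_le_mul_of_nonneg_right ?_ (norm_nonneg _)
        refine (norm_fourier_le_integral_norm _ _).trans (le_of_eq ?_)
        refine integral_congr_ae (Eventually.of_forall fun u ↦ ?_)
        simp only [Complex.norm_real, Real.norm_eq_abs, abs_of_nonneg (rhoT_nonneg hL hM₂ hK' T j u)]

end smoothing

/-! ## §3. Lemma 9.2 assembled -/

section step

variable {f : ℝ → ℝ} (hf : ContDiff ℝ ∞ f) (hfs : HasCompactSupport f) (hf0 : ∀ x, 0 ≤ f x)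
include hf hfs hf0

omit hf hfs hf0 in
/-- `T^{2−j} ≤ (T^{20})^{-1}` for `j ≥ 22`, `T ≥ 1`. [folklore] -/
theorem rpow_two_sub_le {T : ℝ} (hT : 1 ≤ T) {j : ℕ} (hj : 22 ≤ j) : T ^ ((2 : ℝ) - j) ≤ (T ^ 20)⁻¹ := by
  have hj' : (22 : ℝ) ≤ j := by exact_mod_cast hj
  calc T ^ ((2 : ℝ) - j) ≤ T ^ (-(20 : ℝ)) := Real.rpow_le_rpow_of_exponent_le hT (by linarith)
    _ = (T ^ 20)⁻¹ := by rw [Real.rpow_neg (by linarith), show (20 : ℝ) = ((20 : ℕ) : ℝ) by norm_num, Real.rpow_natCast]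

omit hf hfs hf0 in
/-- `T^{-4j} ≤ (T^{26})^{-1}` for `j ≥ 22`, `T ≥ 1`. [folklore] -/
theorem rpow_neg_four_mul_le {T : ℝ} (hT : 1 ≤ T) {j : ℕ} (hj : 22 ≤ j) : T ^ (-(4 * j : ℝ)) ≤ (T ^ 26)⁻¹ := by
  have hj' : (22 : ℝ) ≤ j := by exact_mod_cast hj
  calc T ^ (-(4 * j : ℝ)) ≤ T ^ (-(26 : ℝ)) := Real.rpow_le_rpow_of_exponent_le hT (by linarith)
    _ = (T ^ 26)⁻¹ := by rw [Real.rpow_neg (by linarith), show (26 : ℝ) = ((26 : ℕ) : ℝ) by norm_num, Real.rpow_natCast]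

set_option maxHeartbeats 3200000 in
/-- **Guth–Maynard Lemma 9.2 (iterative bound for `J(f)`), assembled and quantitative.** Let `0 < η ≤ 1`,
`j ≥ 22`, `K ≥ 0` with `|ψ̂₁(y)| ≤ K(1+|y|)^{-2}` and `≤ K(1+|y|)^{-j}`, and let `C_R ≥ 0` be a region-II
constant at height `T` (the conclusion of `sum_perK_le_regionII`). Let `T ≥ 23`, `1 ≤ M ≤ T`,
`1 ≤ M₁, M₂ ≤ M`, `M₃ ≤ 23M`, `I₁ ⊂ {M₁ ≤ |m| ≤ 2M₁}`, `I₂ ⊂ {M₂ ≤ |m| ≤ 2M₂}`, and let `f ≥ 0` be smooth,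
supported in `[a, b] ⊂ [0, 5]`, with `|f̂(ζ)| ≤ T²‖f‖₁(T/|ζ|)⁴` for `ζ ≠ 0`. Then with
`f̃ = fsm ⌈T⁶+T⌉ M₂ K T j f` and `K₁ = ⌈22M₂⌉`,
`J(f; I₁,I₂,M₃) ≤ 6.9·10⁷K² T^η M⁶‖f‖₁² + 1152 C_R K T^η M² ‖f‖₂ J(f̃; I₂,I₂,K₁)^{1/2}
  + (10⁷C_RK² + 10⁷C_RK + 10¹⁸K²) T^{-8} (‖f‖₁² + ‖f‖₂²)`.
[cite: GuthMaynard2026, Lemma 9.2] -/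
theorem J_step {η K C_R T M M₁ M₂ a b : ℝ} {j M₃ : ℕ} {I₁ I₂ : Finset ℤ}
    (hη : 0 < η) (hη1 : η ≤ 1) (hj : 22 ≤ j) (hK : 0 ≤ K)
    (hK2 : ∀ y, ‖𝓕 psi1c y‖ ≤ K / (1 + |y|) ^ 2) (hKj : ∀ y, ‖𝓕 psi1c y‖ ≤ K / (1 + |y|) ^ j)
    (hCR : 0 ≤ C_R)
    (hR : ∀ (M₁ M₃' : ℝ), 1 ≤ M₁ → M₁ ≤ T → 1 ≤ M₃' → M₃' ≤ T ^ 2 →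
      ∀ (I₁ : Finset ℤ), (∀ m ∈ I₁, M₁ ≤ |(m : ℝ)| ∧ |(m : ℝ)| ≤ 2 * M₁) →
      ∀ ξ : ℝ, T ^ η * M₁ / M₃' < |ξ| → |ξ| ≤ T ^ 6 →
      ∑ m₁ ∈ I₁, perK (𝓕 psi1c) M₃' (ξ / m₁) ≤ C_R * T ^ η * (M₁ + M₃'))
    (hT : 23 ≤ T) (_hM : 1 ≤ M) (hMT : M ≤ T)
    (hM₁ : 1 ≤ M₁) (hM₁M : M₁ ≤ M) (hM₂ : 1 ≤ M₂) (hM₂M : M₂ ≤ M) (hM₃ : (M₃ : ℝ) ≤ 23 * M)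
    (hI₁ : ∀ m ∈ I₁, M₁ ≤ |(m : ℝ)| ∧ |(m : ℝ)| ≤ 2 * M₁) (hI₂ : ∀ m ∈ I₂, M₂ ≤ |(m : ℝ)| ∧ |(m : ℝ)| ≤ 2 * M₂)
    (ha : 0 ≤ a) (hb : b ≤ 5) (hfS : ∀ x, f x ≠ 0 → a ≤ x ∧ x ≤ b)
    (hdec : ∀ ζ : ℝ, ζ ≠ 0 → ‖𝓕 (fun y ↦ ((f y : ℝ) : ℂ)) ζ‖ ≤ T ^ 2 * (∫ y, f y) * (T / |ζ|) ^ 4) :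
    Jfun f I₁ I₂ M₃ ≤ 69000000 * K ^ 2 * T ^ η * M ^ 6 * (∫ y, f y) ^ 2
      + 1152 * C_R * K * T ^ η * M ^ 2 * (∫ y, f y ^ 2) ^ (1 / 2 : ℝ) *
          (Jfun (fsm ⌈T ^ 6 + T⌉₊ M₂ K T j f) I₂ I₂ ⌈22 * M₂⌉₊) ^ (1 / 2 : ℝ)
      + (10 ^ 7 * C_R * K ^ 2 + 10 ^ 7 * C_R * K + 10 ^ 18 * K ^ 2) * (T ^ 8)⁻¹ *
          ((∫ y, f y) ^ 2 + ∫ y, f y ^ 2) := by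
  -- parameters
  have hT1 : 1 ≤ T := by linarith
  have hT4 : 4 ≤ T := by linarith
  have hT0 : 0 < T := by linarith
  have hM₁T : M₁ ≤ T := hM₁M.trans hMT
  have hM₂T : M₂ ≤ T := hM₂M.trans hMT
  have hI₁0 : ∀ m ∈ I₁, m ≠ 0 := by
    intro m hm h; have := (hI₁ m hm).1; rw [h, Int.cast_zero, abs_zero] at this; linarith
  have hI₂0 : ∀ m ∈ I₂, m ≠ 0 := by
    intro m hm h; have := (hI₂ m hm).1; rw [h, Int.cast_zero, abs_zero] at this; linarith
  -- name the integer parameters appearing in the statement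
  generalize hLdef : ⌈T ^ 6 + T⌉₊ = L
  generalize hK₁def : ⌈22 * M₂⌉₊ = K₁
  obtain ⟨M₃', hM₃'def⟩ : ∃ x : ℝ, x = max (M₃ : ℝ) 1 := ⟨_, rfl⟩
  obtain ⟨N₃, hN₃def⟩ : ∃ n : ℕ, n = 3 * max M₃ 1 := ⟨_, rfl⟩
  set N1 : ℝ := ∫ y, f y with hN1
  set N2 : ℝ := ∫ y, f y ^ 2 with hN2
  have hN10 : 0 ≤ N1 := integral_nonneg hf0
  have hN20 : 0 ≤ N2 := integral_nonneg fun y ↦ sq_nonneg _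
  have hM₃'1 : 1 ≤ M₃' := by rw [hM₃'def]; exact le_max_right _ _
  have hM₃'0 : 0 < M₃' := by linarith
  have hM₃'M : M₃' ≤ 23 * M := by rw [hM₃'def]; exact max_le hM₃ (by linarith)
  have hM₃'T : M₃' ≤ T ^ 2 := by nlinarith
  have hM₃'T' : M₃' ≤ 1001 * T := by nlinarith
  have hM₃2 : (M₃ : ℝ) ≤ 2 * M₃' := by
    have : (M₃ : ℝ) ≤ M₃' := by rw [hM₃'def]; exact le_max_left _ _
    linarith
  have hM₃N : M₃ ≤ N₃ := by rw [hN₃def]; omega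
  have hN₃' : 3 * M₃' ≤ (N₃ : ℝ) := by
    rw [hN₃def, hM₃'def, Nat.cast_mul, Nat.cast_max]; norm_num
  have hLlo : T ^ 6 + T ≤ (L : ℝ) := by rw [← hLdef]; exact Nat.le_ceil _
  have hLhi : (L : ℝ) ≤ 3 * T ^ 6 := by
    have h1 : (L : ℝ) < T ^ 6 + T + 1 := by rw [← hLdef]; exact Nat.ceil_lt_add_one (by positivity)
    have h2 : T ≤ T ^ 6 := by
      calc T = T ^ 1 := (pow_one T).symm
        _ ≤ T ^ 6 := pow_le_pow_right₀ hT1 (by norm_num)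
    have h3 : (1 : ℝ) ≤ T ^ 6 := one_le_pow₀ hT1
    linarith
  have hL19 : 6 * (L : ℝ) + 1 ≤ 19 * T ^ 6 := by
    have h3 : (1 : ℝ) ≤ T ^ 6 := one_le_pow₀ hT1
    linarith
  have hK₁lo : 22 * M₂ ≤ (K₁ : ℝ) := by rw [← hK₁def]; exact Nat.le_ceil _
  have hK₁L : K₁ ≤ 3 * L := by
    have : (K₁ : ℝ) ≤ 3 * (L : ℝ) := by
      have h1 : (K₁ : ℝ) < 22 * M₂ + 1 := by rw [← hK₁def]; exact Nat.ceil_lt_add_one (by positivity)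
      have h7 : T * (4 : ℝ) ^ 5 ≤ T * T ^ 5 :=
        mul_le_mul_of_nonneg_left (pow_le_pow_left₀ (by norm_num) hT4 5) hT0.le
      nlinarith [h7]
    exact_mod_cast this
  -- the region-II constant at this configuration
  set S_II : ℝ := C_R * T ^ η * (M₁ + M₃') with hS_II
  have hS0 : 0 ≤ S_II := by rw [hS_II]; positivity
  have hTηT : T ^ η ≤ T := by
    calc T ^ η ≤ T ^ (1 : ℝ) := Real.rpow_le_rpow_of_exponent_le hT1 hη1
      _ = T := Real.rpow_one T
  have hS24 : S_II ≤ 24 * C_R * T ^ η * M := by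
    simp only [hS_II]; nlinarith [mul_nonneg hCR (by positivity : (0:ℝ) ≤ T ^ η)]
  have hS24' : S_II ≤ 24 * C_R * T * M := hS24.trans (by gcongr)
  -- Step A: `J ≤ ∫ g²`
  have hA := Jfun_le_integral_gfun_sq hf hfs hf0 I₁ I₂ hI₁0 hI₂0 hM₃'0 hM₃2 hM₃N (N₃ := N₃)
  -- Step B: regions I–III
  have hB := integral_gfun_sq_le hf hfs hf0 hT1 hη.le (by positivity : (0:ℝ) ≤ T ^ 2 * N1) le_rfl hK hS0
    hM₁ hM₁T hM₂ hM₂T hM₃'1 hM₃'T' hI₁ hI₂ hN₃' hLlo (by omega : 2 ≤ j) hK2 hKj hdec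
    (fun ξ h1 h2 ↦ hR M₁ M₃' hM₁ hM₁T hM₃'1 hM₃'T I₁ hI₁ ξ h1 h2)
  -- Step C: the bound for `Q̃` and `∫|Ψ|²`
  have hC := Qtil_le hf hfs hf0 hT4 hM₂ hM₂T hM₃'1 hI₂ ha hb hfS hLlo hK₁lo hK₁L (by omega : 2 ≤ j) hK hK2 hKj
  obtain ⟨-, hΨ⟩ := integral_normSq_PsiF_le hf hfs hM₂ hI₂
  -- abbreviations
  set Jt : ℝ := Jfun (fsm L M₂ K T j f) I₂ I₂ K₁ with hJt
  set Qt : ℝ := ∫ x, ktil L M₃' x * ‖PsiF f I₂ x‖ ^ 2 with hQt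
  set Ψ2 : ℝ := ∫ x, ‖PsiF f I₂ x‖ ^ 2 with hΨ2
  have : 0 ≤ Jt := integral_nonneg fun u ↦ sq_nonneg _
  have : 0 ≤ Ψ2 := integral_nonneg fun x ↦ sq_nonneg _
  have hTj := rpow_two_sub_le hT1 hj
  have hT4j := rpow_neg_four_mul_le hT1 hj
  -- Step D: arithmetic
  -- (D1) region I
  have hD1 : 3000000 * K ^ 2 * T ^ η * M₁ * M₂ ^ 4 * M₃' * N1 ^ 2 ≤ 69000000 * K ^ 2 * T ^ η * M ^ 6 * N1 ^ 2 := by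
    calc 3000000 * K ^ 2 * T ^ η * M₁ * M₂ ^ 4 * M₃' * N1 ^ 2
        ≤ 3000000 * K ^ 2 * T ^ η * M * M ^ 4 * (23 * M) * N1 ^ 2 := by gcongr
      _ = 69000000 * K ^ 2 * T ^ η * M ^ 6 * N1 ^ 2 := by ring
  -- (D3) the main term
  have hD3 : 6 * S_II * (4 * K * (2 * M₂ * N2 ^ (1 / 2 : ℝ) * Jt ^ (1 / 2 : ℝ))) ≤
      1152 * C_R * K * T ^ η * M ^ 2 * N2 ^ (1 / 2 : ℝ) * Jt ^ (1 / 2 : ℝ) := by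
    calc 6 * S_II * (4 * K * (2 * M₂ * N2 ^ (1 / 2 : ℝ) * Jt ^ (1 / 2 : ℝ)))
        ≤ 6 * (24 * C_R * T ^ η * M) * (4 * K * (2 * M * N2 ^ (1 / 2 : ℝ) * Jt ^ (1 / 2 : ℝ))) := by gcongr
      _ = _ := by ring
  -- (D4) first negligible term of `Q̃`
  have hD4 : 6 * S_II * (4 * K * (144 * M₂ ^ 4 * (8 * K * L * T ^ ((2 : ℝ) - j)) * N1 ^ 2)) ≤
      2000000 * C_R * K ^ 2 * (T ^ 8)⁻¹ * N1 ^ 2 := by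
    calc 6 * S_II * (4 * K * (144 * M₂ ^ 4 * (8 * K * L * T ^ ((2 : ℝ) - j)) * N1 ^ 2))
        ≤ 6 * (24 * C_R * T * M) * (4 * K * (144 * M ^ 4 * (8 * K * (3 * T ^ 6) * (T ^ 20)⁻¹) * N1 ^ 2)) := by
          gcongr
      _ ≤ 6 * (24 * C_R * T * T) * (4 * K * (144 * T ^ 4 * (8 * K * (3 * T ^ 6) * (T ^ 20)⁻¹) * N1 ^ 2)) := by
          gcongr
      _ = 1990656 * C_R * K ^ 2 * (T ^ 12 * (T ^ 20)⁻¹) * N1 ^ 2 := by ring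
      _ = 1990656 * C_R * K ^ 2 * (T ^ 8)⁻¹ * N1 ^ 2 := by field_simp
      _ ≤ _ := by gcongr; norm_num
  -- (D5) second negligible term of `Q̃`
  have hD5 : 6 * S_II * (4 * K * (72 * M₂ ^ 3 * ((6 * L + 1) * (2 * K * L * M₂ * T ^ (-(4 * j : ℝ)))) * N1 ^ 2)) ≤
      5000000 * C_R * K ^ 2 * (T ^ 8)⁻¹ * N1 ^ 2 := by
    calc 6 * S_II * (4 * K * (72 * M₂ ^ 3 * ((6 * L + 1) * (2 * K * L * M₂ * T ^ (-(4 * j : ℝ)))) * N1 ^ 2))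
        ≤ 6 * (24 * C_R * T * M) * (4 * K * (72 * M ^ 3 * ((19 * T ^ 6) * (2 * K * (3 * T ^ 6) * M * (T ^ 26)⁻¹)) * N1 ^ 2)) := by
          gcongr
      _ ≤ 6 * (24 * C_R * T * T) * (4 * K * (72 * T ^ 3 * ((19 * T ^ 6) * (2 * K * (3 * T ^ 6) * T * (T ^ 26)⁻¹)) * N1 ^ 2)) := by
          gcongr
      _ = 4727808 * C_R * K ^ 2 * (T ^ 18 * (T ^ 26)⁻¹) * N1 ^ 2 := by ring
      _ = 4727808 * C_R * K ^ 2 * (T ^ 8)⁻¹ * N1 ^ 2 := by field_simp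
      _ ≤ _ := by gcongr; norm_num
  -- (D6) the `ε_t ∫|Ψ|²` term
  have hD6 : 6 * S_II * (8 * K * M₃' * T ^ ((2 : ℝ) - j) * Ψ2) ≤ 2000000 * C_R * K * (T ^ 8)⁻¹ * N2 := by
    calc 6 * S_II * (8 * K * M₃' * T ^ ((2 : ℝ) - j) * Ψ2)
        ≤ 6 * (24 * C_R * T * M) * (8 * K * (23 * M) * (T ^ 20)⁻¹ * (72 * M₂ ^ 3 * N2)) := by gcongr
      _ ≤ 6 * (24 * C_R * T * T) * (8 * K * (23 * T) * (T ^ 20)⁻¹ * (72 * T ^ 3 * N2)) := by gcongr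
      _ = 1907712 * C_R * K * (T ^ 6 * (T ^ 20)⁻¹) * N2 := by ring
      _ ≤ 1907712 * C_R * K * (T ^ 8)⁻¹ * N2 := by
          have h1 : T ^ 6 * (T ^ 20)⁻¹ ≤ (T ^ 8)⁻¹ := by
            rw [← div_eq_mul_inv, div_le_iff₀ (by positivity), ← div_eq_inv_mul, le_div_iff₀ (by positivity)]
            calc T ^ 6 * T ^ 8 = T ^ 14 * 1 := by ring
              _ ≤ T ^ 14 * T ^ 6 := by gcongr; exact one_le_pow₀ hT1
              _ = T ^ 20 := by ring
          gcongr
      _ ≤ _ := by gcongr; norm_num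
  -- (D7) region III
  have hD7 : (10 : ℝ) ^ 18 * K ^ 2 * T ^ (-(8 : ℝ)) * N1 ^ 2 = (10 : ℝ) ^ 18 * K ^ 2 * (T ^ 8)⁻¹ * N1 ^ 2 := by
    rw [Real.rpow_neg hT0.le, show (8 : ℝ) = ((8 : ℕ) : ℝ) by norm_num, Real.rpow_natCast]
  -- combine
  have hQ' : 6 * S_II * (Qt + 8 * K * M₃' * T ^ ((2 : ℝ) - j) * Ψ2) ≤
      6 * S_II * (4 * K * (2 * M₂ * N2 ^ (1 / 2 : ℝ) * Jt ^ (1 / 2 : ℝ))) +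
      6 * S_II * (4 * K * (144 * M₂ ^ 4 * (8 * K * L * T ^ ((2 : ℝ) - j)) * N1 ^ 2)) +
      6 * S_II * (4 * K * (72 * M₂ ^ 3 * ((6 * L + 1) * (2 * K * L * M₂ * T ^ (-(4 * j : ℝ)))) * N1 ^ 2)) +
      6 * S_II * (8 * K * M₃' * T ^ ((2 : ℝ) - j) * Ψ2) := by
    have h1 : 6 * S_II * Qt ≤ 6 * S_II * (4 * K * (2 * M₂ * N2 ^ (1 / 2 : ℝ) * Jt ^ (1 / 2 : ℝ) +
        144 * M₂ ^ 4 * (8 * K * L * T ^ ((2 : ℝ) - j)) * N1 ^ 2 +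
        72 * M₂ ^ 3 * ((6 * L + 1) * (2 * K * L * M₂ * T ^ (-(4 * j : ℝ)))) * N1 ^ 2)) :=
      mul_le_mul_of_nonneg_left hC (by positivity)
    nlinarith [h1]
  have hnegl : 2000000 * C_R * K ^ 2 * (T ^ 8)⁻¹ * N1 ^ 2 + 5000000 * C_R * K ^ 2 * (T ^ 8)⁻¹ * N1 ^ 2 +
      2000000 * C_R * K * (T ^ 8)⁻¹ * N2 + (10 : ℝ) ^ 18 * K ^ 2 * (T ^ 8)⁻¹ * N1 ^ 2 ≤
      (10 ^ 7 * C_R * K ^ 2 + 10 ^ 7 * C_R * K + 10 ^ 18 * K ^ 2) * (T ^ 8)⁻¹ * (N1 ^ 2 + N2) := by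
    have hP8 : 0 ≤ (T ^ 8)⁻¹ := by positivity
    nlinarith [mul_nonneg (mul_nonneg (mul_nonneg hCR (sq_nonneg K)) hP8) hN20,
      mul_nonneg (mul_nonneg (mul_nonneg hCR (sq_nonneg K)) hP8) (sq_nonneg N1),
      mul_nonneg (mul_nonneg (mul_nonneg hCR hK) hP8) (sq_nonneg N1),
      mul_nonneg (mul_nonneg (mul_nonneg hCR hK) hP8) hN20,
      mul_nonneg (mul_nonneg (sq_nonneg K) hP8) hN20]
  have htotal := hA.trans hB
  rw [hD7] at htotal
  linarith [hQ', hD1, hD3, hD4, hD5, hD6, hnegl, htotal]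

end step

/-! ## §4. Proposition 9.1 by iteration -/

section iteration

variable {η' K C_R T M : ℝ} {j k₀ : ℕ}

set_option maxHeartbeats 3200000 in
/-- **The iteration** (proof of Proposition 9.1 from Lemma 9.2, the paper's downward induction on `ε`):
under the standing hypotheses of `J_step` at height `T ≥ 23` with `T² ≥ 32k₀`, for every `d ≤ k₀`, every
smooth `f ≥ 0` supported in `[1/16 − (k₀−d)T^{-2}, 9/2 + (k₀−d)T^{-2}]` with `|f̂(ζ)| ≤ T²‖f‖₁(T/|ζ|)⁴` and
every configuration of size `M`:
`J(f) ≤ Γ^d · 6·10⁶ · T^{2η' + 3·2^{-d}} (M⁶‖f‖₁² + M⁴‖f‖₂²)` with `Γ = 1 + 𝔄 + 8K𝔅 + ℭ`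
(the exponents obey `a_{d+1} = η' + a_d/2`, starting from the trivial bound `a₀ = 3 ≤ 2η' + 3`).
[cite: GuthMaynard2026, proof of Proposition 9.1] -/
theorem J_iterate (hη : 0 < η') (hη1 : η' ≤ 1) (hj : 22 ≤ j) (hK : 0 ≤ K)
    (hK2 : ∀ y, ‖𝓕 psi1c y‖ ≤ K / (1 + |y|) ^ 2) (hKj : ∀ y, ‖𝓕 psi1c y‖ ≤ K / (1 + |y|) ^ j)
    (hCR : 0 ≤ C_R)
    (hR : ∀ (M₁ M₃' : ℝ), 1 ≤ M₁ → M₁ ≤ T → 1 ≤ M₃' → M₃' ≤ T ^ 2 →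
      ∀ (I₁ : Finset ℤ), (∀ m ∈ I₁, M₁ ≤ |(m : ℝ)| ∧ |(m : ℝ)| ≤ 2 * M₁) →
      ∀ ξ : ℝ, T ^ η' * M₁ / M₃' < |ξ| → |ξ| ≤ T ^ 6 →
      ∑ m₁ ∈ I₁, perK (𝓕 psi1c) M₃' (ξ / m₁) ≤ C_R * T ^ η' * (M₁ + M₃'))
    (hT : 23 ≤ T) (_hTk : 32 * (k₀ : ℝ) ≤ T ^ 2) (hM : 1 ≤ M) (hMT : M ≤ T) :
    ∀ d : ℕ, d ≤ k₀ → ∀ (f : ℝ → ℝ), ContDiff ℝ ∞ f → HasCompactSupport f → (∀ x, 0 ≤ f x) →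
      (∀ x, f x ≠ 0 → 1 / 16 - ((k₀ : ℝ) - d) * (T ^ 2)⁻¹ ≤ x ∧ x ≤ 9 / 2 + ((k₀ : ℝ) - d) * (T ^ 2)⁻¹) →
      (∀ ζ : ℝ, ζ ≠ 0 → ‖𝓕 (fun y ↦ ((f y : ℝ) : ℂ)) ζ‖ ≤ T ^ 2 * (∫ y, f y) * (T / |ζ|) ^ 4) →
      ∀ (I₁ I₂ : Finset ℤ) (M₁ M₂ : ℝ) (M₃ : ℕ), 1 ≤ M₁ → M₁ ≤ M → 1 ≤ M₂ → M₂ ≤ M → (M₃ : ℝ) ≤ 23 * M →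
      (∀ m ∈ I₁, M₁ ≤ |(m : ℝ)| ∧ |(m : ℝ)| ≤ 2 * M₁) → (∀ m ∈ I₂, M₂ ≤ |(m : ℝ)| ∧ |(m : ℝ)| ≤ 2 * M₂) →
      Jfun f I₁ I₂ M₃ ≤
        ((1 + 69000000 * K ^ 2 + 8 * K * (1152 * C_R * K) +
            (10 ^ 7 * C_R * K ^ 2 + 10 ^ 7 * C_R * K + 10 ^ 18 * K ^ 2)) ^ d * 6000000) *
          T ^ (2 * η' + 3 * (1 / 2 : ℝ) ^ d) * (M ^ 6 * (∫ y, f y) ^ 2 + M ^ 4 * ∫ y, f y ^ 2) := by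
  have hT1 : 1 ≤ T := by linarith
  have hT0 : 0 < T := by linarith
  set 𝔄 : ℝ := 69000000 * K ^ 2 with h𝔄
  set 𝔅 : ℝ := 1152 * C_R * K with h𝔅
  set ℭ : ℝ := 10 ^ 7 * C_R * K ^ 2 + 10 ^ 7 * C_R * K + 10 ^ 18 * K ^ 2 with hℭ
  have h𝔄0 : 0 ≤ 𝔄 := by rw [h𝔄]; positivity
  have h𝔅0 : 0 ≤ 𝔅 := by rw [h𝔅]; positivity
  have hℭ0 : 0 ≤ ℭ := by rw [hℭ]; positivity
  set Γ : ℝ := 1 + 𝔄 + 8 * K * 𝔅 + ℭ with hΓ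
  have hΓ1 : 1 ≤ Γ := by rw [hΓ]; nlinarith [mul_nonneg (mul_nonneg (by norm_num : (0:ℝ) ≤ 8) hK) h𝔅0]
  intro d
  induction d with
  | zero =>
      intro _ f hf hfs hf0 _ _ I₁ I₂ M₁ M₂ M₃ hM₁ hM₁M hM₂ hM₂M hM₃ hI₁ hI₂
      have h := Jfun_trivial' hf hfs hM₁ hM₁M hM₂ hM₂M hI₁ hI₂ hM₃
      simp only [pow_zero, one_mul, mul_one]
      have hN20 : 0 ≤ ∫ y, f y ^ 2 := integral_nonneg fun y ↦ sq_nonneg _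
      have hM7 : M ^ 7 ≤ T ^ (2 * η' + 3) * M ^ 4 := by
        have h3 : T ^ 3 ≤ T ^ (2 * η' + 3) := by
          calc T ^ 3 = T ^ ((3 : ℕ) : ℝ) := (Real.rpow_natCast T 3).symm
            _ ≤ T ^ (2 * η' + 3) := Real.rpow_le_rpow_of_exponent_le hT1 (by push_cast; linarith)
        calc M ^ 7 = M ^ 3 * M ^ 4 := by ring
          _ ≤ T ^ 3 * M ^ 4 := by gcongr
          _ ≤ T ^ (2 * η' + 3) * M ^ 4 := by gcongr
      calc Jfun f I₁ I₂ M₃ ≤ 6000000 * M ^ 7 * ∫ y, f y ^ 2 := h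
        _ ≤ 6000000 * (T ^ (2 * η' + 3) * M ^ 4) * ∫ y, f y ^ 2 := by gcongr
        _ = 6000000 * T ^ (2 * η' + 3) * (M ^ 4 * ∫ y, f y ^ 2) := by ring
        _ ≤ 6000000 * T ^ (2 * η' + 3) * (M ^ 6 * (∫ y, f y) ^ 2 + M ^ 4 * ∫ y, f y ^ 2) := by
            gcongr
            have : 0 ≤ M ^ 6 * (∫ y, f y) ^ 2 := by positivity
            linarith
  | succ d ih =>
      intro hd f hf hfs hf0 hfS hdec I₁ I₂ M₁ M₂ M₃ hM₁ hM₁M hM₂ hM₂M hM₃ hI₁ hI₂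
      have hd' : d ≤ k₀ := by omega
      -- the support interval at this level
      set a : ℝ := 1 / 16 - ((k₀ : ℝ) - (d + 1 : ℕ)) * (T ^ 2)⁻¹ with ha
      set b : ℝ := 9 / 2 + ((k₀ : ℝ) - (d + 1 : ℕ)) * (T ^ 2)⁻¹ with hb
      have hkT : ((k₀ : ℝ) - (d + 1 : ℕ)) * (T ^ 2)⁻¹ ≤ 1 / 32 := by
        have h1 : ((k₀ : ℝ) - (d + 1 : ℕ)) * (T ^ 2)⁻¹ ≤ (k₀ : ℝ) * (T ^ 2)⁻¹ := by
          gcongr; push_cast; linarith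
        have h2 : (k₀ : ℝ) * (T ^ 2)⁻¹ ≤ 1 / 32 := by
          rw [← div_eq_mul_inv, div_le_iff₀ (by positivity)]; linarith
        linarith
      have ha0 : 0 ≤ a := by simp only [ha]; linarith
      have hb5 : b ≤ 5 := by simp only [hb]; linarith
      -- Lemma 9.2
      have hstep := J_step hf hfs hf0 hη hη1 hj hK hK2 hKj hCR hR hT hM hMT hM₁ hM₁M hM₂ hM₂M hM₃ hI₁ hI₂
        ha0 hb5 hfS hdec
      -- the smoothed function and the induction hypothesis
      set L : ℕ := ⌈T ^ 6 + T⌉₊ with hL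
      set K₁ : ℕ := ⌈22 * M₂⌉₊ with hK₁
      have hLr0 : (0 : ℝ) ≤ L := Nat.cast_nonneg _
      have hLr1 : (1 : ℝ) ≤ L := by
        have : T ^ 6 + T ≤ (L : ℝ) := by rw [hL]; exact Nat.le_ceil _
        have h6 : (1 : ℝ) ≤ T ^ 6 := one_le_pow₀ hT1
        linarith
      have hM₂0 : 0 ≤ M₂ := by linarith
      set fs : ℝ → ℝ := fsm L M₂ K T j f with hfsdef
      have hfs_c : ContDiff ℝ ∞ fs := fsm_contDiff hf hfs hLr0 hM₂0 hK T j
      have hfs_s : HasCompactSupport fs := hasCompactSupport_fsm hfs L M₂ K T j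
      have hfs_0 : ∀ x, 0 ≤ fs x := fsm_nonneg hf0 hLr0 hM₂0 hK T j
      set ρ1 : ℝ := ∫ z, rhoT L M₂ K T j z with hρ1
      have hρ10 : 0 ≤ ρ1 := integral_rhoT_nonneg hLr0 hM₂0 hK T j
      have hρ18 : ρ1 ≤ 8 * K := integral_rhoT_le (by linarith) (by linarith) hK T (by omega)
      have hfs_1 : ∫ c, fs c = ρ1 * ∫ y, f y := integral_fsm hf hfs hLr0 hM₂0 hK T j
      have hfs_2 : ∫ c, fs c ^ 2 ≤ ρ1 ^ 2 * ∫ y, f y ^ 2 := integral_fsm_sq_le hf hfs hf0 hLr0 hM₂0 hK T j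
      have hfs_S : ∀ x, fs x ≠ 0 →
          1 / 16 - ((k₀ : ℝ) - d) * (T ^ 2)⁻¹ ≤ x ∧ x ≤ 9 / 2 + ((k₀ : ℝ) - d) * (T ^ 2)⁻¹ := by
        intro x hx
        by_contra hcon
        apply hx
        apply fsm_eq_zero_of_notMem L M₂ K T j hfS
        intro h
        apply hcon
        simp only [ha, hb] at h
        push_cast at h
        constructor <;> nlinarith [h.1, h.2]
      have hfs_dec : ∀ ζ : ℝ, ζ ≠ 0 → ‖𝓕 (fun y ↦ ((fs y : ℝ) : ℂ)) ζ‖ ≤ T ^ 2 * (∫ y, fs y) * (T / |ζ|) ^ 4 := by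
        intro ζ hζ
        calc ‖𝓕 (fun y ↦ ((fs y : ℝ) : ℂ)) ζ‖ ≤ ρ1 * ‖𝓕 (fun y ↦ ((f y : ℝ) : ℂ)) ζ‖ :=
              norm_fourier_fsm_le hf hfs hLr0 hM₂0 hK T j ζ
          _ ≤ ρ1 * (T ^ 2 * (∫ y, f y) * (T / |ζ|) ^ 4) := mul_le_mul_of_nonneg_left (hdec ζ hζ) hρ10
          _ = T ^ 2 * (∫ y, fs y) * (T / |ζ|) ^ 4 := by rw [hfs_1]; ring
      have hK₁hi : (K₁ : ℝ) ≤ 23 * M := by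
        have h1 : (K₁ : ℝ) < 22 * M₂ + 1 := by rw [hK₁]; exact Nat.ceil_lt_add_one (by positivity)
        linarith
      have hIH := ih hd' fs hfs_c hfs_s hfs_0 hfs_S hfs_dec I₂ I₂ M₂ M₂ K₁ hM₂ hM₂M hM₂ hM₂M hK₁hi hI₂ hI₂
      -- bookkeeping
      set cd : ℝ := Γ ^ d * 6000000 with hcd
      have hcd1 : 1 ≤ cd := by
        rw [hcd]; nlinarith [one_le_pow₀ (n := d) hΓ1]
      have hcd0 : 0 ≤ cd := by linarith
      set ad : ℝ := 2 * η' + 3 * (1 / 2 : ℝ) ^ d with had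
      have had0 : 0 ≤ ad := by rw [had]; positivity
      set N1 : ℝ := ∫ y, f y with hN1
      set N2 : ℝ := ∫ y, f y ^ 2 with hN2
      have : 0 ≤ N1 := integral_nonneg hf0
      have hN20 : 0 ≤ N2 := integral_nonneg fun y ↦ sq_nonneg _
      set Z : ℝ := M ^ 6 * N1 ^ 2 + M ^ 4 * N2 with hZ
      have hZ0 : 0 ≤ Z := by rw [hZ]; positivity
      -- `J(f̃) ≤ c_d T^{a_d} 64K² Z`
      have hJt : Jfun fs I₂ I₂ K₁ ≤ cd * T ^ ad * (64 * K ^ 2 * Z) := by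
        refine hIH.trans ?_
        have h1 : M ^ 6 * (∫ y, fs y) ^ 2 + M ^ 4 * ∫ y, fs y ^ 2 ≤ 64 * K ^ 2 * Z := by
          rw [hfs_1]
          have h2 : (ρ1 * N1) ^ 2 ≤ (8 * K) ^ 2 * N1 ^ 2 := by
            rw [mul_pow]; gcongr
          have h3 : ∫ y, fs y ^ 2 ≤ (8 * K) ^ 2 * N2 := hfs_2.trans (by gcongr)
          calc M ^ 6 * (ρ1 * N1) ^ 2 + M ^ 4 * ∫ y, fs y ^ 2
              ≤ M ^ 6 * ((8 * K) ^ 2 * N1 ^ 2) + M ^ 4 * ((8 * K) ^ 2 * N2) := by gcongr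
            _ = 64 * K ^ 2 * Z := by simp only [hZ]; ring
        exact mul_le_mul_of_nonneg_left h1 (by positivity)
      have hJt0 : 0 ≤ Jfun fs I₂ I₂ K₁ := integral_nonneg fun u ↦ sq_nonneg _
      -- the middle term: `M² ‖f‖₂ J̃^{1/2} ≤ 8K c_d T^{a_d/2} Z` (using `√c_d ≤ c_d`)
      have hmid : M ^ 2 * N2 ^ (1 / 2 : ℝ) * (Jfun fs I₂ I₂ K₁) ^ (1 / 2 : ℝ) ≤
          8 * K * cd * T ^ (ad / 2) * Z := by
        have hM0 : 0 ≤ M := by linarith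
        have h1 : M ^ 2 * N2 ^ (1 / 2 : ℝ) ≤ Z ^ (1 / 2 : ℝ) := by
          have e1 : M ^ 2 * N2 ^ (1 / 2 : ℝ) = (M ^ 4 * N2) ^ (1 / 2 : ℝ) := by
            rw [Real.mul_rpow (by positivity) hN20, show M ^ 4 = (M ^ 2) ^ 2 by ring,
              ← Real.sqrt_eq_rpow ((M ^ 2) ^ 2), Real.sqrt_sq (by positivity)]
          have hle : M ^ 4 * N2 ≤ Z := by
            simp only [hZ]
            have : 0 ≤ M ^ 6 * N1 ^ 2 := by positivity
            linarith
          rw [e1]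
          exact Real.rpow_le_rpow (by positivity) hle (by norm_num)
        have h2 : (Jfun fs I₂ I₂ K₁) ^ (1 / 2 : ℝ) ≤ (cd * T ^ ad * (64 * K ^ 2 * Z)) ^ (1 / 2 : ℝ) :=
          Real.rpow_le_rpow hJt0 hJt (by norm_num)
        have h3 : (cd * T ^ ad * (64 * K ^ 2 * Z)) ^ (1 / 2 : ℝ) =
            cd ^ (1 / 2 : ℝ) * T ^ (ad / 2) * (8 * K) * Z ^ (1 / 2 : ℝ) := by
          have e64 : (64 * K ^ 2 : ℝ) ^ (1 / 2 : ℝ) = 8 * K := by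
            rw [show (64 * K ^ 2 : ℝ) = (8 * K) ^ 2 by ring, ← Real.sqrt_eq_rpow ((8 * K) ^ 2),
              Real.sqrt_sq (by positivity)]
          have eT : (T ^ ad) ^ (1 / 2 : ℝ) = T ^ (ad / 2) := by
            rw [← Real.rpow_mul hT0.le]; congr 1; ring
          rw [Real.mul_rpow (by positivity) (by positivity), Real.mul_rpow hcd0 (by positivity),
            Real.mul_rpow (by positivity) hZ0, e64, eT]
          ring
        have h4 : cd ^ (1 / 2 : ℝ) ≤ cd := by
          calc cd ^ (1 / 2 : ℝ) ≤ cd ^ (1 : ℝ) := Real.rpow_le_rpow_of_exponent_le hcd1 (by norm_num)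
            _ = cd := Real.rpow_one cd
        calc M ^ 2 * N2 ^ (1 / 2 : ℝ) * (Jfun fs I₂ I₂ K₁) ^ (1 / 2 : ℝ)
            ≤ Z ^ (1 / 2 : ℝ) * (cd ^ (1 / 2 : ℝ) * T ^ (ad / 2) * (8 * K) * Z ^ (1 / 2 : ℝ)) := by
              rw [← h3]; exact mul_le_mul h1 h2 (by positivity) (by positivity)
          _ = 8 * K * cd ^ (1 / 2 : ℝ) * T ^ (ad / 2) * (Z ^ (1 / 2 : ℝ) * Z ^ (1 / 2 : ℝ)) := by ring
          _ = 8 * K * cd ^ (1 / 2 : ℝ) * T ^ (ad / 2) * Z := by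
              rw [← Real.rpow_add_of_nonneg hZ0 (by norm_num) (by norm_num)]; norm_num
          _ ≤ 8 * K * cd * T ^ (ad / 2) * Z := by gcongr
      -- powers of `T`: the new exponent is `η' + a_d/2`
      have hnew : 2 * η' + 3 * (1 / 2 : ℝ) ^ (d + 1) = η' + ad / 2 := by
        rw [had, pow_succ]; ring
      have hTpow : T ^ η' * T ^ (ad / 2) = T ^ (2 * η' + 3 * (1 / 2 : ℝ) ^ (d + 1)) := by
        rw [hnew, Real.rpow_add hT0]
      have hTη_le : T ^ η' ≤ T ^ (2 * η' + 3 * (1 / 2 : ℝ) ^ (d + 1)) :=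
        Real.rpow_le_rpow_of_exponent_le hT1 (by rw [hnew]; linarith)
      have hT8_le : (T ^ 8)⁻¹ ≤ T ^ (2 * η' + 3 * (1 / 2 : ℝ) ^ (d + 1)) := by
        calc (T ^ 8)⁻¹ ≤ 1 := inv_le_one_of_one_le₀ (one_le_pow₀ hT1)
          _ ≤ T ^ (2 * η' + 3 * (1 / 2 : ℝ) ^ (d + 1)) := Real.one_le_rpow hT1 (by rw [hnew]; positivity)
      -- assemble
      have hN1Z : M ^ 6 * N1 ^ 2 ≤ Z := by
        have : 0 ≤ M ^ 4 * N2 := by positivity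
        simp only [hZ]; linarith
      have hN12Z : N1 ^ 2 + N2 ≤ Z := by
        simp only [hZ]
        have h4 : (1 : ℝ) ≤ M ^ 4 := one_le_pow₀ hM
        have h6 : (1 : ℝ) ≤ M ^ 6 := one_le_pow₀ hM
        nlinarith
      have hconst : 𝔄 + 𝔅 * (8 * K * cd) + ℭ ≤ Γ ^ (d + 1) * 6000000 := by
        have e : Γ ^ (d + 1) * 6000000 = Γ * cd := by rw [hcd, pow_succ]; ring
        rw [e, hΓ]
        nlinarith [mul_nonneg h𝔄0 (by linarith : (0:ℝ) ≤ cd - 1), mul_nonneg hℭ0 (by linarith : (0:ℝ) ≤ cd - 1),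
          mul_nonneg (mul_nonneg (by norm_num : (0:ℝ) ≤ 8) hK) h𝔅0]
      have hTZ0 : 0 ≤ T ^ (2 * η' + 3 * (1 / 2 : ℝ) ^ (d + 1)) * Z := by positivity
      calc Jfun f I₁ I₂ M₃
          ≤ 𝔄 * T ^ η' * M ^ 6 * N1 ^ 2 + 𝔅 * T ^ η' * M ^ 2 * N2 ^ (1 / 2 : ℝ) * (Jfun fs I₂ I₂ K₁) ^ (1 / 2 : ℝ) +
              ℭ * (T ^ 8)⁻¹ * (N1 ^ 2 + N2) := by
            have := hstep
            simp only [h𝔄, h𝔅, hℭ]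
            linarith [this]
        _ = 𝔄 * T ^ η' * (M ^ 6 * N1 ^ 2) + 𝔅 * T ^ η' * (M ^ 2 * N2 ^ (1 / 2 : ℝ) * (Jfun fs I₂ I₂ K₁) ^ (1 / 2 : ℝ)) +
              ℭ * (T ^ 8)⁻¹ * (N1 ^ 2 + N2) := by ring
        _ ≤ 𝔄 * T ^ (2 * η' + 3 * (1 / 2 : ℝ) ^ (d + 1)) * Z + 𝔅 * T ^ η' * (8 * K * cd * T ^ (ad / 2) * Z) +
              ℭ * T ^ (2 * η' + 3 * (1 / 2 : ℝ) ^ (d + 1)) * Z := by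
            gcongr
        _ = (𝔄 + 𝔅 * (8 * K * cd) + ℭ) * (T ^ (2 * η' + 3 * (1 / 2 : ℝ) ^ (d + 1)) * Z) := by
            rw [← hTpow]; ring
        _ ≤ (Γ ^ (d + 1) * 6000000) * (T ^ (2 * η' + 3 * (1 / 2 : ℝ) ^ (d + 1)) * Z) :=
            mul_le_mul_of_nonneg_right hconst hTZ0
        _ = _ := by ring

end iteration

/-- **Guth–Maynard Proposition 9.1 (equidistribution over affine transformations)**, quantitative form
for the class used in §10: for every `0 < η ≤ 1` there are `C ≥ 0` and `T₀` such that for all `T ≥ T₀`,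
`1 ≤ M ≤ T`, all smooth `f ≥ 0` supported in `[1/16, 9/2]` with `|f̂(ζ)| ≤ T²‖f‖₁(T/|ζ|)⁴` (`ζ ≠ 0`), and
all `I₁ ⊂ {M₁ ≤ |m| ≤ 2M₁}`, `I₂ ⊂ {M₂ ≤ |m| ≤ 2M₂}` with `1 ≤ M₁, M₂ ≤ M` and `M₃ ≤ 23M`:
`J(f; I₁, I₂, M₃) ≤ C T^η (M⁶ ‖f‖₁² + M⁴ ‖f‖₂²)`. [cite: GuthMaynard2026, Proposition 9.1] -/
theorem affine_equidistribution {η : ℝ} (hη : 0 < η) (hη1 : η ≤ 1) :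
    ∃ C T₀ : ℝ, 0 ≤ C ∧ ∀ T : ℝ, T₀ ≤ T → ∀ M : ℝ, 1 ≤ M → M ≤ T →
      ∀ f : ℝ → ℝ, ContDiff ℝ ∞ f → HasCompactSupport f → (∀ x, 0 ≤ f x) →
      (∀ x, f x ≠ 0 → 1 / 16 ≤ x ∧ x ≤ 9 / 2) →
      (∀ ζ : ℝ, ζ ≠ 0 → ‖𝓕 (fun y ↦ ((f y : ℝ) : ℂ)) ζ‖ ≤ T ^ 2 * (∫ y, f y) * (T / |ζ|) ^ 4) →
      ∀ (I₁ I₂ : Finset ℤ) (M₁ M₂ : ℝ) (M₃ : ℕ), 1 ≤ M₁ → M₁ ≤ M → 1 ≤ M₂ → M₂ ≤ M → (M₃ : ℝ) ≤ 23 * M →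
      (∀ m ∈ I₁, M₁ ≤ |(m : ℝ)| ∧ |(m : ℝ)| ≤ 2 * M₁) → (∀ m ∈ I₂, M₂ ≤ |(m : ℝ)| ∧ |(m : ℝ)| ≤ 2 * M₂) →
      Jfun f I₁ I₂ M₃ ≤ C * T ^ η * (M ^ 6 * (∫ y, f y) ^ 2 + M ^ 4 * ∫ y, f y ^ 2) := by
  -- parameters
  set η' : ℝ := η / 3 with hη'
  have hη'0 : 0 < η' := by rw [hη']; positivity
  have hη'1 : η' ≤ 1 := by simp only [hη']; linarith
  set j : ℕ := ⌈4 / η'⌉₊ + 24 with hj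
  have hj22 : 22 ≤ j := by omega
  have hjη : 4 ≤ η' * (j - 2) := by
    have h1 : (4 / η' : ℝ) ≤ ⌈4 / η'⌉₊ := Nat.le_ceil _
    have h2 : ((j : ℕ) : ℝ) = (⌈4 / η'⌉₊ : ℝ) + 24 := by simp [hj]
    rw [h2]
    have h3 : η' * (4 / η') = 4 := by field_simp
    nlinarith
  obtain ⟨K₂, hK₂0, hK₂⟩ := exists_psi1_fourier_decay 2
  obtain ⟨Kj, hKj0, hKj⟩ := exists_psi1_fourier_decay j
  set K : ℝ := max K₂ Kj with hK
  have hK0 : 0 ≤ K := hK₂0.trans (le_max_left _ _)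
  have hK2' : ∀ y, ‖𝓕 psi1c y‖ ≤ K / (1 + |y|) ^ 2 := fun y ↦ (hK₂ y).trans (by
    gcongr; exact le_max_left _ _)
  have hKj' : ∀ y, ‖𝓕 psi1c y‖ ≤ K / (1 + |y|) ^ j := fun y ↦ (hKj y).trans (by
    gcongr; exact le_max_right _ _)
  obtain ⟨C_R, hCR0, hCR⟩ := sum_perK_le_regionII hη'0 hη'1 (by omega : 2 ≤ j) hjη
  set k₀ : ℕ := ⌈3 / η'⌉₊ with hk₀
  set 𝔄 : ℝ := 69000000 * K ^ 2 with h𝔄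
  set 𝔅 : ℝ := 1152 * C_R * K with h𝔅
  set ℭ : ℝ := 10 ^ 7 * C_R * K ^ 2 + 10 ^ 7 * C_R * K + 10 ^ 18 * K ^ 2 with hℭ
  have h𝔄0 : 0 ≤ 𝔄 := by rw [h𝔄]; positivity
  have h𝔅0 : 0 ≤ 𝔅 := by rw [h𝔅]; positivity
  have hℭ0 : 0 ≤ ℭ := by rw [hℭ]; positivity
  set Γ : ℝ := 1 + 𝔄 + 8 * K * 𝔅 + ℭ with hΓ
  have hΓ0 : 0 ≤ Γ := by rw [hΓ]; positivity
  set C : ℝ := Γ ^ k₀ * 6000000 with hC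
  have hC0 : 0 ≤ C := by rw [hC]; positivity
  set T₀ : ℝ := max (max 23 ((4 : ℝ) ^ (2 / η'))) (32 * k₀ + 1) with hT₀
  refine ⟨C, T₀, hC0, ?_⟩
  intro T hT M hM hMT f hf hfs hf0 hfS hdec I₁ I₂ M₁ M₂ M₃ hM₁ hM₁M hM₂ hM₂M hM₃ hI₁ hI₂
  have hT23 : 23 ≤ T := le_trans (le_trans (le_max_left _ _) (le_max_left _ _)) hT
  have hT1 : 1 ≤ T := by linarith
  have hT4η : (4 : ℝ) ^ (2 / η') ≤ T := le_trans (le_trans (le_max_right _ _) (le_max_left _ _)) hT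
  have hTk : 32 * (k₀ : ℝ) ≤ T ^ 2 := by
    have h1 : 32 * (k₀ : ℝ) + 1 ≤ T := le_trans (le_max_right _ _) hT
    nlinarith
  -- region II at this height
  have hR : ∀ (M₁ M₃' : ℝ), 1 ≤ M₁ → M₁ ≤ T → 1 ≤ M₃' → M₃' ≤ T ^ 2 →
      ∀ (I₁ : Finset ℤ), (∀ m ∈ I₁, M₁ ≤ |(m : ℝ)| ∧ |(m : ℝ)| ≤ 2 * M₁) →
      ∀ ξ : ℝ, T ^ η' * M₁ / M₃' < |ξ| → |ξ| ≤ T ^ 6 →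
      ∑ m₁ ∈ I₁, perK (𝓕 psi1c) M₃' (ξ / m₁) ≤ C_R * T ^ η' * (M₁ + M₃') :=
    fun M₁ M₃' h1 h2 h3 h4 I₁ h5 ξ h6 h7 ↦ hCR T hT4η M₁ M₃' h1 h2 h3 h4 I₁ h5 ξ h6 h7
  have hmain := J_iterate hη'0 hη'1 hj22 hK0 hK2' hKj' hCR0 hR hT23 hTk hM hMT k₀ le_rfl f hf hfs hf0
    (fun x hx ↦ by have := hfS x hx; simp only [sub_self, zero_mul, sub_zero, add_zero]; exact this)
    hdec I₁ I₂ M₁ M₂ M₃ hM₁ hM₁M hM₂ hM₂M hM₃ hI₁ hI₂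
  have hmain' : Jfun f I₁ I₂ M₃ ≤ C * T ^ (2 * η' + 3 * (1 / 2 : ℝ) ^ k₀) *
      (M ^ 6 * (∫ y, f y) ^ 2 + M ^ 4 * ∫ y, f y ^ 2) := hmain
  refine hmain'.trans ?_
  have hZ0 : 0 ≤ M ^ 6 * (∫ y, f y) ^ 2 + M ^ 4 * ∫ y, f y ^ 2 := by
    have : 0 ≤ ∫ y, f y ^ 2 := integral_nonneg fun y ↦ sq_nonneg _
    positivity
  refine mul_le_mul_of_nonneg_right (mul_le_mul_of_nonneg_left ?_ hC0) hZ0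
  -- `2η' + 3·2^{-k₀} ≤ η`
  refine Real.rpow_le_rpow_of_exponent_le hT1 ?_
  have h2 : 3 * (1 / 2 : ℝ) ^ k₀ ≤ η' := by
    have hk : (3 / η' : ℝ) ≤ k₀ := Nat.le_ceil _
    have hk2 : (k₀ : ℝ) < 2 ^ k₀ := by exact_mod_cast Nat.lt_two_pow_self
    have hpos : (0 : ℝ) < 2 ^ k₀ := by positivity
    rw [one_div, inv_pow, ← div_eq_mul_inv, div_le_iff₀ hpos]
    rw [div_le_iff₀ hη'0] at hk
    nlinarith
  simp only [hη'] at h2 ⊢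
  linarith

end GuthMaynardAffine

end Literature.NumberTheory.LFunctions

end
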